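import Mathlib
import Literature.MathematicalPhysics.QuantumFieldTheory.Balaban1983to89.T4InputCauchyRateData

/-!
# T4InputCauchyRateSpecies — the INPUT-INTERPOLATION CAUCHY RATE with ONE LIPSCHITZ MODULUS PER INPUT SPECIES: the
# consumed currency of `T4InputCauchyRateData` §11 split into an OPERATOR-species modulus `Λop` and a HISTORY-species
# modulus `Λhist`, the scale recursion re-run with the species kept apart — ONLY `Λhist` multiplies the feedback gain —,
# a toy on which, AT ITS UNIT MARGINS, the single-modulus closure is void while the species closure fires, and (file v1.1)
# the MARGIN GAUGE under which every shape of the route is covariant: the species closure is file v5's single-modulus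
# closure read in the operator-margin gauge `rOp ↦ (Λhist/Λop)·rOp` — same exponent, same constant, the gauge visible only
# in the reach hypothesis — so the species form is the gauge-covariant BOOKKEEPING of v5's estimate, not a sharper one;
# and (file v1.2) the CLASS READING of the two fibre envelopes: a one-run output bound on an admissible input CLASS that
# contains the slack box, plus complex differentiability along complex segments inside the class, IS the pair of envelopes
# — the typed form of "the one-step bound holds for every admissible input, and the actual input sits at depth inside the
# admissible class", with its honest price on the toy (a class bound is species-blind: output size over margin); (file
# v1.2.1, DOCSTRING ERRATUM) the depth is `d = 1 − μ` with `μ` the (1.36)-budget fraction of the actual TOTAL potential —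
# the print backs `μ ≤ 1` only; v1.2's identification `d = 1 − ν` is withdrawn and the census re-tabulated in `(d, ν)`;
# and (file v1.3) SLACK FROM BUDGET + DILATION: Lemma 2's (1.36)-constant is existential, so the budget ball dilated by
# any `λ > 1` contains the slack box by the printed budget `μ ≤ 1` ALONE — no itemization, no unprinted depth — at the
# print-visible price `G ↦ λG`, `ε₁`- and `γ`-thresholds `/λ` (NUMBERS (g″)); (file v1.4) the budget route under the
# margin gauge and a NON-VOID end-to-end instance of the budget closure on the regauged toy (vacuity witness)
# (cell `pub-balaban`, T⁴-continuum fan-out, node U3 / spine estimate NE5, prover seat P1 = "cluster-expansion derivative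
# bound: differentiate the convergent expansion in its inputs and bound term-wise (analyticity strip ⇒ Cauchy estimate)";
# a SIBLING LEAF of `T4InputCauchyRateData` (file v5, frozen), which it imports BY NAME and does not modify)

HONEST FRAMING.  The cell's T4 target is rung (B)+1 (existence AND uniqueness of the ε → 0 limit of Bałaban's unit-scale
expectations on a FIXED finite torus T⁴); NOT infinite volume, NOT a mass gap, NOT the Clay problem.  The conditionals of
the spine (BetaPertH, (B), (B^μ)) are untouched by this module and stay explicit wherever the spine composes (`T4OutputRate`
docstring; T4-DAG §2).  NOTHING printed in the audited papers is asserted here: `DataLipschitz₂` below is a HYPOTHESIS SHAPE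
over the hypothesis-carrying data `T4InputCauchyRateData.StepModel` and the ABSTRACT carriers of `T4OutputRate` (to be ASSUMED
by consumers, never cited as a fact); every `theorem` is kernel-checked complex analysis / real bookkeeping about the shapes of
`T4InputCauchyRateData`, plus a toy instance.  The estimate NE5 itself is NOT PRINTED anywhere in [Balaban1987RG1],
[Balaban1988RG2Cluster], [Balaban1988Convergent] (cell GAPS G-t4-U3-1); this module does not change that, derives no modulus of
any actual step map, and changes NO census value (NUMBERS (f)).  Value = (i) the kernel fact that in the seat's scale recursion
the OPERATOR-species output wall is CONSTANT-ONLY and the HISTORY-species output wall is the only output-side input to the NE5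
EXPONENT (`recursiveRate_of_stepModel_lip₂`: budget `RecursiveRate … (Λop·δ + Λhist·δ′ + B) (Λhist·c)`); (ii) the species
form of the Cauchy discharge with SEPARATE envelope constants (`dataLipschitz₂_of_fibreEnvelopes`: `Λop = Gop/(1 − ρ₀)`,
`Λhist = Ghist/(1 − ρ₀)`); (iii) a toy (§3) on which, AT ITS FIXED UNIT MARGINS, every single modulus of file v5's
`DataLipschitz` is void while the species closure fires; (iv) (file v1.1, §4–§5) the kernel fact that the single/species
distinction is a choice of MARGIN UNITS, not an estimate: under the margin gauge `regauge M s t` (`rOp ↦ s·rOp`,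
`rHist ↦ t·rHist`, everything else unchanged) every shape of the route is covariant — `OperatorRate δ ↦ δ/s`, `InsertionRate
δ′ ↦ δ′/t`, `InsertionDamped(Nat) c ↦ c/t`, `DataLipschitz₂ (Λop, Λhist) ↦ (s·Λop, t·Λhist)` — so the load-bearing products
`Λop·δ`, `Λhist·δ′`, `Λhist·c` are gauge-INVARIANT while v5's single modulus `max Λop Λhist` is not, and the species
closure of §2 is RE-DERIVED from file v5's single-modulus closure `ne5_at_of_stepModel_lip_nat` in the operator-margin gauge
`s = Λhist/Λop` (`ne5_at_of_stepModel_lip₂_nat_of_gauge`: same smallness `ω + Λhist·c < θ′`, same constant; the gauge shows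
ONLY in the reach hypothesis `hnear`, the route's second binder-visible smallness, read with `δ·Λop/Λhist` for `δ`), the
referee's rescaled toy reproduced (`toy₆₄r_ne5_single`: rate 1/2 and constant 992/15 again, §5); with the booking that the
operator-species wall needs NO analyticity at all (`dataLipschitz₂_of_opLipschitz_histFibre`); (v) (file v1.2, §6–§7) the
kernel fact that BOTH fibre envelopes — hence the route's whole output side — follow from three hypothesis shapes closer to
the printed text than the envelopes themselves: `ClassBound K κ G` (the one-run bound at EVERY point of an admissible input
class `K` — the interface reading of [II] §2, which consumes its input potentials only through the class properties of
Lemma 2 p. 11), `ClassLineAnalytic K` (complex differentiability along complex segments inside the class — [analysis] of the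
printed structure (2.14) p. 15) and `BoxInClass K` (the SLACK: the two-margin box around every base point lies in the class —
a depth `d·E₀` of the actual TOTAL potential inside the one (1.36)-budget `E₀` of Lemma 2 p. 11; file v1.2 identified
`d = 1 − ν` from the action-level depth `½E₀` of p. 21 transported to the inserted potentials by homogeneity — WITHDRAWN by
file v1.2.1 (NUMBERS (g′)): the (1.36)-budget is ONE budget for the total `V″` and its itemization among the `𝐏^{(k)}`-part
and Lemma 1's images of the β-terms, the normalization terms and the earlier outputs is NOT PRINTED, so the print backs only
`d = 1 − μ`, `μ ≤ 1`); on the species toy the class route is honestly VOID (`toy₆₄_class_smallness_void`: a class bound is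
species-blind and worth output size over margin), which is the smallness `ν/d` the class reading charges to [II] (NUMBERS
(g)/(g′)); (vi) (file v1.3, §8–§9) the kernel fact that the SLACK needs no depth hypothesis of its own: `BaseBudget`
(every base point within budget of the class centre — printed for [II] as Lemma 2's *"satisfies the bound (1.36)"*,
`μ ≤ 1`) plus ROOM (`budget + margin ≤ class radius`) gives `BaseDepth`, hence `BoxInClass` for the ball class
(`baseDepth_of_baseBudget`, `baseDepth_dilate`, `boxInClass_of_baseBudget`, closure `ne5_at_of_stepModel_budget_scale_nat`);
for [II] the room is FREE OF HYPOTHESIS because the (1.36)-constant `C₁` is existential ([II] p. 9 [R] *"There exist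
absolute constants C₁, C₂, q, for which"*): the budget ball DILATED by `λ > 1` has room `(λ − 1)×budget`, at the
print-visible price `ε₂ ↦ λε₂`, `C₃ ↦ λC₃` (p. 19/p. 20 definitions, both linear in `C₁`) — class envelope `G ↦ λG`, every
`ε₁`-threshold of §2 and, through p. 18, the coupling threshold `γ` divided by `λ` — so the census closes in `ν ∝ ε₁`
alone (NUMBERS (g″): `ν/d ↦ λν/(λ − μ) ≤ 2ν` at `λ = 2`; `a → 1` as `ε₁ → 0`) and the ε₁-independent unprinted constant
of (g′) (cell item S-ne5p1-μ) is DISPENSED WITH; (vii) (file v1.4, §10) gauge covariance of the budget route's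
binders (`regauge_insAffine/insBlind/insHomog/baseBudget/classBound/classLineAnalytic` are `Iff.rfl`,
`insScaleBound_regauge : c ↦ c/t`) and the VACUITY WITNESS `toy₆₄R_ne5_budget`: on `toyModel₆₄R = regauge toyModel₆₄
(1/64) 16` every binder of `ne5_at_of_stepModel_budget_scale_nat` is met non-degenerately (budgets `(0, 1)`, room into
radii `(1/64, 17)`, class constant `18`, reach `1/3`, smallness `43/1024 < 1/2`) and the conclusion is a genuine `NE5`
rate `1/2` — where at unit margins the class route is void (`toy₆₄_class_smallness_void`): the class route is worth
output size over MARGIN and the margin gauge is free, the kernel face of NUMBERS (g″)'s `ν_eff`; NOT summit progress.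

WHY A LEAF (successor menu (d) of the cell record `t4/T4-EST-NE5-P1.md` v6 §18; file v5 of `T4InputCauchyRateData` was
cross-read clean — cell GAPS C-ne5p1-9 / C-pv08g4-8: 0 gap, 0 objection, 0 misquotation, 0 DOCFIX — and stays byte-identical).
File v5 §11 re-typed the one located output-side gap of node U3 in this typing (G-ne5p1-1′, the joint output envelope) in
its printed ONE-PARAMETER form, one input species at a time (`OpFibreEnvelope`, `HistFibreEnvelope` = G-ne5p1-1″), but its
CONSUMED form `DataLipschitz κ Λ ρ₀` and its recursion `recursiveRate_of_stepModel_lip` carry ONE modulus `Λ` for both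
species, so the load-bearing smallness of the route reads `ω + Λc♮ < θ′` with `Λ ≥` the operator-species sensitivity as well.
[analysis] In the recursion the two species are displaced by DIFFERENT mechanisms: the operator data by the two-spacing
operator rate `δθ^k` (MI-1, an INPUT at rate θ, no feedback), the inserted history by the insertion rate `δ′θ^k` (G-ne5p1-4)
PLUS the fed-back earlier discrepancies `c♮·Σ_j ω^{k−1−j}D_j` (MI-3a) — the only displacement that is not a-priori `θ^k`-small.
Hence only the HISTORY-species modulus can enter the ratio of the linear majorant, and the species-separated budget makes this
a kernel statement: `b = Λhist·c` (model normalisation), smallness `ω + Λhist·c♮ < θ′`, constant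
`(Λop·δ + Λhist·δ′ + B)(θ′ − ω)/(θ′ − (ω + Λhist·c♮))`.  The two shapes are inter-derivable up to constants
(`dataLipschitz₂_of_dataLipschitz`, `dataLipschitz_of_dataLipschitz₂` with `Λ = max Λop Λhist`): the species form introduces
no new wall and removes none — it BOOKS which output-side wall is exponent-critical.

FILE v1.1 (generation 8; ADDITIVE: every declaration of §1–§3 is byte-identical to v1/v1.0.1, p187484/p187559 — only this
module docstring is amended and §4–§5 are appended).  Two referee remarks on v1 are answered in the kernel (cell item
GAPS-T4 C-t4r3-17: PROOF AUDIT by seat t4-ref3-g10, verdict ok/CONSISTENT, INFO 2, DOCFIX-LOW 1; the cross-read of v1.0.1,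
cell GAPS C-ne5p1-10 / C-adv4-94, was ok/CONSISTENT with 0 objection, 0 misquotation, 0 DOCFIX).  INFO-1 [the referee's
analysis, confirmed]: the §3 toy decides single-versus-species only at its FIXED unit margins — `Λop·δ` is invariant under a
rescaling of the operator margin, so the species closure equals v5's single-modulus closure with the operator margin
re-chosen (verbatim for reach-independent moduli such as the toy's; in general at the cost of ABSOLUTE operator reach, paid
in `k₀`/`B`, never in the exponent).  §4 types the rescaling as the MARGIN GAUGE `regauge` and proves exactly this
(`dataLipschitz₂_regauge`, `dataLipschitz_gauge`, `ne5_at_of_stepModel_lip₂_nat_of_gauge`); §5 reproduces the referee's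
witness (`toyModel₆₄r = regauge toyModel₆₄ (1/64) 1`, `toy₆₄r_ne5_single`).  What is gauge-INVARIANT — hence what §1–§3 add
over file v5 independently of units — is (α) the exponent-critical census {θ_op, ω, Λhist·c♮} of NUMBERS (f) together with
the constant's `Λop·δ + Λhist·δ′` (v5's `Λ(δ + δ′)`, `Λ = max Λop Λhist`, is its value in ONE gauge), and (β) on the Cauchy
route, whose margins are PINNED to the analyticity radii because an envelope constant does not shrink with the margin
(`opFibreEnvelope_regauge`, `histFibreEnvelope_regauge`: the SAME `G` at margins `s·rOp`, `t·rHist` for `s, t ≤ 1`, so a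
Cauchy modulus transported to a smaller gauge loses the factor `1/s`), the species-by-species DISCHARGE
`dataLipschitz₂_of_fibreEnvelopes` with two DIFFERENT fibre constants `Gop ≠ Ghist` read at the pinned margins — which v5's
diagonal discharge `dataLipschitz_of_fibreEnvelopes` cannot produce in any gauge, a regauged envelope keeping its constant;
the species RECURSION of §2, by contrast, is v5's recursion in another gauge.  INFO-2: besides the load-bearing smallness
`ω + Λhist·c < θ′` (the exponent) every closure of this route carries a SECOND binder-visible smallness, the REACH hypothesis
`hnear : (δ + δ′)θ^{k₀} + c(EA₀ + E₀)/(1 − ω) ≤ ρ₀` — satisfiable by a choice of `k₀` as soon as `c(EA₀ + E₀)/(1 − ω) < ρ₀`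
(`θ < 1`): the two runs'
data must lie within mutual reach of the two-point bound (on the Cauchy route `ρ₀ < 1`, the a-priori NEAR REGIME of
`T4InputCauchyRateData` §7, sized in its NUMBERS (d): history part `≤ 2ν/((λ − 1)(1 − ω))` = 0.107 at ν = ½, λ = 11,
ω = 1/16, by the same printed restriction `ν ≤ ½` as S-ν′; operator part by the choice of `k₀`, the first scales paid in
`B`).  It conditions APPLICABILITY — through `k₀` and `B` — never the exponent, and it is the ONE gauge-dependent line of
the closure (§4: in the operator-margin gauge `s` it reads with `δ/s` for `δ`).  No census value changes.

FILE v1.2 (generation 9; ADDITIVE: every declaration of §1–§5 is byte-identical to v1.1 p188038 — only this module docstring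
is amended and §6–§7 are appended; the cross-read of v1.1, cell GAPS C-ne5p1-11 / C-pv05g13-6, was ok/CONSISTENT with 0
objection, 0 misquotation, 0 DOCFIX, INFO 3 — its I1 is this precision of the v1.1 sentence «bookkeeping, not a sharper one»:
the identity is kernel-proved as `ne5_at_of_stepModel_lip₂_nat_of_gauge` for `0 < Λhist ≤ Λop`; for `Λop ≤ Λhist` file v5's
closure applies with `Λ = Λhist` and NO gauge (`ne5_at_of_stepModel_lip₂_nat_of_single`); the boundary `Λhist = 0` is the
limit `s → 0`, `k₀ → ∞`, not a regauge).  THE CLASS READING (cell wall W2-hist = `HistFibreEnvelope`, the one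
EXPONENT-CRITICAL output-side wall of NUMBERS (f); successor menu of the cell record `t4/T4-EST-NE5-P1.md` v8 §22).
[analysis] The printed text never deforms the inserted history; what it DOES is (α) derive the one-step bound (2.41) p. 21
for ANY input of the inductive class — [II] §2 consumes the fluctuation-field action only through Lemma 2 p. 11, i.e.
through the unit bound (1.36) p. 9 with its budget `E₀`, the analyticity domain (1.34), localization and gauge invariance
(p. 11 [R] *"We consider the integral in (I.2.13), with the fluctuation field action represented by (1.41)."*; at the
action level [I] p. 265 [R] *"We assume that after k steps we have obtained the action A_k described in the previous
section, and we apply the next renormalization transformation 𝐓_k"*), the operators likewise only through their bounds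
((1.5) p. 3), and (β) deliver the output at DEPTH inside that class (p. 21 [R] *"The inequality (2.41) and the assumptions
imply the inequality (I.1.18), with ½E₀ instead of E₀, for the terms of the effective action 𝐄^{(k+1)} in (I.1.3)."*).
(α) is typed as `ClassBound K κ G` over an abstract class `K k g U ⊆ Op × Hist`, (β) as `BoxInClass K` (the two-margin box
of every base point inside the class; for a BALL class it is the triangle inequality from `BaseDepth`,
`boxInClass_of_baseDepth`), and the one genuinely analytic input as `ClassLineAnalytic K` (complex differentiability of the
output along complex segments inside the class — [analysis]: each resummed term (2.14) p. 15 is an exponential of an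
expression LINEAR in the potentials, hence entire along `V + ζv`, and the expansion (2.13) converges uniformly under Lemma 3
p. 20 — the mechanism [II] uses on p. 15 for the analyticity in σ(Z); NOT PRINTED for segments in the potentials).  The
three together ARE the two fibre envelopes with ONE constant (`opFibreEnvelope_of_class`, `histFibreEnvelope_of_class`: a
segment of length ≤ the margin through a base point lies in the box, hence in the class), so every closure of the route
runs from them (`dataLipschitz₂_of_class`; `ne5_at_of_stepModel_class_scale_nat`, `Gop = Ghist = G`).  What this BUYS
[analysis, NUMBERS (g)]: posed at the level of the inserted POTENTIALS (the `Hist` of this typing read as the history-type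
terms V_k(Y, ·) of the fluctuation-field action, the insertion as the affine age-damped map of Lemma 1 p. 9), the class is
`{potentials with the Lemma-2 interface properties and (1.36)-budget ≤ E₀}` and the one-run OUTPUT computed on it has level
`νE₀`, `ν = O(1)C₃ε₁/E₀ ∝ ε₁` ((2.41) read on the class; [II] p. 21 prints `ν ≤ ½`), so the class bound is READ AT THE
PRINTED CONSTANTS — `G = νE₀` in (1.36)-units, NO re-run of (2.26)–(2.41) at an enlarged budget; the history margin is the
DEPTH of the actual total potential in the class, `rHist = d·E₀` with `d = 1 − μ`, `μ` = the (1.36)-budget fraction of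
the actual TOTAL `V″` of (1.42) — the `𝐏^{(k)}`-part of [I] (2.13) p. 268 together with Lemma 1's images of the WHOLE
history functional `𝐄_k` ([I] p. 265 [R] *"The meaning of the function 𝐄_k is obvious, it is equal to (1/g_k²)A + A_k."*,
i.e. by (1.3)/(1.6) pp. 260–261 the β-counterterms, the normalization terms `log Z^{(j)}` and the earlier outputs; [II]
p. 9 [R] *"The results obtained for the expression in the curly bracket {⋯} can be summarized as follows."* = Lemma 1).
The print backs `μ ≤ 1` ONLY (Lemma 2 p. 11 puts the total `V″_k` under the one bound (1.36)); the itemization of the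
budget among these consumers is NOT PRINTED.  [File v1.2 wrote here «the actual history part has budget `νE₀`», «margin
`rHist = (1 − ν)E₀`», «superseded for every `λ ≤ 1/ν` by the slack the text already grants», i.e. the identification
`μ = ν` that charges only the images of the earlier outputs and sets the `𝐏^{(k)}`-part, the β-images and the
normalization images to zero budget — WITHDRAWN by file v1.2.1 (DOCSTRING ERRATUM, NUMBERS (g′); cell sheet
`t4/b2b-balaban-t4-ne5-p1/READING-W2-CLASS-CERT.md` Part B); p. 21's «½» is an ACTION-level statement about the small-field
output term alone ([R] *"We define ½E₀ as equal to this constant"* fixes `E₀` by the normalization term's constant, with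
no potential-level consequence), and — unlike `ν ∝ ε₁` — the ε₁-independent part of `μ` is a ratio of absolute constants
to `E₀` that shrinking `ε₁` does not improve.]  The λ-family of `T4InputCauchyRateData` NUMBERS (d) (MI-3b: the same bounds
RE-RUN at `λε₂`, NOT PRINTED) is superseded by the class reading exactly to the extent `d > 0`: both need an unprinted
constant statement — the class reading's is «`E₀` large against the absolute constants of the `𝐏^{(k)}`-part, of the
normalization expansion and of the β-images, with quantified room `d`» at FIXED printed estimates (the print gestures at
re-fixing `E₀`: p. 21 [R] *"In fact this assumption is unessential, because the constant C₃ε₁ is small anyway, and we can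
take E₀ such, that the assumption is satisfied."*, p. 16 [R] *"We assume that ⅛(κ₁ − 1) ≥ (1 − 3δ)κ, C₃ ≤ E₀C₁, and
q ≥ 8."* — but carries out a FIX of `E₀` without room), the λ-family's is a re-run.  What it does NOT buy: `ClassBound` as a
statement quantified over `K`, `ClassLineAnalytic`, and the potential-level depth `d > 0` are NOT PRINTED sentences (cell
GAPS G-ne5p1-1‴ re-books W2-hist as CLASS = the interface reading of [II] pp. 11–21, CERTIFIED BY READING line by line on
pp. 12–21 by generation 9 (cell sheet READING-W2-CLASS-CERT Part A; still not a printed sentence) / LINE = [analysis] of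
(2.14) / SLACK = the depth `d = 1 − μ`, NOT PRINTED beyond `μ ≤ 1`, cell item S-ne5p1-μ superseding S-ne5p1-ν″); the
exponent-critical smallness becomes `ω + γ₀ν/(d(1 − ρ₀)) < θ′` with reach `2γ₀ν/(d(1 − ω)) ≤ ρ₀ < 1` — admissible iff
`ν/d < (1 − ω)/(3γ₀)` (`= 5/16` at `γ₀ = 1`, `L = 16`), VOID at `(d, ν) = (½, ½)` (reach `32/15 > 1`, §7), and for every
FIXED `d > 0` the rate tends to the age damping (`a → ᾱ = 1`) as `ν → 0`, i.e. under a restriction `O(1)C₃ε₁ ≤ νE₀` of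
the printed KIND but NOT PRINTED for small `ν` (propagating to the coupling window through `ε₁`, (1.34), (2.26)) AND the
unprinted ε₁-independent `d > 0`.  On the species toy (§7) the class route is VOID while the exact moduli fire
(`toy₆₄_class_smallness_void` against `toy₆₄_ne5`): a class bound is species-blind and a Cauchy estimate on it is worth
output SIZE over MARGIN — the toy's `66/1`, [II]'s `ν/d`; the kernel thus shows both what the class reading gives and what
it costs.  No census value of NUMBERS (a)–(f) changes; (g) is added, (g′) corrects its identification of the depth.

FILE v1.2.1 (generation 9, continued after the cell's certification pass; DOCSTRING ERRATUM + two arithmetic `example`s: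
every `def`/`theorem` of v1.2 p188639 is byte-identical).  While certifying the class question line by line on [II]
pp. 12–21 (renders p012–p021 read as images; outcome: every use of the potentials in (2.1)–(2.41) goes through the Lemma-2
interface — the representation (1.41) and localization, analyticity on (1.34) with (1.35), the split (1.42) with (1.43)
for `Q` and (1.36) for `V″`, gauge invariance — and from (2.23) on only through the class PARAMETERS `E₀, C₁, C₂, q, α₄,
α₆, γ₂` inside `α₅`, `2/|τ(Y)|`, `ε₂`, `C₃`; cell sheet READING-W2-CLASS-CERT Part A: CLASS certified by reading, still
not a printed sentence), the seat found that v1.2's potential-level DEPTH `1 − ν` over-identified the print: by [I] (1.3)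
p. 260, p. 265 and (2.12)/(2.13) p. 268 the curly bracket carries the WHOLE history functional `𝐄_k` (β-counterterms,
normalization terms, earlier outputs), Lemma 1 p. 9 maps all of it into the potentials, and Lemma 2 p. 11 puts the TOTAL
`V″_k` — `𝐏^{(k)}`-part included — under the ONE budget (1.36); the itemization is NOT PRINTED.  Hence `d = 1 − μ` with
`μ ≤ 1` printed and nothing more (NUMBERS (g′)); the identification `μ = ν`, the gloss of `BoxInClass`/`BaseDepth` by
p. 21's action-level half, and «superseded for every `λ ≤ 1/ν`» are WITHDRAWN in the docstrings above and below; the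
kernel is untouched because every v1.2 theorem is abstract in `rHist`, `RHist`, `ctr` (`BaseDepth` takes the depth as a
HYPOTHESIS).  Renders read as images for v1.2.1: [II] p008, p009, p012–p021; [I] p012, p013, p019, p020 (journal p. 260,
261, 267, 268); the [R] strings new to the lineage stand on the loci sheet v1.5.

FILE v1.3 (generation 9, continued; ADDITIVE §8–§9, every §1–§7 declaration byte-identical to v1.2.1 p189050).  One hour
after the erratum the seat noticed that the unprinted depth of (g′) is DISPENSABLE.  (g′) looked for room inside the
budget `E₀` — pinned by [II] p. 21 *"We define ½E₀ as equal to this constant"* — and found none printed.  But the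
(1.36)-budget is `E₀·u(Y)` with `u(Y) = ε₁C₁M^q e^{C₂κ₁}e^{−(1−2δ)κd_k(Y)}`, and `C₁` is NOT pinned: Lemma 1 p. 9 [R]
*"There exist absolute constants C₁, C₂, q, for which"* (1.36) holds, Lemma 2 p. 11 [R] *"the function V″_k(Y, B)
satisfies the bound (1.36)"*, p. 11 [R] *"possibly with other absolute constants"*.  Any `λC₁`, `λ > 1`, witnesses the
same lemmas, and §2 read at `λC₁` is the same text with `1/|τ(Y)| ↦ λ/|τ(Y)|` ((2.18) p. 16), `ε₂ ↦ λε₂` (p. 19 [R] *"and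
denoting ε₂ = 2E₀ε₁C₁α₄^{−1}α₆^{−1}M^q exp C₂κ₁, we obtain"*), `C₃ ↦ λC₃` (p. 20 [R] *"We define the constant C₃ =
2(L + 2)⁴O(1)2E₀C₁α₄^{−1}α₆^{−1}M^q exp C₂κ₁."*); every restriction of §2 that involves `C₁` (cell sheet
READING-W2-CLASS-CERT A2) is an inequality that either EASES with `λ` — p. 16 *"C₃ ≤ E₀C₁"* (Sect. 1's `C₃`), p. 19 *"For
simplicity let us assume that exp(−(1/20)γ₂(ε₁²/γ²)) ≤ ε₂."* — or is RESTORED by `ε₁ ↦ ε₁/λ` — p. 18 *"Assuming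
2E₀ε₁C₁α₄^{−1}α₆^{−1}M^q exp C₂κ₁ exp 5κ ≤ 1"*, p. 19 *"We have used the assumption ε₂ ≤ 1"*, p. 20 *"(L + 2)⁴O(1)ε₂ ≤
½"*, *"2(L + 2)⁴O(1)ε₂ exp 5κ ≤ 1"*, p. 21 *"O(1)C₃ε₁ ≤ ½E₀"* — together with the coupling threshold `γ ↦ γ/λ` through
p. 18 *"Assuming (1/20)γ₂(ε₁²/g_k²) ≥ (1/20)γ₂(ε₁²/γ²) ≥ 4κ,"*; all inside p. 21's *"for κ sufficiently large, and ε₁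
sufficiently small"*, `λ` being an absolute number fixed before `ε₁` (*"The assumptions allow finally us to fix all the
constants, or rather bounds on these constants."*).  In the DILATED budget ball (radius `λE₀` in `u`-units) the actual
total potential, of budget `μE₀ ≤ E₀` — Lemma 2, the ONLY printed fact used about it — sits at depth `≥ (λ − 1)E₀`
WHATEVER its itemization: SLACK from BUDGET + DILATION (§8 `baseDepth_dilate`), and the class envelope on the dilated
ball is (2.41) with `λC₃`, `G ↦ λG`.  Status words: the SLACK sub-wall of W2-hist no longer carries an unprinted constant
(it is [R] `μ ≤ 1` plus the dictionary); its cost moved into the class constant, the `ε₁`-thresholds and the coupling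
window (`γ`), all print-derived; CLASS stays CERTIFIED-BY-READING (interface reading, not a printed sentence — and it is
exactly that reading which is applied at `λC₁`), LINE stays [analysis]; the smallness becomes a condition on `ε₁` ALONE,
of the printed KIND (NUMBERS (g″); cell item S-ne5p1-λ superseding S-ne5p1-μ); NE5 stays NOT PRINTED (G-t4-U3-1); NOT
summit progress.  No page re-read for v1.3: every [R] string of this paragraph is a loci v1.5 entry (l.10, 11, 22, 24,
25, 37/43, 42, 44, 61, 62).

FILE v1.4 (generation 9, continued; ADDITIVE §10, every §1–§9 declaration byte-identical to v1.3 p189265; no quotation, no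
page re-read).  The budget closure of §8 had only a VOID toy instance (§9 restates `toy₆₄_class_smallness_void`): at unit
margins the species toy's class constant `66` against the natural gain `≥ 1/64` cannot meet the smallness.  §10 supplies
the missing VACUITY WITNESS — the same toy in the margin gauge `(1/64, 16)` (`toyModel₆₄R`) meets every binder of
`ne5_at_of_stepModel_budget_scale_nat` with budgets `(0, 1)`, room into the ball class of radii `(1/64, 17)`, class
constant `18`, operator rate `64`, single-scale gain `1/1024`, reach `1/3` from scale `9`, smallness `43/1024 < 1/2`, and
concludes `NE5 toyEA₆₄ toyEB univ 0 (1/2) (…)` (`toy₆₄R_ne5_budget`) — together with the gauge covariance of the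
binders the budget route uses (`Iff.rfl` for the structure / budget / class binders, `c ↦ c/t` for `InsScaleBound`).
Meaning for [II] ([analysis]): the class route's exponent sees `G·c` = output size × gain PER MARGIN, and the margin is
the dilation's `(λ − μ)E₀` — the toy's `16` is [II]'s `λ − μ`.  Nothing printed is touched; NOT summit progress.

## What is PROVED (kernel; `[folklore]` = elementary real/complex bookkeeping, no printed mathematics reproduced)

§1 `DataLipschitz₂ κ Λop Λhist ρ₀` (the shape); `dataLipschitz₂_of_dataLipschitz` / `dataLipschitz_of_dataLipschitz₂` /
`dataLipschitz₂_mono` (single ⟺ species up to constants); `opLeg_of_opFibreEnvelope`, `histLeg_of_histFibreEnvelope` (ONE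
unit-disc Cauchy estimate per species, file v5's `norm_sub_le_of_unitDisc_near`, with that species' OWN envelope constant);
`dataLipschitz₂_of_fibreEnvelopes` (`OpFibreEnvelope κ Gop ∧ HistFibreEnvelope κ Ghist ∧ ρ₀ < 1 ⟹ DataLipschitz₂ κ
(Gop/(1 − ρ₀)) (Ghist/(1 − ρ₀)) ρ₀`; file v5's `dataLipschitz_of_fibreEnvelopes` is the diagonal `Gop = Ghist`).
§2 `recursiveRate_of_stepModel_lip₂` (representation of the two runs, admissibility of run B's data, the one-run decay bounds,
`OperatorRate δ θ`, `InsertionRate κ E₀ δ′ θ`, `InsertionDamped κ c ω`, the near hypothesis and the first-scales bound, with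
`DataLipschitz₂ κ Λop Λhist ρ₀` ⟹ `RecursiveRate EA EB W κ θ ω (Λop·δ + Λhist·δ′ + B) (Λhist·c)`); the closures
`ne5_at_of_stepModel_lip₂_nat` (printed age normalisation, natural gain: NE5 at every `θ′ ∈ [θ, 1]` with `ω + Λhist·c < θ′`),
`exists_rate_of_stepModel_lip₂_nat` (room `ω + Λhist·c < 1` alone yields SOME rate `θ′ < 1`), and
`ne5_at_of_stepModel_fibre₂_scale_nat` (every wall of the route in its most primitive typed form, species-resolved: the two
fibre envelopes with separate constants, the structural insertion shapes + the single-scale term `InsScaleBound` of file v4 §9,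
the two input rates; smallness `ω + Ghist·c/(1 − ρ₀) < θ′` — no `Gop`).
§3 THE DECIDING TOY (`toyModel₆₄`: file v5's toy with the output map `Out(o, h) = 64·o + h`, run A = `64·toyRate`): the exact
species moduli are `Λop = 64`, `Λhist = 1` (`toy₆₄_dataLipschitz₂`); every SINGLE modulus with positive reach is `≥ 64`
(`toy₆₄_single_modulus_ge`) and every natural history gain is `≥ 1/64` (`toy₆₄_natural_gain_ge`), so the single-modulus
smallness `ω + Λc < θ′ ≤ 1` of file v5's `ne5_at_of_stepModel_lip_nat` is UNSATISFIABLE on this toy for every `ω ≥ 0`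
(`toy₆₄_single_closure_void`), while the species closure fires at `θ′ = 1/2` with `ω + Λhist·c = 1/32` and constant `992/15`
(`toy₆₄_ne5`) against the true supremum `2048/31` of `|E_A(k) − E_B(k)|/θ^k` (`toyEA₆₄_div_pow`).  [analysis] The toy is the
abstract shadow of a step whose output is MUCH more sensitive to its operators than to its history while the operator data
carry no feedback: conflating the species charges the operator sensitivity to the history loop — AT THE TOY'S UNIT MARGINS;
§5 reads the same toy in the operator-margin gauge `1/64`, where v5's single closure fires with the species rate and constant
(cell item GAPS-T4 C-t4r3-17).
§4 (file v1.1) `OpLipschitz κ Λop ρ₀` (shape: a DIRECT operator two-point bound, no analyticity); `opLipschitz_of_opFibreEnvelope`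
(the Cauchy operator leg is one instance); `dataLipschitz₂_of_opLipschitz_histFibre` (MIXED discharge: any operator two-point
bound + the history fibre envelope + `ρ₀ < 1` ⟹ `DataLipschitz₂ κ Λop (Ghist/(1 − ρ₀)) ρ₀`).  The margin gauge `regauge M s t`
and the covariances `regauge_representsA` / `regauge_representsB` / `regauge_inBase` (definitional), `operatorRate_regauge`
(`δ ↦ δ/s`), `insertionRate_regauge` (`δ′ ↦ δ′/t`), `insertionDamped_regauge` / `insertionDampedNat_regauge` (`c ↦ c/t`),
`dataLipschitz₂_regauge` (`(Λop, Λhist) ↦ (s·Λop, t·Λhist)` at every reach `ρ₀′` with `ρ₀′s, ρ₀′t ≤ ρ₀`),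
`opFibreEnvelope_regauge` / `histFibreEnvelope_regauge` (the SAME envelope constant for `s, t ≤ 1`); `dataLipschitz_gauge`
(`0 < Λhist ≤ Λop` ⟹ the regauged model `regauge M (Λhist/Λop) 1` carries file v5's `DataLipschitz κ Λhist ρ₀`);
`ne5_at_of_stepModel_lip₂_nat_of_gauge` (the conclusion of `ne5_at_of_stepModel_lip₂_nat`, obtained from file v5's
`ne5_at_of_stepModel_lip_nat` on the regauged model; `hnear` with `δ·Λop/Λhist` for `δ`); `ne5_at_of_stepModel_lip₂_nat_of_single`
(`Λop ≤ Λhist`: no gauge, v5's closure with `Λ = Λhist`, constant `Λhist(δ + δ′) + B`).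
§5 (file v1.1) `toyModel₆₄r = regauge toyModel₆₄ (1/64) 1`; `toy₆₄r_dataLipschitz` (single modulus `1` at every reach),
`toy₆₄r_operatorRate` (`δ = 64`), `toy₆₄r_insertionRate`, `toy₆₄r_insertionDampedNat` (unchanged); `toy₆₄r_ne5_single` (file
v5's single-modulus closure fires: `θ′ = 1/2`, `ω + Λc = 1/32`, constant `992/15` — the referee's witness, reproduced through
`regauge`); `toy₆₄_ne5_of_gauge` (the same from the general gauge theorem on the unit-margin toy).
§6 (file v1.2) `BoxInClass K` / `ClassBound K κ G` / `ClassLineAnalytic K` (shapes over an abstract admissible class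
`K : ℕ → (ℕ → ℝ) → C.BgB → Set (Op × Hist)`); `opSegment_mem_box`, `histSegment_mem_box` (margin-length segments through
a base point stay in the box); `opFibreEnvelope_of_class`, `histFibreEnvelope_of_class` (the three shapes ⟹ EACH fibre
envelope, with the class constant); `dataLipschitz₂_of_class` (⟹ `DataLipschitz₂ κ (G/(1 − ρ₀)) (G/(1 − ρ₀)) ρ₀`);
`ne5_at_of_stepModel_class_scale_nat` (`ne5_at_of_stepModel_fibre₂_scale_nat` with both envelopes discharged by the class:
smallness `ω + G·c/(1 − ρ₀) < θ′`, constant `(G·δ/(1 − ρ₀) + G·δ′/(1 − ρ₀) + B)(θ′ − ω)/(θ′ − (ω + G·c/(1 − ρ₀)))`);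
`ballClass ctr ROp RHist`, `BaseDepth ctr ROp RHist`, `boxInClass_of_baseDepth` (depth ⟹ slack, triangle inequality).
§7 (file v1.2) on `toyModel₆₄` with the ball class of radii `(1, 2)` around the origin (`toyCtr`): `toy₆₄_baseDepth`,
`toy₆₄_boxInClass`, `toy₆₄_classBound` (`G = 66`), `toy₆₄_classLineAnalytic`, `toy₆₄_opFibreEnvelope_of_class` /
`toy₆₄_histFibreEnvelope_of_class` (BOTH envelopes with `66`), `toy₆₄_dataLipschitz₂_of_class`,
`toy₆₄_class_smallness_void` (class constant `66` × natural gain `≥ 1/64` exceeds 1: the class route is void on this toy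
while `toy₆₄_ne5` fires); three `example`s = the class-gauge census values of NUMBERS (g) (rows `μ = ν` of (g′)) and (file
v1.2.1) two `example`s = the `μ = ½ + ν` rows of NUMBERS (g′).
§8 (file v1.3, abstract): `BaseBudget` (hypothesis shape), `baseDepth_of_baseBudget` (budget + room ⟹ depth),
`baseDepth_dilate` (margins `≤ (λ − 1)×budget` ⟹ depth in the `λ`-dilated ball class), `boxInClass_of_baseBudget`, closure
`ne5_at_of_stepModel_budget_scale_nat` (= `ne5_at_of_stepModel_class_scale_nat` on the roomy ball class, slack from
budget).  §9 on `toyModel₆₄`: `toy₆₄_baseBudget` (budgets `(0, 1)`), §7's `toy₆₄_baseDepth` re-derived twice as `example`s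
(explicit room; dilation `λ = 2` of the history budget), the void smallness restated for the budget route, and three
`example`s = NUMBERS (g″) rows (`λ = 2`: `ν = 1/100`, `1/1000`; `λ = 11`: `ν = 1/100`).
§10 (file v1.4): abstract `regauge_insAffine`, `regauge_insBlind`, `regauge_insHomog`, `insScaleBound_regauge`,
`regauge_baseBudget`, `regauge_classBound`, `regauge_classLineAnalytic`; toy `toyModel₆₄R := regauge toyModel₆₄ (1/64) 16`,
`toy₆₄_classBound_roomy` (`G = 18` on radii `(1/64, 17)`), `toy₆₄_classLineAnalytic_roomy`, `toy₆₄R_operatorRate` (`64`),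
`toy₆₄R_insertionRate` (`0`), `toy₆₄R_insScaleBound` (`1/1024`), **`toy₆₄R_ne5_budget`** (the budget closure fires:
`NE5 … 0 (1/2) (…)`), one arithmetic `example` (reach `107/336 ≤ 1/3`, smallness `43/1024 < 1/2`).

DICTIONARY (abstract ↔ printed object; [R] = read on the ×2 journal-page renders by this lineage, the strings below copied from
the lineage's loci sheet `t4/b2b-balaban-t4-ne5-p1/b13-loci.md` v1.3; [analysis] = this seat's reading, not a quotation; the
Bałaban papers are under adjudication and are quoted as CONTEXT only).  Everything of `T4InputCauchyRateData`'s DICTIONARY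
applies verbatim (carriers, `StepModel`, `OperatorRate` ↔ MI-1, `InsertionRate` ↔ G-ne5p1-4, `InsertionDamped(Nat)` ↔ MI-3a,
`OpFibreEnvelope`/`HistFibreEnvelope` ↔ G-ne5p1-1″, `DataLipschitz` ↔ nothing printed).  NEW: `DataLipschitz₂ κ Λop Λhist ρ₀`
↔ NOTHING printed, exactly as `DataLipschitz` ([Balaban1988RG2Cluster] (2.41) p. 21 [R] *"|𝐄^{(k+1)}(X)| ≤
O(1)C₃ε₁exp(−(1−10δ)½Lκd_{k+1}(X))"* bounds ONE run; the shape compares one step at TWO data points) — it is the consumed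
form with the two input species booked separately.  [analysis] On the Cauchy route `Λop ↔ Gop/(1 − ρ₀)`, `Gop` = the one-run
envelope along complex deformations of the OPERATOR data at fixed admissible history — printed mechanism: the step is a
functional of its operators through their bounds, p. 3 (1.5) [R] *"In these equations we can replace the propagators by
arbitrary operators having the same regularity properties and satisfying the same bounds. Only these bounds were important in
the analysis of Sect. C, E [15], hence the solutions D, 𝐀₀ can be considered as functionals of these operators"*, the
complex non-symmetric operator perturbations being controlled by (2.16) p. 16 [R] *"|R₁(b, b′)| ≤ (O(1)e^{−1/3δ₀M} + O(α₀ +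
α₁))exp(−½δ₀|b₋ − b′₋|)"*; and `Λhist ↔ Ghist/(1 − ρ₀)`, `Ghist` = the one-run envelope along complex deformations of the
inserted HISTORY at fixed operators — printed mechanism: the potentials enter each term (2.14) p. 15 [R] through
*"exp[Σ_{Y∈𝐃} τ(Y)𝐕_k(Y,B)]"*, bounded in (2.15) [R] through *"Π_{Y∈𝐃} 2/|τ(Y)|"* on the circles (2.18) p. 16 [R]
*"1/|τ(Y)| = E₀ε₁C₁α₄^{−1}M^q exp C₂κ₁ exp(−(1 − 3δ)κd_k(Y))"*, p. 16 [R] *"The expression in the last exponential can be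
estimated using (1.42), and the inequalities (1.43), (1.36)."* — BOTH fibre envelopes NOT PRINTED as parametrised statements
(G-ne5p1-1″), and neither `Gop` nor `Ghist` is derived here.  NEW in v1.1: `OpLipschitz κ Λop ρ₀` ↔ NOTHING printed as a
statement (a two-point comparison in the operator data; [analysis] mechanism of a non-Cauchy discharge = operator-perturbation
identities of the (2.16)–(2.17) p. 16 kind); `regauge M s t` ↔ no printed object — a change of the bookkeeping UNITS `rOp`,
`rHist` of this typing ([analysis] in print the margins are whatever the bounds (2.16)–(2.18) tolerate; an instance's margins
are delivered by its discharge, and no gauge is chosen here for Bałaban's step).  NEW in v1.2: `K k g U` ↔ the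
inductive CLASS of step-`k` input data — [analysis] at the potential level: operators obeying the bounds of (1.5)/(1.7)
p. 3, paired with `P₀ +` history-type potentials V(Y, U, J, B) analytic on (1.34), localized, gauge invariant, with
(1.36)-budget `≤ E₀` — i.e. what Lemma 2 p. 11 [R] hands to §2 (*"For each term in the sum there exists a function
V_k(Y, U, J, B), defined and analytic on the space (1.34), and satisfying the corresponding equality (1.35)."* … *"and the
function V″_k(Y, B) satisfies the bound (1.36)."*); `ClassBound K κ G` ↔ (2.41) p. 21 READ FOR EVERY MEMBER OF THE CLASS —
printed support: §2 opens on the interface (p. 11 [R] *"We consider the integral in (I.2.13), with the fluctuation field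
action represented by (1.41)."*), every use of V_k on pp. 15–21 goes through `|τ(Y)||V_k(Y, B)|` and (1.42)/(1.43)/(1.36)
(p. 16 [R] sentence above; (2.15), (2.20)), and at the action level [I] runs the step for any action satisfying the
inductive hypotheses (p. 265 [R] sentence in the FILE v1.2 paragraph; Theorem 3 p. 264); NOT PRINTED as a statement
quantified over a class; `BoxInClass K` / `BaseDepth` ↔ NOTHING printed at the potential level: the depth `d·E₀ = (1 − μ)E₀`
of the actual total `V″` inside the (1.36)-budget, of which the print gives `μ ≤ 1` (Lemma 2 p. 11) and no itemization
(file v1.2's entry «the depth of p. 21 [R] (*"with ½E₀ instead of E₀"*), [analysis] transported to the inserted potentials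
by the homogeneity of Lemma 1's map (`InsHomog`)» is WITHDRAWN by v1.2.1: p. 21's half is the action-level share of the
small-field output term, the other half being the normalization term's BY DEFINITION of `E₀`, and Lemma 1 transports the
whole `𝐄_k`, not the outputs alone) [file v1.3: RESOLVED for the dilated ball class — the depth is not located in print,
it is manufactured by dilation, next entry]; `BaseBudget ctr BOp BHist` (file v1.3) ↔ history species: Lemma 2 p. 11 [R]
*"the function V″_k(Y, B) satisfies the bound (1.36)"* — the actual total potential inside the (1.36)-budget ball, `μ ≤ 1`,
PRINTED; operator species: budget `0` by the choice of centre; the ROOM `budget + margin ≤ radius` of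
`baseDepth_of_baseBudget` ↔ the DILATION `C₁ ↦ λC₁` of Lemma 1's existential constant (p. 9 [R] *"There exist absolute
constants C₁, C₂, q, for which"*), print-visible as `ε₂ ↦ λε₂`, `C₃ ↦ λC₃` (p. 19, p. 20) — [R] + [analysis], no unprinted
constant (FILE v1.3 paragraph); `ClassLineAnalytic K` ↔ NOTHING
printed for segments in the potentials ([analysis] of (2.14)/(2.15) p. 15 and of the σ(Z)-argument there, [R] *"Thus the
activities in (2.13), and the whole sum 𝐄^{(k+1)}(X), are analytic functions of (𝐔, 𝐉)"*); `ballClass` / `toyCtr` ↔ no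
printed object.

## NUMBERS (f) (this leaf): the EXPONENT-CRITICAL census of the route, by species — [analysis] over `T4InputCauchyRateData`'s
## NUMBERS (a)–(e) and the [R] loci there; changes NO census value (cell record `t4/T4-EST-NE5-P1.md` v7 §19–§20)

By `ne5_at_of_stepModel_lip₂_nat` the NE5 rate delivered by this route is `max(θ_op, ω + Λhist·c♮ + slack)` — θ_op = the
input rate of `OperatorRate`/`InsertionRate` (NE2⁺/NE3-type, nodes U1a/U1b), ω = the age damping (NUMBERS (a)), `Λhist·c♮` =
the Lipschitz modulus of the one-step output with respect to the NEWEST previous action (NUMBERS (e), now booked to the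
history species ALONE).  The operator-species modulus `Λop`, the rate CONSTANTS `δ` (MI-1), `δ′` (G-ne5p1-4) and the
first-scales constant `B` enter `C₅` only.  CONSEQUENCES for the cell's wall table (record v7, WALLS v3): W2 =
G-ne5p1-1″ splits into W2-op (`OpFibreEnvelope`/`Λop`: CONSTANT-ONLY — any discharge, however lossy its constant, leaves the
exponent intact) and W2-hist (`HistFibreEnvelope`/`Λhist`: EXPONENT-CRITICAL through the product `Λhist·c♮` with W3 =
MI-3a/G-ne5p1-3a″); W1 = MI-1 and W4 = G-ne5p1-4 are exponent-critical only through their RATE θ_op, never through their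
constants.  On the pure Cauchy route of NUMBERS (b)–(e) both fibre envelopes are read off the SAME re-run of (2.38)/(2.41) on
the slack box (p. 21 [R] *"Next, we assume that O(1)C₃ε₁ ≤ ½E₀."*), so `Gop = Ghist = G(λ)` and the smallness line S-ν′
(`ω + K′ν < θ′`, `K′ = λ/((λ − 1)(1 − ρ₀))`) is UNCHANGED; what the species form adds there is only the booking that a cruder
OPERATOR-fibre constant (e.g. one inherited from operator-perturbation bounds of the (2.16)–(2.17) kind with large prefactors)
costs nothing in the exponent, and that a SHARPER history-species modulus from any non-Cauchy discharge (the toy's exact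
`Λhist = 1` against Cauchy's `Ghist/(1 − ρ₀)`) improves the exponent one-for-one.  GAUGE READING (file v1.1, §4): every
entry of this census is margin-gauge-INVARIANT — θ_op and ω are margin-free, and `Λhist·c♮`, `Λop·δ`, `Λhist·δ′` are
invariant products (`(t·Λhist)(c♮/t)`, `(s·Λop)(δ/s)`, `(t·Λhist)(δ′/t)`); only the reach line `hnear` (hence `k₀`, `B`) is
gauge-dependent.  On the pure Cauchy route the gauge is pinned at the analyticity radii (`opFibreEnvelope_regauge`: shrinking
a margin keeps `G` and loses the factor), which is why S-ν′ is read there; v5's single-modulus smallness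
`ω + max(Λop, Λhist)·c♮ < θ′` is the species smallness evaluated in ONE gauge, and after regauging a `DataLipschitz₂`
hypothesis to `s = Λhist/Λop` (lossless in the moduli, `dataLipschitz₂_regauge`; the absolute operator reach shrinks by `s`,
visible in `hnear` only) the two coincide (`ne5_at_of_stepModel_lip₂_nat_of_gauge`).  Nothing in (f) is printed; it is
constant-tracking inside the hypothesis shapes.

## NUMBERS (g) (file v1.2): the census in the CLASS GAUGE — [analysis] over NUMBERS (a)–(f) and the [R] loci; changes no
## value of (a)–(f) (cell record v9 §23)

In the class reading the history species is measured in the units of the unit bound (1.36) p. 9 ([R] *"|V′_k(Y, U, J, B)|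
≤ E₀ε₁C₁M^q exp C₂κ₁ exp(−(1 − 2δ)κd_k(Y))"*), budget `E₀` for the whole potential `V″` of (1.42); the one-run OUTPUT has
level `νE₀` with `ν = O(1)C₃ε₁/E₀`, `E₀`-FREE because `C₃ ∝ E₀` (p. 20 [R] *"We define the constant C₃ =
2(L + 2)⁴O(1)2E₀C₁α₄^{−1}α₆^{−1}M^q exp C₂κ₁."*), so `ν ∝ ε₁`, and [II] prints `ν ≤ ½` (p. 21).  [File v1.2 IDENTIFIED the
history margin with `(1 − ν)E₀` («the actual history-type part has budget `νE₀`»); by NUMBERS (g′) below only `rHist =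
d·E₀`, `d = 1 − μ ≥ 0` is print-backed and the entries are to be read with `d` for `1 − ν` — the VALUES of this block are
the special case `μ = ν`.]  ENTRIES: class constant
`G = Gop = Ghist = νE₀` (`ClassBound` = (2.41) read on the class); history margin `rHist = (1 − ν)E₀` (`BaseDepth`: depth
`νE₀` in a class of radius `E₀`) [v1.2.1: `rHist = d·E₀`]; natural gain `c = γ₀/((1 − ν)E₀)` [v1.2.1: `γ₀/(d·E₀)`] per
unit of newest-scale discrepancy, `γ₀ ≤ 1` = the
newest scale's share of the (1.36) budget (the print bounds the scale sum by p. 8 [R] *"This yields (6L)⁴Lʲη, and the sum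
over j is bounded by 2(6L)⁴."*; conservative `γ₀ = 1`); age damping `ω = L^{−ᾱ}`, `ᾱ = 1` through the (1.24)/(1.31) channel
(NUMBERS (a)).  Hence the exponent-critical product `Ghist·c = γ₀ν/(1 − ν)` and, by `ne5_at_of_stepModel_class_scale_nat`,
the smallness `ω + γ₀ν/((1 − ν)(1 − ρ₀)) < θ′ = L^{−a}` with the reach (near regime, `T4InputCauchyRateData` NUMBERS (d) in
this gauge) `2γ₀ν/((1 − ν)(1 − ω)) ≤ ρ₀ < 1`.  VALUES (`γ₀ = 1`, `L = 16`, `ω = 1/16`; the §7 `example`s): `ν = ½` (the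
printed depth): reach `32/15 > 1` — VOID; `ν_max ≈ (1 − ω)/(2γ₀ + 1 − ω) ≈ 0.32`; `ν = 1/10`: `ρ₀ = 32/135`, gain
`15/103`, `ω + gain = 0.2082` ⇒ every `a < 0.566`; `ν = 1/100`: `ρ₀ = 32/1485`, gain `15/1453`, `ω + gain = 0.0728` ⇒
`a < 0.945`; `ν → 0`: `a → ᾱ = 1` (the age damping is the floor of this route, NUMBERS (a)).  STATUS: constant-tracking
inside hypothesis shapes; `ν < ½` is a restriction `O(1)C₃ε₁ ≤ νE₀` of the printed KIND (p. 21) and NOT PRINTED (cell item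
S-ne5p1-ν″; it supersedes S-ν′'s `ω + K′ν < θ′` of NUMBERS (d)/(f) for this reading — `K′ν = λν/((λ − 1)(1 − ρ₀))` at
`λ = 1/ν` IS `ν/((1 − ν)(1 − ρ₀))`: the class reading is the λ-family evaluated at the slack the text grants, with NO
re-run at `λε₂`); it propagates to the coupling window through `ε₁` ((1.34) [R] *"|B| < ε₁g_k^{−1}"*, (2.26) [R]
*"exp(−½γ₂(ε₁²/g_k²)|P|)"*).  Nothing in (g) is printed.

## NUMBERS (g′) (file v1.2.1, DOCSTRING ERRATUM of generation 9 against its own (g); cell sheet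
## `t4/b2b-balaban-t4-ne5-p1/READING-W2-CLASS-CERT.md` Part B, record `t4/T4-EST-NE5-P1.md` v10 §25): the DEPTH is `d = 1 − μ`,
## print-backed only as `μ ≤ 1`; the census re-tabulated in `(d, ν)` — no kernel statement changes

WHAT THE PRINT SAYS ([R], loci v1.5).  [I] p. 265 *"The meaning of the function 𝐄_k is obvious, it is equal to
(1/g_k²)A + A_k."* with (1.3) p. 260 / (1.6) p. 261: `𝐄_k` is the WHOLE remainder of the action — the sum over `j < k` of
`−β_{j+1}(g_j)A(U_k)`, `[log Z^{(j)}(U_k) − log Z^{(j)}(1)]` and `[𝐄^{(j+1)}(g_j, U_k) − 𝐄^{(j+1)}(g_j, 1)]`; [I] p. 268: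
the curly bracket of (2.12)/(2.13) is `{𝐄_k(U_k(exp i[g_kCB − hD̃(g_kCB)]V^{(k)})) − 𝐄_k(U_k(V^{(k)}))}` with THIS `𝐄_k`,
the other summand being `𝐏^{(k)}(g_k, U_{k+1}, B)` (*"one is connected with the expansion of the action −(1/g_k²)A(U_k(V))
and the measure in (2.1), and we denote it by 𝐏^{(k)}(g_k, U_{k+1}, B), another is the expression in the curly bracket"*);
[II] p. 9 *"The results obtained for the expression in the curly bracket {⋯} can be summarized as follows."* — Lemma 1,
whose (1.36) carries `E₀` through (I.1.18) on the history terms; [II] p. 11 Lemma 2: the TOTAL *"V_k(Y, B) = ½⟨Q(Y, B), B,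
B⟩ + V″_k(Y, B). (1.42)"* has *"the function V″_k(Y, B) satisfies the bound (1.36)"* — ONE budget; [II] p. 16: the Cauchy
circle (2.18) is calibrated to exactly that constant; [II] p. 21: the small-field output obeys (I.1.18) *"with ½E₀ instead
of E₀"* under *"O(1)C₃ε₁ ≤ ½E₀"*, the normalization term obeys it *"with an absolute constant instead of E₀. We define ½E₀
as equal to this constant"*.  CONSEQUENCE [analysis].  With `u(Y) = ε₁C₁M^q e^{C₂κ₁}e^{−(1−2δ)κd_k(Y)}` and the budget norm
`‖V″‖ = sup_Y |V″(Y)|/u(Y)`, §2 runs on the class `‖V″‖ ≤ E₀` (plus the interface properties and (1.43) for `Q`); the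
ACTUAL potential is `V″_P + 𝓛(𝐄_k)` (the `𝐏^{(k)}`-part plus Lemma 1's image of the full history functional), of budget
`μE₀`, `μ ≤ 1` printed, NOT itemized in print among `V″_P`, the β-images, the normalization images and the output images.
So `BaseDepth`/`BoxInClass` hold with `rHist = d·E₀`, `d = 1 − μ`, where `d` is NOT PRINTED and its ε₁-INDEPENDENT deficit
(everything but the output images, whose share is `∝ ν ∝ ε₁`) is a ratio of absolute constants to `E₀`: room needs «`E₀`
large against the absolute constants of `𝐏^{(k)}`, of the normalization expansion ([16] (63)) and of the β-images», a
constant statement of the KIND the print gestures at (p. 21 *"we can take E₀ such, that the assumption is satisfied"*,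
p. 16 *"C₃ ≤ E₀C₁"*, p. 11 *"possibly with other absolute constants"*) but replaces by the FIX `½E₀ :=` the normalization
constant; raising `E₀` also tightens `ε₁` through `ε₂ ∝ E₀ε₁` (p. 18/19 assumptions).  (g)'s identification `d = 1 − ν`
(only output images charged) is WITHDRAWN; p. 21's «½» is action-level for the output term and implies nothing about `μ`.
CORRECTED CENSUS (same closure `ne5_at_of_stepModel_class_scale_nat`; `γ₀ = 1`, `L = 16`, `ω = 1/16`, `θ′ = L^{−a}`):
`G = νE₀` (unchanged), `rHist = d·E₀`, `c = γ₀/(d·E₀)`, exponent-critical product `Ghist·c = γ₀ν/d`, reach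
`2γ₀ν/(d(1 − ω)) ≤ ρ₀ < 1`, smallness `ω + γ₀ν/(d(1 − ρ₀)) < L^{−a}`, admissible iff `x = ν/d < (1 − ω)/(3γ₀) = 5/16`
((g)'s «`ν_max ≈ 0.32`» was this `x_max`, loosely; `μ = ν` ⇒ `ν < 5/21`, `μ = ½ + ν` ⇒ `ν < 5/42`).  VALUES: `μ = ν` (the
(g) rows = the optimistic case): `(d, ν) = (½, ½)` VOID (reach `32/15`); `(9/10, 1/10)`: reach `32/135`, gain `15/103`,
smallness `0.2081`, `a < 0.566`; `(99/100, 1/100)`: `32/1485`, `15/1453`, `0.0728`, `a < 0.945`.  `μ = ½ + ν` (the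
normalization images charged at their nominal action-level share, `V″_P` and β-images still uncharged — ILLUSTRATIVE, not
printed either): `(2/5, 1/10)`: reach `8/15`, gain `ν/d = 1/4`, smallness `1/16 + (1/4)/(1 − 8/15) = 67/112 = 0.598`,
`a < 0.185`; `(49/100, 1/100)`: reach `32/735`, gain `1/49`, smallness `943/11248 = 0.0838`, `a < 0.894`;
`(499/1000, 1/1000)`: `0.0645`, `a < 0.989`.  Heavy ε₁-independent consumption `d = 1/10`: `ν = 1/100`: smallness
`179/944 = 0.190`, `a < 0.600`; `ν = 1/1000`: `0.0727`, `a < 0.945`.  ROBUST: for every FIXED `d > 0`, `a → ᾱ = 1` as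
`ν → 0` — the age damping stays the floor AND the limit of this route; what changed is the finite-ν table (it depends on
the unprinted `d`, not on `ν` alone) and the NATURE of the residual smallness: besides «`ν` small» (`∝ ε₁`, of the printed
kind) the route needs «`d > 0` with quantified room», ε₁-INDEPENDENT and NOT PRINTED (cell item S-ne5p1-μ, superseding
S-ne5p1-ν″).  The three §7 `example`s stand as the `μ = ν` rows; two `example`s for the `μ = ½ + ν` rows are added.
Nothing in (g′) is printed; it is constant-tracking inside hypothesis shapes, and it makes the class route WEAKER than (g)
stated, not stronger.

## NUMBERS (g″) (file v1.3; cell record `t4/T4-EST-NE5-P1.md` v11 §27, sheet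
## `t4/b2b-balaban-t4-ne5-p1/READING-W2-SLACK-DILATION.md`): the DILATION census — (g′) with `ν/d ↦ ν_eff = λν/(λ − μ)`,
## `μ ≤ 1` printed, `λ > 1` free; no unprinted constant; no kernel statement of §1–§7 changes

MECHANISM ([R] + [analysis], FILE v1.3 paragraph).  Read Lemma 2's existential (1.36)-constant as `λC₁`: budget ball of
radius `λE₀` (in `u`-units); actual potential of budget `μE₀`, `μ ≤ 1` [R]; history margin `rHist = (λ − μ)E₀ ≥ (λ − 1)E₀`
(§8 `baseDepth_dilate`); class envelope on the dilated ball `G = λνE₀` ((2.41) with `C₃ ↦ λC₃`); natural gain `c =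
γ₀/rHist`; every `ε₁`-threshold of [II] §2 divided by `λ` (`ε₂ ↦ λε₂`) and the coupling threshold `γ` with it (p. 18),
i.e. the coupling window `W` of every shape shrinks accordingly.  CENSUS (closure `ne5_at_of_stepModel_budget_scale_nat` =
the class closure; `γ₀ = 1`, `L = 16`, `ω = 1/16`, `θ′ = L^{−a}`): exponent-critical product `G·c = γ₀ν_eff`, `ν_eff :=
λν/(λ − μ) ≤ λν/(λ − 1)`; reach `2γ₀ν_eff/(1 − ω) ≤ ρ₀ < 1`; smallness `ω + γ₀ν_eff/(1 − ρ₀) < L^{−a}`; admissible iff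
`ν_eff < 5/16`; side conditions `ε₁ ≤ ε̄₁/λ`, `γ ≤ γ̄/λ` (`ε̄₁, γ̄` = the printed thresholds of §2 at `λ = 1`).  VALUES at
the WORST printed budget `μ = 1`: `λ = 2` (`ν_eff = 2ν`): `ν = 1/100`: reach `16/375`, gain `15/718`, smallness `479/5744
= 0.0834`, `a < 0.895`; `ν = 1/1000`: `8/1875`, `15/7468`, `1927/29872 = 0.0645`, `a < 0.988`.  `λ = 11`, `ν = 1/100`
(`ν_eff = 0.011`): `0.0738`, `a < 0.940`; `λ → ∞`: `ν_eff ↓ ν` (the (g′) row `d = 1`), each `λ` paid in thresholds.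
Intermediate budgets interpolate: `λ = 2`, `μ = ½` (`ν_eff = 4ν/3`), `ν = 1/100`: `0.0762`, `a < 0.928`.  COMPARISON with
(g′): (g′)'s `ν/d = ν/(1 − μ)` is the row `λ = 1` — VOID at `μ = 1` and dependent on the unprinted `d` otherwise; for every
`μ ≤ 1` and `λ ≥ 2`, `ν_eff ≤ 2ν`: the dilation dominates (g′) whenever `d < ½` and never needs `d`.  ROBUST (unchanged):
`a → ᾱ = 1` as `ε₁ → 0` at fixed `λ`.  NATURE of the residual smallness (cell item S-ne5p1-λ, superseding S-ne5p1-μ): a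
condition on `ε₁` ALONE — «`ν_eff` small», `ν ∝ ε₁`, plus `ε₁ ≤ ε̄₁/λ`, `γ ≤ γ̄/λ` — of the printed KIND ([II] p. 21 *"ε₁
sufficiently small"*, p. 18 *"γ² sufficiently small"*); the specific inequality is the route's, NOT PRINTED; NO
ε₁-independent unprinted constant remains in the SLACK.  What dilation does NOT touch: CLASS (certified by reading, not a
printed sentence), LINE ([analysis]), the operator species (budget `0`; its room is W2-op's constant-only question),
`DataLipschitz` (corresponds to nothing printed), NE5 NOT PRINTED (G-t4-U3-1).  Nothing in (g″) is printed mathematics; it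
is constant-tracking inside hypothesis shapes, and it makes the class route as strong as (g) HOPED (its row `d ≈ 1`) up to
the factor `λ/(λ − 1) ≤ 2` — this time with printed support for the slack and a printed-kind price.

NOT COVERED.  No functional of Bałaban's is constructed, factorised as `Out ∘ (op, ins)`, or shown analytic or Lipschitz in
anything; no modulus `Λop`, `Λhist`, no envelope constant `Gop`, `Ghist`, no operator rate, insertion rate, damping constant or
margin is derived, and no margin gauge is chosen for Bałaban's step; no admissible class `K`, class centre or class radius
is constructed for Bałaban's step, no class bound or segment analyticity is derived, and the potential-level reading of
`Hist` is [analysis], not a construction; the boundary/R-terms member (B14 (2.40)–(2.42), B16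
(1.99)) is the sibling module `T4BoundaryCarrier`/seat P3 and is not touched; the activity-level junction is seat P2's
(`T4ActivityLipschitz`, `T4ActivityRecursion`) and is not duplicated; `T4InputCauchyRateData` (file v5), `T4InputCauchyRate`
(v1) and `T4OutputRate` are imported BY NAME and not modified.

CITATION HEADER (lean-in-tree rule 2026-08-18).  T. Bałaban, *Renormalization group approach to lattice gauge field
theories. II. Cluster expansions*, Commun. Math. Phys. **116**, 1–22 (1988) [Balaban1988RG2Cluster] (cell paper B13 = [II];
held `paper:balaban1988-cmp116-rg-ii-cluster`, journal page = PDF page; renders `b2b-balaban-ref1/pages/1988-cmp116-rg-II-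
cluster/…-pNNN-x2.png`, p. 3, 15, 16, 20, 21 read as images by this lineage (generations 1–3) and [II] p. 11, 20, 21
with [I] p. 261, 264, 265 (`…/1987-cmp109-rg-I-small-field/…-p013/p016/p017-x2.png`) by generation 9, and [II] p. 8, 9,
12–21 with [I] p. 260, 261, 267, 268 (`…-p012/p013/p019/p020-x2.png`) by generation 9 continued (v1.2.1); the eight v1 [R]
strings above ([II] p. 3 (1.5), p. 15 (2.14)/(2.15), p. 16 (2.16)/(2.18) + one sentence, p. 21 (2.41) + one sentence) are
copied from the lineage loci sheet v1.3 (l.5, 15/22, 19, 22, 36) and were NOT re-read by generations 7–8 (generation 9 re-read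
the two p. 21 strings on render p021, not p. 3/15/16)); T. Bałaban, *Renormalization group approach to lattice gauge field
theories. I*, Commun. Math. Phys. **109**, 249–301 (1987) [Balaban1987RG1] (B12 = [I]; from v1.2 its p. 265 is quoted
and p. 264 (Theorem 3) named as CONTEXT for the class reading, renders p016/p017) and T. Bałaban, *Convergent
renormalization expansions for lattice gauge theories*, Commun. Math. Phys. **119**, 243–285 (1988) [Balaban1988Convergent]
(B14 = [III], named for the framing only).  What is reproduced: NOTHING of the papers' mathematics —
only folklore complex analysis (the unit-disc Cauchy two-point bound of file v5, applied one species at a time), real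
bookkeeping and a toy; the quotations above are context.  NEW module of unit `b2b-balaban-t4-ne5-p1` (T⁴ fan-out prover P1
for NE5), generation 7, journal claim T4-U3.E-NE5-PROVE-P1-v7 2026-08-19T11:51:01Z; no page re-read, no quotation new to the lineage
(every [R] string above stands on the loci sheet v1.3; seven of the eight also stand — in plain typography, up to
spacing — in `T4InputCauchyRateData`'s cross-read module docstring, the exception being the p. 16 sentence on
(1.42)/(1.43)/(1.36), loci l.15/22, read on render p016 by generations 1–2; v1.0.1 = this provenance sentence and the
render clause above corrected, DOCSTRING ONLY, every declaration byte-identical to v1 p187484; v1.1 = generation 8, journal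
claim T4-U3.E-NE5-PROVE-P1-v8 2026-08-19T12:45:39Z: §4–§5 APPENDED (margin gauge, mixed discharge, the regauged toy) and this
docstring amended — title, value sentence (iii)/(iv), the FILE v1.1 paragraph, What is PROVED §3 rider and §4–§5, DICTIONARY
and NUMBERS (f) riders, NOT COVERED, this sentence — answering cell items GAPS-T4 C-t4r3-17 (INFO-1/INFO-2/DOCFIX-LOW) and
C-ne5p1-10; every §1–§3 declaration byte-identical to v1.0.1 p187559; no page re-read, no quotation new to the lineage, the
(2.16)–(2.17) p. 16 pointers of §4 being LOCATIONS of loci l.15/22, not new strings; v1.2 = generation 9, journal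
claim T4-U3.E-NE5-PROVE-P1-v9 2026-08-19T13:24:28Z: §6–§7 APPENDED (the class reading, the ball class, the toy's class
route, the census examples) and this docstring amended — title, value sentence (v), the FILE v1.2 paragraph with the I1
precision of cell GAPS C-pv05g13-6, What is PROVED §6–§7, DICTIONARY and NUMBERS (g) riders, NOT COVERED, this sentence;
every §1–§5 declaration byte-identical to v1.1 p188038; renders READ AS IMAGES by generation 9: [II] p011, p020, p021 and
[I] p013, p016, p017 (journal p. 261, 264, 265); the [R] strings NEW to the lineage — [II] p. 11 *"We consider the integral
in (I.2.13) …"*, the p. 21 (I.1.18) sentence IN FULL and the p. 21 *"In fact this assumption is unessential …"* sentence,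
[I] p. 265 *"We assume that after k steps …"* — stand on the loci sheet v1.4 with their renders; every other [R] string is
a loci v1.3 entry as before; v1.2.1 = generation 9 continued, same journal claim: DOCSTRING ERRATUM (title rider, value
sentence (v), the CLASS READING paragraph, the FILE v1.2.1 paragraph, What is PROVED §7, the DICTIONARY entry
`BoxInClass`/`BaseDepth`, NUMBERS (g) riders and NUMBERS (g′), the `BoxInClass`/`BaseDepth`/`toy₆₄_class_smallness_void`
docstrings, the three §7 example docstrings) plus two arithmetic `example`s; every `def`/`theorem` byte-identical to v1.2
p188639; the [R] strings new to the lineage — [I] p. 265 *"The meaning of the function 𝐄_k …"* (already on loci v1.4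
l.48), [II] p. 9 *"The results obtained for the expression in the curly bracket …"*, p. 21 *"We define ½E₀ as equal to
this constant"*, p. 11 *"possibly with other absolute constants"* (loci v1.4 l.42) — stand on the loci sheet v1.5 with
their renders; v1.3 = generation 9 continued, same journal claim: §8–§9 APPENDED (`BaseBudget`; budget + room ⟹ depth;
dilation; the budget closure; the toy's budgets; NUMBERS (g″) examples) and this docstring amended — title, value sentence
(vi), the FILE v1.3 paragraph, What is PROVED §8–§9, the DICTIONARY entries `BoxInClass`/`BaseDepth` (rider) and
`BaseBudget`, NUMBERS (g″), riders in the `BoxInClass`/`BaseDepth` docstrings; every §1–§7 declaration byte-identical to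
v1.2.1 p189050; no page re-read, no quotation new to the lineage — the [R] strings of the FILE v1.3 paragraph are loci
v1.5 entries; v1.4 = generation 9 continued, same journal claim: §10 APPENDED (gauge covariance of the budget route's
binders; the regauged toy `toyModel₆₄R` and the non-void budget-closure instance `toy₆₄R_ne5_budget`) and this docstring
amended — title, value sentence (vii), the FILE v1.4 paragraph, What is PROVED §10; every §1–§9 declaration
byte-identical to v1.3 p189265; no quotation, no page re-read); imports
`T4InputCauchyRateData` (file v5: `StepModel` and its shapes, `norm_sub_le_of_unitDisc_near`, `ne5_at_of_recursiveRate`,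
`ne5_at_of_stepModel_lip_nat`,
`insertionDamped_of_nat`, `insertionDampedNat_of_affine`, `sizeDampedNat_of_scaleBound`, the toy `toyModel`/`toyRate` and its
lemmas) BY NAME — and through it `T4OutputRate` (carriers, `NE5`, `DecayBound`) and `T4InputCauchyRate` (`RecursiveRate`,
`toyCarriers`, `toyEB`) — and modifies nothing.
-/

noncomputable section

open Metric Set Finset

namespace Literature.MathematicalPhysics.QuantumFieldTheory.Balaban1983to89.T4InputCauchyRateSpecies

open Literature.MathematicalPhysics.QuantumFieldTheory.Balaban1983to89.T4OutputRate
open Literature.MathematicalPhysics.QuantumFieldTheory.Balaban1983to89.T4InputCauchyRate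
open Literature.MathematicalPhysics.QuantumFieldTheory.Balaban1983to89.T4InputCauchyRateData

/-! ## §1 The species-separated two-point form and its relation to the single-modulus form -/

section Species

variable {C : Carriers} {Op Hist : Type*} [NormedAddCommGroup Op] [NormedSpace ℂ Op] [NormedAddCommGroup Hist]
  [NormedSpace ℂ Hist] (M : StepModel C Op Hist)

/-- HYPOTHESIS SHAPE `DataLipschitz₂ κ Λop Λhist ρ₀` — the CONSUMED form of the output wall with ONE LIPSCHITZ MODULUS PER
INPUT SPECIES (corresponds to nothing printed, exactly as `StepModel.DataLipschitz`: [II] (2.41) p. 21 bounds ONE run, this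
compares the one step at TWO data points): at every base point `p` and every data point `q` within relative reach `ρ₀` of
`p` in each species, the outputs at a step-`k` domain differ by at most
`(Λop·‖q.1 − p.1‖/rOp + Λhist·‖q.2 − p.2‖/rHist)·e^{−κd(X)}` — `Λop` = the OPERATOR-species modulus, `Λhist` = the
HISTORY-species modulus, both in margin units. [folklore] -/
def DataLipschitz₂ (W : Set (ℕ → ℝ)) (κ Λop Λhist ρ₀ : ℝ) : Prop :=
  ∀ k, ∀ g ∈ W, ∀ (U : C.BgB) (p : Op × Hist), p ∈ M.Base k g U → ∀ X : C.Dom, C.scale X = k →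
    ∀ q : Op × Hist, ‖q.1 - p.1‖ ≤ ρ₀ * M.rOp k → ‖q.2 - p.2‖ ≤ ρ₀ * M.rHist k →
      ‖M.Out k q.1 q.2 X - M.Out k p.1 p.2 X‖ ≤
        (Λop * (‖q.1 - p.1‖ / M.rOp k) + Λhist * (‖q.2 - p.2‖ / M.rHist k)) * Real.exp (-(κ * C.d X))

/-- SINGLE ⟹ SPECIES (the diagonal): `DataLipschitz κ Λ ρ₀` is `DataLipschitz₂ κ Λ Λ ρ₀`. [folklore] -/
theorem dataLipschitz₂_of_dataLipschitz {W : Set (ℕ → ℝ)} {κ Λ ρ₀ : ℝ} (h : M.DataLipschitz W κ Λ ρ₀) :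
    DataLipschitz₂ M W κ Λ Λ ρ₀ := by
  intro k g hg U p hp X hX q hq1 hq2
  calc ‖M.Out k q.1 q.2 X - M.Out k p.1 p.2 X‖
      ≤ Λ * (‖q.1 - p.1‖ / M.rOp k + ‖q.2 - p.2‖ / M.rHist k) * Real.exp (-(κ * C.d X)) := h k g hg U p hp X hX q hq1 hq2
    _ = (Λ * (‖q.1 - p.1‖ / M.rOp k) + Λ * (‖q.2 - p.2‖ / M.rHist k)) * Real.exp (-(κ * C.d X)) := by ring

/-- SPECIES ⟹ SINGLE (the maximum): `DataLipschitz₂ κ Λop Λhist ρ₀` gives `DataLipschitz κ (max Λop Λhist) ρ₀`.  With the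
previous theorem: the two shapes are inter-derivable up to constants — the species form introduces NO new wall and removes
none; it only books WHICH modulus multiplies what in the recursion (§2). [folklore] -/
theorem dataLipschitz_of_dataLipschitz₂ {W : Set (ℕ → ℝ)} {κ Λop Λhist ρ₀ : ℝ} (h : DataLipschitz₂ M W κ Λop Λhist ρ₀) :
    M.DataLipschitz W κ (max Λop Λhist) ρ₀ := by
  intro k g hg U p hp X hX q hq1 hq2
  have ha : 0 ≤ ‖q.1 - p.1‖ / M.rOp k := div_nonneg (norm_nonneg _) (M.rOp_pos k).le
  have hb : 0 ≤ ‖q.2 - p.2‖ / M.rHist k := div_nonneg (norm_nonneg _) (M.rHist_pos k).le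
  calc ‖M.Out k q.1 q.2 X - M.Out k p.1 p.2 X‖
      ≤ (Λop * (‖q.1 - p.1‖ / M.rOp k) + Λhist * (‖q.2 - p.2‖ / M.rHist k)) * Real.exp (-(κ * C.d X)) :=
        h k g hg U p hp X hX q hq1 hq2
    _ ≤ (max Λop Λhist * (‖q.1 - p.1‖ / M.rOp k) + max Λop Λhist * (‖q.2 - p.2‖ / M.rHist k)) *
          Real.exp (-(κ * C.d X)) :=
        mul_le_mul_of_nonneg_right (add_le_add (mul_le_mul_of_nonneg_right (le_max_left _ _) ha)
          (mul_le_mul_of_nonneg_right (le_max_right _ _) hb)) (Real.exp_pos _).le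
    _ = max Λop Λhist * (‖q.1 - p.1‖ / M.rOp k + ‖q.2 - p.2‖ / M.rHist k) * Real.exp (-(κ * C.d X)) := by ring

/-- Monotonicity of the species form in both moduli. [folklore] -/
theorem dataLipschitz₂_mono {W : Set (ℕ → ℝ)} {κ Λop Λhist Λop' Λhist' ρ₀ : ℝ} (h : DataLipschitz₂ M W κ Λop Λhist ρ₀)
    (hop : Λop ≤ Λop') (hhist : Λhist ≤ Λhist') : DataLipschitz₂ M W κ Λop' Λhist' ρ₀ := by
  intro k g hg U p hp X hX q hq1 hq2
  have ha : 0 ≤ ‖q.1 - p.1‖ / M.rOp k := div_nonneg (norm_nonneg _) (M.rOp_pos k).le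
  have hb : 0 ≤ ‖q.2 - p.2‖ / M.rHist k := div_nonneg (norm_nonneg _) (M.rHist_pos k).le
  exact (h k g hg U p hp X hX q hq1 hq2).trans (mul_le_mul_of_nonneg_right (add_le_add
    (mul_le_mul_of_nonneg_right hop ha) (mul_le_mul_of_nonneg_right hhist hb)) (Real.exp_pos _).le)

/-! ### The two Cauchy legs, one species at a time, with SEPARATE envelope constants -/

/-- THE OPERATOR LEG: `OpFibreEnvelope κ Gop` ⟹ at every base point, for every history datum `h` in the history ball and every
operator datum `o` within relative reach `ρ₀ < 1`, `‖Out k o h X − Out k p.1 h X‖ ≤ (Gop/(1 − ρ₀))·(‖o − p.1‖/rOp)·e^{−κd}`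
(one unit-disc Cauchy estimate in the direction `u = (o − p.1)/a`, `a = ‖o − p.1‖/rOp`, at the point `ζ = a`). [folklore] -/
theorem opLeg_of_opFibreEnvelope {W : Set (ℕ → ℝ)} {κ Gop ρ₀ : ℝ} (hopF : M.OpFibreEnvelope W κ Gop) (hρ₀ : ρ₀ < 1) :
    ∀ k, ∀ g ∈ W, ∀ (U : C.BgB) (p : Op × Hist), p ∈ M.Base k g U → ∀ X : C.Dom, C.scale X = k →
      ∀ h ∈ closedBall p.2 (M.rHist k), ∀ o : Op, ‖o - p.1‖ ≤ ρ₀ * M.rOp k →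
        ‖M.Out k o h X - M.Out k p.1 h X‖ ≤ Gop / (1 - ρ₀) * (‖o - p.1‖ / M.rOp k) * Real.exp (-(κ * C.d X)) := by
  intro k g hg U p hp X hX h hh o ho
  have hrOp := M.rOp_pos k
  set a := ‖o - p.1‖ / M.rOp k with ha_def
  have ha0 : 0 ≤ a := by positivity
  have hqa : ‖o - p.1‖ = a * M.rOp k := by rw [ha_def, div_mul_cancel₀ _ hrOp.ne']
  have haρ : a ≤ ρ₀ := le_of_mul_le_mul_right (by rw [← hqa]; exact ho) hrOp
  rcases ha0.eq_or_lt with hzero | hpos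
  · have h0 : ‖o - p.1‖ = 0 := by rw [hqa, ← hzero, zero_mul]
    rw [norm_eq_zero, sub_eq_zero] at h0
    rw [h0, sub_self, norm_zero, ← hzero, mul_zero, zero_mul]
  · have hne : (a : ℂ) ≠ 0 := Complex.ofReal_ne_zero.mpr hpos.ne'
    set u : Op := (a : ℂ)⁻¹ • (o - p.1) with hu_def
    have hu : ‖u‖ ≤ M.rOp k := by
      rw [hu_def, norm_smul, norm_inv, Complex.norm_real, Real.norm_eq_abs, abs_of_pos hpos, hqa,
        inv_mul_cancel_left₀ hpos.ne']
    obtain ⟨hdiff, hbd⟩ := hopF k g hg U p hp X hX h hh u hu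
    have hend : p.1 + (a : ℂ) • u = o := by
      rw [hu_def, smul_smul, mul_inv_cancel₀ hne, one_smul, add_sub_cancel]
    have key := norm_sub_le_of_unitDisc_near hdiff hbd ha0 hρ₀ haρ
    beta_reduce at key
    rw [hend, zero_smul, add_zero] at key
    calc ‖M.Out k o h X - M.Out k p.1 h X‖ ≤ Gop * Real.exp (-(κ * C.d X)) / (1 - ρ₀) * a := key
      _ = Gop / (1 - ρ₀) * a * Real.exp (-(κ * C.d X)) := by ring

/-- THE HISTORY LEG: `HistFibreEnvelope κ Ghist` ⟹ at every base point, for every operator datum `o` in the operator ball and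
every history datum `h` within relative reach `ρ₀ < 1`, `‖Out k o h X − Out k o p.2 X‖ ≤ (Ghist/(1 − ρ₀))·(‖h − p.2‖/rHist)·e^{−κd}`.
[folklore] -/
theorem histLeg_of_histFibreEnvelope {W : Set (ℕ → ℝ)} {κ Ghist ρ₀ : ℝ} (hhistF : M.HistFibreEnvelope W κ Ghist)
    (hρ₀ : ρ₀ < 1) :
    ∀ k, ∀ g ∈ W, ∀ (U : C.BgB) (p : Op × Hist), p ∈ M.Base k g U → ∀ X : C.Dom, C.scale X = k →
      ∀ o ∈ closedBall p.1 (M.rOp k), ∀ h : Hist, ‖h - p.2‖ ≤ ρ₀ * M.rHist k →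
        ‖M.Out k o h X - M.Out k o p.2 X‖ ≤ Ghist / (1 - ρ₀) * (‖h - p.2‖ / M.rHist k) * Real.exp (-(κ * C.d X)) := by
  intro k g hg U p hp X hX o ho h hh
  have hrHist := M.rHist_pos k
  set b := ‖h - p.2‖ / M.rHist k with hb_def
  have hb0 : 0 ≤ b := by positivity
  have hqb : ‖h - p.2‖ = b * M.rHist k := by rw [hb_def, div_mul_cancel₀ _ hrHist.ne']
  have hbρ : b ≤ ρ₀ := le_of_mul_le_mul_right (by rw [← hqb]; exact hh) hrHist
  rcases hb0.eq_or_lt with hzero | hpos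
  · have h0 : ‖h - p.2‖ = 0 := by rw [hqb, ← hzero, zero_mul]
    rw [norm_eq_zero, sub_eq_zero] at h0
    rw [h0, sub_self, norm_zero, ← hzero, mul_zero, zero_mul]
  · have hne : (b : ℂ) ≠ 0 := Complex.ofReal_ne_zero.mpr hpos.ne'
    set v : Hist := (b : ℂ)⁻¹ • (h - p.2) with hv_def
    have hv : ‖v‖ ≤ M.rHist k := by
      rw [hv_def, norm_smul, norm_inv, Complex.norm_real, Real.norm_eq_abs, abs_of_pos hpos, hqb,
        inv_mul_cancel_left₀ hpos.ne']
    obtain ⟨hdiff, hbd⟩ := hhistF k g hg U p hp X hX o ho v hv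
    have hend : p.2 + (b : ℂ) • v = h := by
      rw [hv_def, smul_smul, mul_inv_cancel₀ hne, one_smul, add_sub_cancel]
    have key := norm_sub_le_of_unitDisc_near hdiff hbd hb0 hρ₀ hbρ
    beta_reduce at key
    rw [hend, zero_smul, add_zero] at key
    calc ‖M.Out k o h X - M.Out k o p.2 X‖ ≤ Ghist * Real.exp (-(κ * C.d X)) / (1 - ρ₀) * b := key
      _ = Ghist / (1 - ρ₀) * b * Real.exp (-(κ * C.d X)) := by ring

/-- **FIBREWISE ANALYTICITY WITH SEPARATE CONSTANTS ⟹ THE SPECIES FORM**: `OpFibreEnvelope κ Gop` and `HistFibreEnvelope κ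
Ghist` with `ρ₀ < 1` give `DataLipschitz₂ κ (Gop/(1 − ρ₀)) (Ghist/(1 − ρ₀)) ρ₀` (the two legs: operators moved at the admissible
history `p.2`, then the history moved at the reached operators `q.1 ∈ closedBall p.1 rOp`).  File v5's
`dataLipschitz_of_fibreEnvelopes` is the diagonal `Gop = Ghist = G`. [folklore] -/
theorem dataLipschitz₂_of_fibreEnvelopes {W : Set (ℕ → ℝ)} {κ Gop Ghist ρ₀ : ℝ} (hopF : M.OpFibreEnvelope W κ Gop)
    (hhistF : M.HistFibreEnvelope W κ Ghist) (hρ₀ : ρ₀ < 1) :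
    DataLipschitz₂ M W κ (Gop / (1 - ρ₀)) (Ghist / (1 - ρ₀)) ρ₀ := by
  intro k g hg U p hp X hX q hq1 hq2
  have hrOp := M.rOp_pos k
  have hrHist := M.rHist_pos k
  have leg1 := opLeg_of_opFibreEnvelope M hopF hρ₀ k g hg U p hp X hX p.2 (mem_closedBall_self hrHist.le) q.1 hq1
  have ho : q.1 ∈ closedBall p.1 (M.rOp k) := by
    rw [mem_closedBall, dist_eq_norm]
    calc ‖q.1 - p.1‖ ≤ ρ₀ * M.rOp k := hq1
      _ ≤ 1 * M.rOp k := mul_le_mul_of_nonneg_right hρ₀.le hrOp.le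
      _ = M.rOp k := one_mul _
  have leg2 := histLeg_of_histFibreEnvelope M hhistF hρ₀ k g hg U p hp X hX q.1 ho q.2 hq2
  calc ‖M.Out k q.1 q.2 X - M.Out k p.1 p.2 X‖
      ≤ ‖M.Out k q.1 q.2 X - M.Out k q.1 p.2 X‖ + ‖M.Out k q.1 p.2 X - M.Out k p.1 p.2 X‖ :=
        norm_sub_le_norm_sub_add_norm_sub _ _ _
    _ ≤ Ghist / (1 - ρ₀) * (‖q.2 - p.2‖ / M.rHist k) * Real.exp (-(κ * C.d X)) +
          Gop / (1 - ρ₀) * (‖q.1 - p.1‖ / M.rOp k) * Real.exp (-(κ * C.d X)) := add_le_add leg2 leg1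
    _ = (Gop / (1 - ρ₀) * (‖q.1 - p.1‖ / M.rOp k) + Ghist / (1 - ρ₀) * (‖q.2 - p.2‖ / M.rHist k)) *
          Real.exp (-(κ * C.d X)) := by ring

end Species

/-! ## §2 The scale recursion with species-separated moduli: ONLY the history modulus multiplies the feedback gain -/

section Recursion

variable {C : Carriers} {Op Hist : Type*} [NormedAddCommGroup Op] [NormedSpace ℂ Op] [NormedAddCommGroup Hist]
  [NormedSpace ℂ Hist] (M : StepModel C Op Hist)

/-- **THE STEP FROM THE SPECIES FORM.**  The hypotheses of file v5's `recursiveRate_of_stepModel_lip` with `DataLipschitz κ Λ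
ρ₀` replaced by `DataLipschitz₂ κ Λop Λhist ρ₀` (and `0 ≤ δ`, `0 ≤ δ′` separately) ⟹
`RecursiveRate EA EB W κ θ ω (Λop·δ + Λhist·δ′ + B) (Λhist·c)`: the operator-species modulus `Λop` multiplies the operator
rate `δ` (MI-1) and NOTHING ELSE; the history-species modulus `Λhist` multiplies the insertion rate `δ′` (G-ne5p1-4) and the
feedback gain `c` (MI-3a).  The history constant `b = Λhist·c` of the recursive budget — the only constant entering the
load-bearing smallness `(1 + b)ω < θ′` of `ne5_of_recursiveRate` — does not see `Λop`. [folklore] -/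
theorem recursiveRate_of_stepModel_lip₂ {EA : Functional C C.BgA} {EB : Functional C C.BgB} {W : Set (ℕ → ℝ)}
    {κ Λop Λhist EA₀ E₀ δ δ' θ c ω ρ₀ B : ℝ} {k₀ : ℕ} (hrA : M.RepresentsA EA W) (hrB : M.RepresentsB EB W)
    (hbase : M.InBase EB W) (hlip : DataLipschitz₂ M W κ Λop Λhist ρ₀) (hdA : DecayBound EA W EA₀ κ)
    (hdB : DecayBound EB W E₀ κ) (hop : M.OperatorRate W δ θ) (hins : M.InsertionRate W κ E₀ δ' θ)
    (hdamp : M.InsertionDamped W κ c ω) (hΛop : 0 ≤ Λop) (hΛhist : 0 ≤ Λhist) (hδ : 0 ≤ δ) (hδ' : 0 ≤ δ')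
    (hθ : 0 ≤ θ) (hθ1 : θ ≤ 1) (hc : 0 ≤ c) (hω : 0 ≤ ω) (hω1 : ω < 1)
    (hnear : (δ + δ') * θ ^ k₀ + c * (EA₀ + E₀) * (ω / (1 - ω)) ≤ ρ₀) (hB : 0 ≤ B)
    (hfirst : ∀ k < k₀, EA₀ + E₀ ≤ B * θ ^ k) :
    RecursiveRate EA EB W κ θ ω (Λop * δ + Λhist * δ' + B) (Λhist * c) := by
  intro k D hD g hg U X hX
  -- the two data points
  set x₀ := M.opB g U k with hx₀
  set x₁ := M.opA g U k with hx₁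
  set y₀ := M.insB g U k (tableB EB g U) with hy₀
  set y₁ := M.insA g U k (tableA EA g U) with hy₁
  have hrOp := M.rOp_pos k
  have hrHist := M.rHist_pos k
  have hexp := Real.exp_pos (-(κ * C.d X))
  have hθk : 0 ≤ θ ^ k := pow_nonneg hθ k
  -- the one-run levels are nonnegative (read at the point at hand)
  have hEA₀ : 0 ≤ EA₀ := by
    by_contra hneg
    have : EA₀ * Real.exp (-(κ * C.d X)) < 0 := mul_neg_of_neg_of_pos (not_le.mp hneg) hexp
    linarith [abs_nonneg (EA g (C.transport U) X), hdA g hg (C.transport U) X]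
  have hE₀ : 0 ≤ E₀ := by
    by_contra hneg
    have : E₀ * Real.exp (-(κ * C.d X)) < 0 := mul_neg_of_neg_of_pos (not_le.mp hneg) hexp
    linarith [abs_nonneg (EB g U X), hdB g hg U X]
  -- the inherited levels, and the CAPPED levels `min (D j) (EA₀ + E₀)`
  set S := ∑ j ∈ range k, ω ^ (k - j) * D j with hS
  set S' := ∑ j ∈ range k, ω ^ (k - j) * min (D j) (EA₀ + E₀) with hS'
  have hD'0 : ∀ j < k, 0 ≤ min (D j) (EA₀ + E₀) := fun j hj => le_min (hD j hj).1 (add_nonneg hEA₀ hE₀)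
  have hS'0 : 0 ≤ S' := sum_nonneg fun j hj => mul_nonneg (pow_nonneg hω _) (hD'0 j (mem_range.1 hj))
  have hS'S : S' ≤ S :=
    sum_le_sum fun j hj => mul_le_mul_of_nonneg_left (min_le_left _ _) (pow_nonneg hω _)
  have hS'E : S' ≤ (EA₀ + E₀) * (ω / (1 - ω)) :=
    calc S' ≤ ∑ j ∈ range k, ω ^ (k - j) * (EA₀ + E₀) :=
          sum_le_sum fun j hj => mul_le_mul_of_nonneg_left (min_le_right _ _) (pow_nonneg hω _)
      _ = (EA₀ + E₀) * ∑ j ∈ range k, ω ^ (k - j) := by rw [mul_sum]; exact sum_congr rfl fun j _ => mul_comm _ _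
      _ ≤ (EA₀ + E₀) * (ω / (1 - ω)) := mul_le_mul_of_nonneg_left (sum_pow_age_le hω hω1 k) (add_nonneg hEA₀ hE₀)
  -- every earlier table discrepancy is bounded by the inherited level AND by the one-run levels
  have htab : ∀ Y, C.scale Y < k →
      |tableA EA g U Y - tableB EB g U Y| ≤ min (D (C.scale Y)) (EA₀ + E₀) * Real.exp (-(κ * C.d Y)) := by
    intro Y hY
    rw [min_mul_of_nonneg _ _ (Real.exp_pos _).le]
    refine le_min ((hD (C.scale Y) hY).2 g hg U Y rfl) ?_
    calc |tableA EA g U Y - tableB EB g U Y| ≤ |tableA EA g U Y| + |tableB EB g U Y| := abs_sub _ _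
      _ ≤ EA₀ * Real.exp (-(κ * C.d Y)) + E₀ * Real.exp (-(κ * C.d Y)) := add_le_add (hdA g hg _ Y) (hdB g hg U Y)
      _ = (EA₀ + E₀) * Real.exp (-(κ * C.d Y)) := by ring
  -- operator discrepancy in margin units (MI-1); history discrepancy from the CAPPED levels (MI-3a) + insertion rate
  have hxd : ‖x₁ - x₀‖ ≤ δ * θ ^ k * M.rOp k := hop k g hg U
  have hdamp' : ‖y₁ - M.insA g U k (tableB EB g U)‖ ≤ M.rHist k * (c * S') :=
    hdamp k g hg U (tableA EA g U) (tableB EB g U) (fun j => min (D j) (EA₀ + E₀)) hD'0 htab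
  have hins' := hins k g hg U (tableB EB g U) (fun Y => hdB g hg U Y)
  have hyd : ‖y₁ - y₀‖ ≤ (c * S' + δ' * θ ^ k) * M.rHist k :=
    calc ‖y₁ - y₀‖ ≤ ‖y₁ - M.insA g U k (tableB EB g U)‖ + ‖M.insA g U k (tableB EB g U) - y₀‖ :=
          norm_sub_le_norm_sub_add_norm_sub _ _ _
      _ ≤ M.rHist k * (c * S') + δ' * θ ^ k * M.rHist k := add_le_add hdamp' hins'
      _ = (c * S' + δ' * θ ^ k) * M.rHist k := by ring
  -- the relative displacement PER SPECIES and its a-priori budget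
  set a := ‖x₁ - x₀‖ / M.rOp k with ha_def
  set b := ‖y₁ - y₀‖ / M.rHist k with hb_def
  have ha0 : 0 ≤ a := by positivity
  have hb0 : 0 ≤ b := by positivity
  have haδ : a ≤ δ * θ ^ k := by rw [ha_def, div_le_iff₀ hrOp]; exact hxd
  have hbδ : b ≤ c * S' + δ' * θ ^ k := by rw [hb_def, div_le_iff₀ hrHist]; exact hyd
  have hbS : b ≤ c * S + δ' * θ ^ k := by
    have := mul_le_mul_of_nonneg_left hS'S hc
    linarith
  -- the two runs' outputs are the real parts of the step output at the two data points
  have hdisc : disc EA EB g U X ≤ ‖M.Out k x₁ y₁ X - M.Out k x₀ y₀ X‖ := by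
    have eA := hrA g hg U X
    have eB := hrB g hg U X
    rw [hX] at eA eB
    unfold disc
    rw [eA, eB, ← Complex.sub_re]
    exact Complex.abs_re_le_norm _
  -- bookkeeping of the history sum
  have hsum : ∑ j ∈ range k, Λhist * c * ω ^ (k - j) * D j = Λhist * c * S := by
    rw [hS, mul_sum]
    exact sum_congr rfl fun j _ => by ring
  have hS0 : 0 ≤ S := hS'0.trans hS'S
  by_cases hk : k < k₀
  · -- FIRST SCALES: the one-run bounds, absorbed by the constant B
    calc disc EA EB g U X ≤ |EA g (C.transport U) X| + |EB g U X| := abs_sub _ _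
      _ ≤ EA₀ * Real.exp (-(κ * C.d X)) + E₀ * Real.exp (-(κ * C.d X)) :=
          add_le_add (hdA g hg _ X) (hdB g hg U X)
      _ = (EA₀ + E₀) * Real.exp (-(κ * C.d X)) := by ring
      _ ≤ B * θ ^ k * Real.exp (-(κ * C.d X)) := mul_le_mul_of_nonneg_right (hfirst k hk) hexp.le
      _ ≤ ((Λop * δ + Λhist * δ' + B) * θ ^ k + ∑ j ∈ range k, Λhist * c * ω ^ (k - j) * D j) *
            Real.exp (-(κ * C.d X)) := by
          rw [hsum]
          apply mul_le_mul_of_nonneg_right _ hexp.le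
          have h1 : 0 ≤ Λop * δ * θ ^ k := mul_nonneg (mul_nonneg hΛop hδ) hθk
          have h2 : 0 ≤ Λhist * δ' * θ ^ k := mul_nonneg (mul_nonneg hΛhist hδ') hθk
          have h3 : 0 ≤ Λhist * c * S := mul_nonneg (mul_nonneg hΛhist hc) hS0
          linarith
  · -- NEAR REGIME k ≥ k₀: each species is displaced by at most ρ₀ margins, and the species bound applies
    push Not at hk
    have hθkk₀ : θ ^ k ≤ θ ^ k₀ := pow_le_pow_of_le_one hθ hθ1 hk
    have hρ1 : a + b ≤ ρ₀ :=
      calc a + b ≤ (δ + δ') * θ ^ k + c * S' := by linarith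
        _ ≤ (δ + δ') * θ ^ k₀ + c * ((EA₀ + E₀) * (ω / (1 - ω))) :=
            add_le_add (mul_le_mul_of_nonneg_left hθkk₀ (add_nonneg hδ hδ')) (mul_le_mul_of_nonneg_left hS'E hc)
        _ = (δ + δ') * θ ^ k₀ + c * (EA₀ + E₀) * (ω / (1 - ω)) := by ring
        _ ≤ ρ₀ := hnear
    have hq1 : ‖x₁ - x₀‖ ≤ ρ₀ * M.rOp k := by
      have : a ≤ ρ₀ := (le_add_of_nonneg_right hb0).trans hρ1
      rwa [ha_def, div_le_iff₀ hrOp] at this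
    have hq2 : ‖y₁ - y₀‖ ≤ ρ₀ * M.rHist k := by
      have : b ≤ ρ₀ := (le_add_of_nonneg_left ha0).trans hρ1
      rwa [hb_def, div_le_iff₀ hrHist] at this
    have h2 : ‖M.Out k x₁ y₁ X - M.Out k x₀ y₀ X‖ ≤ (Λop * a + Λhist * b) * Real.exp (-(κ * C.d X)) :=
      hlip k g hg U (M.dataB EB g U k) (hbase k g hg U) X hX (x₁, y₁) hq1 hq2
    calc disc EA EB g U X ≤ _ := hdisc
      _ ≤ (Λop * a + Λhist * b) * Real.exp (-(κ * C.d X)) := h2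
      _ ≤ (Λop * (δ * θ ^ k) + Λhist * (c * S + δ' * θ ^ k)) * Real.exp (-(κ * C.d X)) :=
          mul_le_mul_of_nonneg_right
            (add_le_add (mul_le_mul_of_nonneg_left haδ hΛop) (mul_le_mul_of_nonneg_left hbS hΛhist)) hexp.le
      _ ≤ ((Λop * δ + Λhist * δ' + B) * θ ^ k + ∑ j ∈ range k, Λhist * c * ω ^ (k - j) * D j) *
            Real.exp (-(κ * C.d X)) := by
          rw [hsum]
          apply mul_le_mul_of_nonneg_right _ hexp.le
          have h1 : 0 ≤ B * θ ^ k := mul_nonneg hB hθk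
          linarith

/-! ### Closures: the load-bearing smallness is `ω + Λhist·c < θ′`; `Λop`, `δ`, `δ′`, `B` enter the constant only -/

/-- **NE5 AT ANY SLOWER RATE FROM THE SPECIES FORM, printed age normalisation.**  Natural history gain `c` at damping `ω > 0`
(`InsertionDampedNat`), inputs at rate `θ`, output NE5 at every `θ′ ∈ [θ, 1]` under the load-bearing smallness
`ω + Λhist·c < θ′` — the OPERATOR-species modulus `Λop` is ABSENT from it — with constant
`(Λop·δ + Λhist·δ′ + B)(θ′ − ω)/(θ′ − (ω + Λhist·c))`.  [analysis] Census reading (module docstring): the NE5 EXPONENT of this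
route is constrained by the input rate `θ`, the age damping `ω` and the product (history-species modulus) × (natural history
gain) ONLY; the operator-species wall and the rate CONSTANTS `δ`, `δ′` bear on `C₅`. [folklore] -/
theorem ne5_at_of_stepModel_lip₂_nat {EA : Functional C C.BgA} {EB : Functional C C.BgB} {W : Set (ℕ → ℝ)}
    {κ Λop Λhist EA₀ E₀ δ δ' θ θ' c ω ρ₀ B : ℝ} {k₀ : ℕ} (hrA : M.RepresentsA EA W) (hrB : M.RepresentsB EB W)
    (hbase : M.InBase EB W) (hlip : DataLipschitz₂ M W κ Λop Λhist ρ₀) (hdA : DecayBound EA W EA₀ κ)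
    (hdB : DecayBound EB W E₀ κ) (hop : M.OperatorRate W δ θ) (hins : M.InsertionRate W κ E₀ δ' θ)
    (hdamp : M.InsertionDampedNat W κ c ω) (hΛop : 0 ≤ Λop) (hΛhist : 0 ≤ Λhist) (hδ : 0 ≤ δ) (hδ' : 0 ≤ δ')
    (hθ : 0 ≤ θ) (hθθ' : θ ≤ θ') (hθ'1 : θ' ≤ 1) (hc : 0 ≤ c) (hω : 0 < ω)
    (hnear : (δ + δ') * θ ^ k₀ + c * (EA₀ + E₀) / (1 - ω) ≤ ρ₀) (hB : 0 ≤ B)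
    (hfirst : ∀ k < k₀, EA₀ + E₀ ≤ B * θ ^ k) (hsmall : ω + Λhist * c < θ') :
    NE5 EA EB W κ θ' ((Λop * δ + Λhist * δ' + B) * (θ' - ω) / (θ' - (ω + Λhist * c))) := by
  have hΛc : 0 ≤ Λhist * c := mul_nonneg hΛhist hc
  have hω1 : ω < 1 := by linarith
  have h1 : (1 + Λhist * (c / ω)) * ω = ω + Λhist * c := by
    rw [add_mul, one_mul, mul_assoc Λhist, div_mul_cancel₀ c hω.ne']
  have h2 : c / ω * (EA₀ + E₀) * (ω / (1 - ω)) = c * (EA₀ + E₀) / (1 - ω) := by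
    rw [← mul_div_assoc, div_mul_eq_mul_div, div_mul_cancel₀ _ hω.ne']
  have hrec := recursiveRate_of_stepModel_lip₂ M hrA hrB hbase hlip hdA hdB hop hins (M.insertionDamped_of_nat hdamp hω)
    hΛop hΛhist hδ hδ' hθ (hθθ'.trans hθ'1) (div_nonneg hc hω.le) hω.le hω1 (by rw [h2]; exact hnear) hB hfirst
  have key := ne5_at_of_recursiveRate (add_nonneg (add_nonneg (mul_nonneg hΛop hδ) (mul_nonneg hΛhist hδ')) hB)
    (mul_nonneg hΛhist (div_nonneg hc hω.le)) hω.le hθ hθθ' (by rw [h1]; exact hsmall) hrec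
  rwa [h1] at key

/-- **EXISTENCE OF A RATE NEEDS ONLY ROOM IN THE HISTORY SPECIES**: at an input rate `θ < 1`, the single condition
`ω + Λhist·c < 1` yields SOME rate `θ′ < 1` with a constant (witness `θ′ = max(θ, (ω + Λhist·c + 1)/2)`); `Λop` is
unconstrained. [folklore] -/
theorem exists_rate_of_stepModel_lip₂_nat {EA : Functional C C.BgA} {EB : Functional C C.BgB} {W : Set (ℕ → ℝ)}
    {κ Λop Λhist EA₀ E₀ δ δ' θ c ω ρ₀ B : ℝ} {k₀ : ℕ} (hrA : M.RepresentsA EA W) (hrB : M.RepresentsB EB W)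
    (hbase : M.InBase EB W) (hlip : DataLipschitz₂ M W κ Λop Λhist ρ₀) (hdA : DecayBound EA W EA₀ κ)
    (hdB : DecayBound EB W E₀ κ) (hop : M.OperatorRate W δ θ) (hins : M.InsertionRate W κ E₀ δ' θ)
    (hdamp : M.InsertionDampedNat W κ c ω) (hΛop : 0 ≤ Λop) (hΛhist : 0 ≤ Λhist) (hδ : 0 ≤ δ) (hδ' : 0 ≤ δ')
    (hθ : 0 ≤ θ) (hθ1 : θ < 1) (hc : 0 ≤ c) (hω : 0 < ω) (hnear : (δ + δ') * θ ^ k₀ + c * (EA₀ + E₀) / (1 - ω) ≤ ρ₀)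
    (hB : 0 ≤ B) (hfirst : ∀ k < k₀, EA₀ + E₀ ≤ B * θ ^ k) (hroom : ω + Λhist * c < 1) :
    ∃ θ', θ' < 1 ∧ ∃ C₅, NE5 EA EB W κ θ' C₅ :=
  ⟨max θ ((ω + Λhist * c + 1) / 2), max_lt hθ1 (by linarith), _,
    ne5_at_of_stepModel_lip₂_nat M hrA hrB hbase hlip hdA hdB hop hins hdamp hΛop hΛhist hδ hδ' hθ (le_max_left _ _)
      (max_le hθ1.le (by linarith)) hc hω hnear hB hfirst (lt_max_of_lt_right (by linarith))⟩

/-- **NE5 AT ANY SLOWER RATE WITH EVERY WALL IN ITS MOST PRIMITIVE TYPED FORM, SPECIES-RESOLVED**: the two fibre envelopes with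
SEPARATE constants `Gop` (W2-op) and `Ghist` (W2-hist), the structural insertion shapes + the single-scale term
`InsScaleBound κ E₁ c ω` (W3), the two input rates (W1, W4); smallness `ω + Ghist·c/(1 − ρ₀) < θ′` (NO `Gop`), constant
`(Gop·δ/(1 − ρ₀) + Ghist·δ′/(1 − ρ₀) + B)(θ′ − ω)/(θ′ − (ω + Ghist·c/(1 − ρ₀)))`. [folklore] -/
theorem ne5_at_of_stepModel_fibre₂_scale_nat {EA : Functional C C.BgA} {EB : Functional C C.BgB} {W : Set (ℕ → ℝ)}
    {κ Gop Ghist EA₀ E₀ E₁ δ δ' θ θ' c ω ρ₀ B : ℝ} {k₀ : ℕ} (hrA : M.RepresentsA EA W) (hrB : M.RepresentsB EB W)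
    (hbase : M.InBase EB W) (hopF : M.OpFibreEnvelope W κ Gop) (hhistF : M.HistFibreEnvelope W κ Ghist)
    (hdA : DecayBound EA W EA₀ κ) (hdB : DecayBound EB W E₀ κ) (hop : M.OperatorRate W δ θ)
    (hins : M.InsertionRate W κ E₀ δ' θ) (haff : M.InsAffine W) (hblind : M.InsBlind W) (hhom : M.InsHomog W)
    (hunit : M.InsScaleBound W κ E₁ c ω) (hE₁ : 0 < E₁) (hGop : 0 ≤ Gop) (hGhist : 0 ≤ Ghist) (hδ : 0 ≤ δ)
    (hδ' : 0 ≤ δ') (hθ : 0 ≤ θ) (hθθ' : θ ≤ θ') (hθ'1 : θ' ≤ 1) (hc : 0 ≤ c) (hω : 0 < ω) (hρ₀ : ρ₀ < 1)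
    (hnear : (δ + δ') * θ ^ k₀ + c * (EA₀ + E₀) / (1 - ω) ≤ ρ₀) (hB : 0 ≤ B) (hfirst : ∀ k < k₀, EA₀ + E₀ ≤ B * θ ^ k)
    (hsmall : ω + Ghist / (1 - ρ₀) * c < θ') :
    NE5 EA EB W κ θ'
      ((Gop / (1 - ρ₀) * δ + Ghist / (1 - ρ₀) * δ' + B) * (θ' - ω) / (θ' - (ω + Ghist / (1 - ρ₀) * c))) :=
  ne5_at_of_stepModel_lip₂_nat M hrA hrB hbase (dataLipschitz₂_of_fibreEnvelopes M hopF hhistF hρ₀) hdA hdB hop hins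
    (M.insertionDampedNat_of_affine haff (M.sizeDampedNat_of_scaleBound haff hblind hhom hunit hE₁))
    (div_nonneg hGop (by linarith)) (div_nonneg hGhist (by linarith)) hδ hδ' hθ hθθ' hθ'1 hc hω hnear hB hfirst hsmall

end Recursion

/-! ## §3 The deciding toy: unequal species sensitivities — the single-modulus closure is void, the species closure fires -/

section ToySpecies

/-- Toy run A of the species toy: `E_A(k) = 64·toyRate k` (operator artifact `64·(1/2)^k` plus the damped history feed of
file v5's toy). [folklore] -/
def toyEA₆₄ : Functional toyCarriers toyCarriers.BgA := fun _ _ X => 64 * toyRate (toyCarriers.scale X)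

/-- The species toy model: file v5's `toyModel` (operator data `(1/2)^k` versus `0`, the same insertion "read the previous
scale with gain 1/64" for both runs, base class `{o = 0, ‖h‖ ≤ 1}`, unit margins) with the output map replaced by
`Out(o, h) = 64·o + h` — operator-species sensitivity 64, history-species sensitivity 1 per unit margin. [folklore] -/
def toyModel₆₄ : StepModel toyCarriers ℂ ℂ :=
  { toyModel with Out := fun _ o h _ => 64 * o + h }

/-- Toy: run B (≡ 0) is represented. [folklore] -/
theorem toy₆₄_representsB : toyModel₆₄.RepresentsB toyEB Set.univ := by
  intro g _ U X
  simp [toyModel₆₄, toyModel, toyIns, toyEB, tableB]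

/-- Toy: run A is represented — `64·E(k) = 64·(1/2)^k + (1/64)·(64·E(k − 1))` is the toy recursion times 64. [folklore] -/
theorem toy₆₄_representsA : toyModel₆₄.RepresentsA toyEA₆₄ Set.univ := by
  intro g _ U X
  show 64 * toyRate (toyCarriers.scale X) =
    (64 * (((1 / 2 : ℝ) ^ toyCarriers.scale X : ℝ) : ℂ) +
      (if toyCarriers.scale X = 0 then (0 : ℂ)
        else ((1 / 64 * (64 * toyRate (toyCarriers.scale X - 1)) : ℝ) : ℂ))).re
  generalize toyCarriers.scale X = n
  have h := toyRate_step n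
  have hre : (64 * (((1 / 2 : ℝ) ^ n : ℝ) : ℂ) +
      (if n = 0 then (0 : ℂ) else ((1 / 64 * (64 * toyRate (n - 1)) : ℝ) : ℂ))) =
        ((64 * (1 / 2 : ℝ) ^ n + (if n = 0 then 0 else 1 / 64 * (64 * toyRate (n - 1))) : ℝ) : ℂ) := by
    split_ifs <;> push_cast <;> ring
  rw [hre, Complex.ofReal_re, h]
  split_ifs <;> ring

/-- Toy: run B's data `(0, 0)` lie in the base class. [folklore] -/
theorem toy₆₄_inBase : toyModel₆₄.InBase toyEB Set.univ := by
  intro k g _ U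
  simp [toyModel₆₄, toyModel, StepModel.dataB, toyIns, tableB, toyEB]

/-- Toy: one-run bound of run A with constant 192. [folklore] -/
theorem toy₆₄_decayA : DecayBound toyEA₆₄ Set.univ 192 0 := by
  intro g _ U X
  simp only [toyEA₆₄, zero_mul, neg_zero, Real.exp_zero, mul_one, abs_mul]
  have := abs_toyRate_le (toyCarriers.scale X)
  rw [abs_of_pos (by norm_num : (0 : ℝ) < 64)]
  linarith

/-- Toy: the operator rate is file v5's (`δ = 1`, `θ = 1/2`; the operator data are unchanged). [folklore] -/
theorem toy₆₄_operatorRate : toyModel₆₄.OperatorRate Set.univ 1 (1 / 2) := toy_operatorRate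

/-- Toy: the two runs insert identically (`δ′ = 0`). [folklore] -/
theorem toy₆₄_insertionRate : toyModel₆₄.InsertionRate Set.univ 0 3 0 (1 / 2) := toy_insertionRate

/-- Toy: the natural damped-Lipschitz bound of the insertion (gain `1/64`, damping `1/64`) is file v5's. [folklore] -/
theorem toy₆₄_insertionDampedNat : toyModel₆₄.InsertionDampedNat Set.univ 0 (1 / 64) (1 / 64) :=
  toy_insertionDampedNat

/-- Toy: the EXACT species moduli — `64·o + h` is `DataLipschitz₂` with `Λop = 64`, `Λhist = 1` (unit margins) for every
reach `ρ₀`. [folklore] -/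
theorem toy₆₄_dataLipschitz₂ (ρ₀ : ℝ) : DataLipschitz₂ toyModel₆₄ Set.univ 0 64 1 ρ₀ := by
  intro k g _ U p _ X _ q _ _
  show ‖(64 * q.1 + q.2) - (64 * p.1 + p.2)‖ ≤
    (64 * (‖q.1 - p.1‖ / 1) + 1 * (‖q.2 - p.2‖ / 1)) * Real.exp (-(0 * toyCarriers.d X))
  rw [zero_mul, neg_zero, Real.exp_zero, mul_one, one_mul, div_one, div_one,
    show (64 * q.1 + q.2) - (64 * p.1 + p.2) = 64 * (q.1 - p.1) + (q.2 - p.2) by ring]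
  calc ‖64 * (q.1 - p.1) + (q.2 - p.2)‖ ≤ ‖64 * (q.1 - p.1)‖ + ‖q.2 - p.2‖ := norm_add_le _ _
    _ = 64 * ‖q.1 - p.1‖ + ‖q.2 - p.2‖ := by rw [norm_mul, Complex.norm_ofNat]

/-- Toy, NECESSITY 1: every SINGLE modulus `Λ` of file v5's `DataLipschitz` with positive reach is `≥ 64` (test: base point
`(0, 0)` at step 0, second point `(ρ₀, 0)`). [folklore] -/
theorem toy₆₄_single_modulus_ge {Λ ρ₀ : ℝ} (h : toyModel₆₄.DataLipschitz Set.univ 0 Λ ρ₀) (hρ₀ : 0 < ρ₀) : 64 ≤ Λ := by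
  have hp : ((0 : ℂ), (0 : ℂ)) ∈ toyModel₆₄.Base 0 (fun _ => 1) () := by
    show (0 : ℂ) = 0 ∧ ‖(0 : ℂ)‖ ≤ 1
    simp
  have hq1 : ‖((ρ₀ : ℝ) : ℂ) - 0‖ ≤ ρ₀ * toyModel₆₄.rOp 0 := by
    show ‖((ρ₀ : ℝ) : ℂ) - 0‖ ≤ ρ₀ * 1
    rw [sub_zero, mul_one, Complex.norm_real, Real.norm_eq_abs, abs_of_pos hρ₀]
  have hq2 : ‖(0 : ℂ) - 0‖ ≤ ρ₀ * toyModel₆₄.rHist 0 := by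
    show ‖(0 : ℂ) - 0‖ ≤ ρ₀ * 1
    rw [sub_zero, norm_zero, mul_one]
    exact hρ₀.le
  have key := h 0 (fun _ => 1) (Set.mem_univ _) () ((0 : ℂ), (0 : ℂ)) hp (show toyCarriers.Dom from (0 : ℕ)) rfl
    (((ρ₀ : ℝ) : ℂ), (0 : ℂ)) hq1 hq2
  change ‖(64 * ((ρ₀ : ℝ) : ℂ) + 0) - (64 * 0 + 0)‖ ≤
    Λ * (‖((ρ₀ : ℝ) : ℂ) - 0‖ / 1 + ‖(0 : ℂ) - 0‖ / 1) * Real.exp (-(0 * (0 : ℝ))) at key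
  rw [add_zero, mul_zero, add_zero, sub_zero, sub_zero, sub_zero, norm_zero, zero_div, add_zero, div_one, mul_zero,
    neg_zero, Real.exp_zero, mul_one, norm_mul, Complex.norm_ofNat, Complex.norm_real, Real.norm_eq_abs,
    abs_of_pos hρ₀] at key
  exact le_of_mul_le_mul_right key hρ₀

/-- Toy, NECESSITY 2: every NATURAL history gain `c` of `InsertionDampedNat` (any damping `ω`) is `≥ 1/64` (test: step 1,
tables `1` versus `0` at scale 0). [folklore] -/
theorem toy₆₄_natural_gain_ge {c ω : ℝ} (h : toyModel₆₄.InsertionDampedNat Set.univ 0 c ω) : 1 / 64 ≤ c := by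
  have key := h 1 (fun _ => 1) (Set.mem_univ _) () (fun _ => 1) (fun _ => 0) (fun _ => 1) (fun _ _ => zero_le_one)
    (fun Y _ => by simp)
  change ‖toyIns 1 (fun _ => 1) - toyIns 1 (fun _ => 0)‖ ≤ 1 * (c * ∑ j ∈ range 1, ω ^ (1 - 1 - j) * (1 : ℝ)) at key
  have hL : toyIns 1 (fun _ => 1) - toyIns 1 (fun _ => 0) = ((1 / 64 : ℝ) : ℂ) := by
    simp [toyIns]
  have hR : ∑ j ∈ range 1, ω ^ (1 - 1 - j) * (1 : ℝ) = 1 := by simp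
  rw [hL, hR, Complex.norm_real, Real.norm_eq_abs, abs_of_pos (by norm_num : (0 : ℝ) < 1 / 64), one_mul, mul_one] at key
  exact key

/-- **THE SINGLE-MODULUS CLOSURE IS VOID ON THIS TOY.**  For every single modulus `Λ` with positive reach, every natural
history gain `c` at any damping `ω ≥ 0`, and every candidate rate `θ′ ≤ 1`, the load-bearing smallness `ω + Λ·c < θ′` of file
v5's `ne5_at_of_stepModel_lip_nat` FAILS (`Λ ≥ 64`, `c ≥ 1/64` ⟹ `ω + Λc ≥ 1 ≥ θ′`): conflating the species charges the
operator sensitivity 64 to the history feedback. [folklore] -/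
theorem toy₆₄_single_closure_void {Λ ρ₀ c ω θ' : ℝ} (hlip : toyModel₆₄.DataLipschitz Set.univ 0 Λ ρ₀) (hρ₀ : 0 < ρ₀)
    (hdamp : toyModel₆₄.InsertionDampedNat Set.univ 0 c ω) (hω : 0 ≤ ω) (hθ'1 : θ' ≤ 1) : ¬ (ω + Λ * c < θ') := by
  have hΛ := toy₆₄_single_modulus_ge hlip hρ₀
  have hc := toy₆₄_natural_gain_ge hdamp
  have hΛc : (64 : ℝ) * (1 / 64) ≤ Λ * c := mul_le_mul hΛ hc (by norm_num) (by linarith)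
  intro hs
  linarith

/-- **THE SPECIES CLOSURE FIRES**: with the exact moduli `Λop = 64`, `Λhist = 1` (reach `ρ₀ = 5`, so `k₀ = 0`, `B = 0`: the
near hypothesis `1 + (1/64)·195/(1 − 1/64) ≤ 5` holds from the first scale), `δ = 1`, `δ′ = 0`, `θ = θ′ = 1/2`, natural gain
`c = 1/64`, `ω = 1/64`; smallness `1/64 + 1·(1/64) < 1/2` (the operator modulus 64 does not enter); constant
`64·(31/64)/(30/64) = 992/15` against the true supremum `64·32/31 = 2048/31` (`toyRate_div_pow`). [folklore] -/
theorem toy₆₄_ne5 : NE5 toyEA₆₄ toyEB (Set.univ : Set (ℕ → ℝ)) 0 (1 / 2)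
    ((64 * 1 + 1 * 0 + 0) * (1 / 2 - 1 / 64) / (1 / 2 - (1 / 64 + 1 * (1 / 64)))) :=
  ne5_at_of_stepModel_lip₂_nat toyModel₆₄ (ρ₀ := 5) (B := 0) (k₀ := 0) toy₆₄_representsA toy₆₄_representsB
    toy₆₄_inBase (toy₆₄_dataLipschitz₂ 5) toy₆₄_decayA toy_decayB toy₆₄_operatorRate toy₆₄_insertionRate
    toy₆₄_insertionDampedNat (by norm_num) (by norm_num) (by norm_num) le_rfl (by norm_num) le_rfl (by norm_num)
    (by norm_num) (by norm_num) (by norm_num) le_rfl (fun k hk => absurd hk (Nat.not_lt_zero k)) (by norm_num)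

/-- The species-toy constant in lowest terms, above the true supremum `2048/31`. [folklore] -/
example : ((64 * 1 + 1 * 0 + 0) * (1 / 2 - 1 / 64) / (1 / 2 - (1 / 64 + 1 * (1 / 64))) : ℝ) = 992 / 15 ∧
    (2048 / 31 : ℝ) < 992 / 15 := by norm_num

/-- The true ratio `|E_A(k) − E_B(k)|/θ^k = 64·(32/31 − (1/31)(1/32)^k)` of the species toy. [folklore] -/
theorem toyEA₆₄_div_pow (k : ℕ) : 64 * toyRate k / (1 / 2 : ℝ) ^ k = 64 * (32 / 31 - 1 / 31 * (1 / 32 : ℝ) ^ k) := by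
  rw [mul_div_assoc, toyRate_div_pow]

end ToySpecies

/-! ## §4 The operator species needs no analyticity; the margin gauge -/

section Mixed

variable {C : Carriers} {Op Hist : Type*} [NormedAddCommGroup Op] [NormedSpace ℂ Op] [NormedAddCommGroup Hist]
  [NormedSpace ℂ Hist] (M : StepModel C Op Hist)

/-- HYPOTHESIS SHAPE `OpLipschitz κ Λop ρ₀` — a DIRECT two-point bound in the OPERATOR species (no analyticity): at every
base point `p`, at the admissible history `p.2`, operator data within relative reach `ρ₀` move the output by at most
`Λop·(‖o − p.1‖/rOp)·e^{−κd(X)}`.  Corresponds to nothing printed as a statement (it compares the step at two operator data);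
[analysis] printed MECHANISM of a non-Cauchy discharge: operator differences enter the constructions of [II] §1 through
resolvent-type identities, cf. the operator-perturbation bounds (2.16)–(2.17) p. 16 ((2.16) is quoted in the module
docstring; both located on the lineage loci sheet v1.3 l.15/22). [folklore] -/
def OpLipschitz (W : Set (ℕ → ℝ)) (κ Λop ρ₀ : ℝ) : Prop :=
  ∀ k, ∀ g ∈ W, ∀ (U : C.BgB) (p : Op × Hist), p ∈ M.Base k g U → ∀ X : C.Dom, C.scale X = k →
    ∀ o : Op, ‖o - p.1‖ ≤ ρ₀ * M.rOp k →
      ‖M.Out k o p.2 X - M.Out k p.1 p.2 X‖ ≤ Λop * (‖o - p.1‖ / M.rOp k) * Real.exp (-(κ * C.d X))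

/-- The Cauchy operator leg is ONE instance of `OpLipschitz` (modulus `Gop/(1 − ρ₀)`, reach `ρ₀ < 1`). [folklore] -/
theorem opLipschitz_of_opFibreEnvelope {W : Set (ℕ → ℝ)} {κ Gop ρ₀ : ℝ} (hopF : M.OpFibreEnvelope W κ Gop)
    (hρ₀ : ρ₀ < 1) : OpLipschitz M W κ (Gop / (1 - ρ₀)) ρ₀ :=
  fun k g hg U p hp X hX o ho =>
    opLeg_of_opFibreEnvelope M hopF hρ₀ k g hg U p hp X hX p.2 (mem_closedBall_self (M.rHist_pos k).le) o ho

/-- **MIXED DISCHARGE**: ANY operator two-point bound `OpLipschitz κ Λop ρ₀` + the HISTORY fibre envelope (Cauchy in the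
history species only) with `ρ₀ < 1` ⟹ `DataLipschitz₂ κ Λop (Ghist/(1 − ρ₀)) ρ₀`.  Booking: the operator-species wall W2-op
needs NO analyticity of the step in its operators — and since `Λop` is CONSTANT-ONLY (§2), however lossy `Λop` is, the NE5
exponent is untouched. [folklore] -/
theorem dataLipschitz₂_of_opLipschitz_histFibre {W : Set (ℕ → ℝ)} {κ Λop Ghist ρ₀ : ℝ}
    (hopL : OpLipschitz M W κ Λop ρ₀) (hhistF : M.HistFibreEnvelope W κ Ghist) (hρ₀ : ρ₀ < 1) :
    DataLipschitz₂ M W κ Λop (Ghist / (1 - ρ₀)) ρ₀ := by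
  intro k g hg U p hp X hX q hq1 hq2
  have hrOp := M.rOp_pos k
  have leg1 := hopL k g hg U p hp X hX q.1 hq1
  have ho : q.1 ∈ closedBall p.1 (M.rOp k) := by
    rw [mem_closedBall, dist_eq_norm]
    calc ‖q.1 - p.1‖ ≤ ρ₀ * M.rOp k := hq1
      _ ≤ 1 * M.rOp k := mul_le_mul_of_nonneg_right hρ₀.le hrOp.le
      _ = M.rOp k := one_mul _
  have leg2 := histLeg_of_histFibreEnvelope M hhistF hρ₀ k g hg U p hp X hX q.1 ho q.2 hq2
  calc ‖M.Out k q.1 q.2 X - M.Out k p.1 p.2 X‖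
      ≤ ‖M.Out k q.1 q.2 X - M.Out k q.1 p.2 X‖ + ‖M.Out k q.1 p.2 X - M.Out k p.1 p.2 X‖ :=
        norm_sub_le_norm_sub_add_norm_sub _ _ _
    _ ≤ Ghist / (1 - ρ₀) * (‖q.2 - p.2‖ / M.rHist k) * Real.exp (-(κ * C.d X)) +
          Λop * (‖q.1 - p.1‖ / M.rOp k) * Real.exp (-(κ * C.d X)) := add_le_add leg2 leg1
    _ = (Λop * (‖q.1 - p.1‖ / M.rOp k) + Ghist / (1 - ρ₀) * (‖q.2 - p.2‖ / M.rHist k)) *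
          Real.exp (-(κ * C.d X)) := by ring

end Mixed

section Gauge

variable {C : Carriers} {Op Hist : Type*} [NormedAddCommGroup Op] [NormedSpace ℂ Op] [NormedAddCommGroup Hist]
  [NormedSpace ℂ Hist] (M : StepModel C Op Hist)

/-- THE MARGIN GAUGE: the SAME step model read in other margin units — operator margin `s·rOp`, history margin `t·rHist`
(`0 < s`, `0 < t`); the output functional, both runs' operator data and insertions, and the admissible class are
UNCHANGED.  [analysis] The margins are bookkeeping units of the typing, not data of the problem; the load-bearing content
of a hypothesis set is what survives every regauge. [folklore] -/
def regauge (s t : ℝ) (hs : 0 < s) (ht : 0 < t) : StepModel C Op Hist where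
  Out := M.Out
  opA := M.opA
  opB := M.opB
  insA := M.insA
  insB := M.insB
  Base := M.Base
  rOp := fun k => s * M.rOp k
  rHist := fun k => t * M.rHist k
  rOp_pos := fun k => mul_pos hs (M.rOp_pos k)
  rHist_pos := fun k => mul_pos ht (M.rHist_pos k)

variable {s t : ℝ} (hs : 0 < s) (ht : 0 < t)

/-- Margin-free shapes are gauge-INVARIANT on the nose (definitionally): representation of run A. [folklore] -/
theorem regauge_representsA {EA : Functional C C.BgA} {W : Set (ℕ → ℝ)} :
    (regauge M s t hs ht).RepresentsA EA W ↔ M.RepresentsA EA W := Iff.rfl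

/-- … representation of run B. [folklore] -/
theorem regauge_representsB {EB : Functional C C.BgB} {W : Set (ℕ → ℝ)} :
    (regauge M s t hs ht).RepresentsB EB W ↔ M.RepresentsB EB W := Iff.rfl

/-- … admissibility of run B's data. [folklore] -/
theorem regauge_inBase {EB : Functional C C.BgB} {W : Set (ℕ → ℝ)} :
    (regauge M s t hs ht).InBase EB W ↔ M.InBase EB W := Iff.rfl

/-- COVARIANCE of the operator rate: `δ` operator margins = `δ/s` regauged operator margins. [folklore] -/
theorem operatorRate_regauge {W : Set (ℕ → ℝ)} {δ θ : ℝ} (h : M.OperatorRate W δ θ) :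
    (regauge M s t hs ht).OperatorRate W (δ / s) θ := by
  intro k g hg U
  show ‖M.opA g U k - M.opB g U k‖ ≤ δ / s * θ ^ k * (s * M.rOp k)
  rw [show δ / s * θ ^ k * (s * M.rOp k) = δ * θ ^ k * M.rOp k by field_simp]
  exact h k g hg U

/-- COVARIANCE of the insertion rate: `δ′ ↦ δ′/t`. [folklore] -/
theorem insertionRate_regauge {W : Set (ℕ → ℝ)} {κ E₀ δ' θ : ℝ} (h : M.InsertionRate W κ E₀ δ' θ) :
    (regauge M s t hs ht).InsertionRate W κ E₀ (δ' / t) θ := by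
  intro k g hg U tab htab
  show ‖M.insA g U k tab - M.insB g U k tab‖ ≤ δ' / t * θ ^ k * (t * M.rHist k)
  rw [show δ' / t * θ ^ k * (t * M.rHist k) = δ' * θ ^ k * M.rHist k by field_simp]
  exact h k g hg U tab htab

/-- COVARIANCE of the damped-Lipschitz insertion (model age normalisation): `c ↦ c/t`. [folklore] -/
theorem insertionDamped_regauge {W : Set (ℕ → ℝ)} {κ c ω : ℝ} (h : M.InsertionDamped W κ c ω) :
    (regauge M s t hs ht).InsertionDamped W κ (c / t) ω := by
  intro k g hg U tab tab' D hD htab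
  show ‖M.insA g U k tab - M.insA g U k tab'‖ ≤ t * M.rHist k * (c / t * ∑ j ∈ range k, ω ^ (k - j) * D j)
  rw [show t * M.rHist k * (c / t * ∑ j ∈ range k, ω ^ (k - j) * D j) =
    M.rHist k * (c * ∑ j ∈ range k, ω ^ (k - j) * D j) by field_simp]
  exact h k g hg U tab tab' D hD htab

/-- COVARIANCE of the damped-Lipschitz insertion (printed age normalisation): `c♮ ↦ c♮/t`. [folklore] -/
theorem insertionDampedNat_regauge {W : Set (ℕ → ℝ)} {κ c ω : ℝ} (h : M.InsertionDampedNat W κ c ω) :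
    (regauge M s t hs ht).InsertionDampedNat W κ (c / t) ω := by
  intro k g hg U tab tab' D hD htab
  show ‖M.insA g U k tab - M.insA g U k tab'‖ ≤ t * M.rHist k * (c / t * ∑ j ∈ range k, ω ^ (k - 1 - j) * D j)
  rw [show t * M.rHist k * (c / t * ∑ j ∈ range k, ω ^ (k - 1 - j) * D j) =
    M.rHist k * (c * ∑ j ∈ range k, ω ^ (k - 1 - j) * D j) by field_simp]
  exact h k g hg U tab tab' D hD htab

/-- **COVARIANCE OF THE SPECIES FORM**: `DataLipschitz₂ κ Λop Λhist ρ₀` ⟹ the regauged model carries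
`DataLipschitz₂ κ (s·Λop) (t·Λhist) ρ₀′` for every reach `ρ₀′` with `ρ₀′s ≤ ρ₀`, `ρ₀′t ≤ ρ₀` (the regauged reach must stay
inside the original one).  With the rate covariances above: the products `Λop·δ`, `Λhist·δ′`, `Λhist·c` — the ONLY
combinations entering `recursiveRate_of_stepModel_lip₂`'s budget — are GAUGE-INVARIANT, whereas file v5's single modulus
`max Λop Λhist` is NOT (it can be void in one gauge and fire in another: §5). [folklore] -/
theorem dataLipschitz₂_regauge {W : Set (ℕ → ℝ)} {κ Λop Λhist ρ₀ ρ₀' : ℝ} (h : DataLipschitz₂ M W κ Λop Λhist ρ₀)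
    (hρs : ρ₀' * s ≤ ρ₀) (hρt : ρ₀' * t ≤ ρ₀) :
    DataLipschitz₂ (regauge M s t hs ht) W κ (s * Λop) (t * Λhist) ρ₀' := by
  intro k g hg U p hp X hX q hq1 hq2
  have hrOp := M.rOp_pos k
  have hrHist := M.rHist_pos k
  change ‖q.1 - p.1‖ ≤ ρ₀' * (s * M.rOp k) at hq1
  change ‖q.2 - p.2‖ ≤ ρ₀' * (t * M.rHist k) at hq2
  have hq1' : ‖q.1 - p.1‖ ≤ ρ₀ * M.rOp k :=
    hq1.trans (by rw [← mul_assoc]; exact mul_le_mul_of_nonneg_right hρs hrOp.le)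
  have hq2' : ‖q.2 - p.2‖ ≤ ρ₀ * M.rHist k :=
    hq2.trans (by rw [← mul_assoc]; exact mul_le_mul_of_nonneg_right hρt hrHist.le)
  have key := h k g hg U p hp X hX q hq1' hq2'
  show ‖M.Out k q.1 q.2 X - M.Out k p.1 p.2 X‖ ≤
    (s * Λop * (‖q.1 - p.1‖ / (s * M.rOp k)) + t * Λhist * (‖q.2 - p.2‖ / (t * M.rHist k))) * Real.exp (-(κ * C.d X))
  rw [show s * Λop * (‖q.1 - p.1‖ / (s * M.rOp k)) = Λop * (‖q.1 - p.1‖ / M.rOp k) by field_simp,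
    show t * Λhist * (‖q.2 - p.2‖ / (t * M.rHist k)) = Λhist * (‖q.2 - p.2‖ / M.rHist k) by field_simp]
  exact key

/-- **CAUCHY PINS THE GAUGE** (operator fibre): shrinking BOTH margins (`s, t ≤ 1`) keeps `OpFibreEnvelope κ G` with the SAME
envelope constant `G` — fewer directions, smaller history ball, same supremum.  Hence the Cauchy modulus per SHRUNKEN operator
margin is again `G/(1 − ρ₀)` (`opLeg_of_opFibreEnvelope`), not the covariant `s·G/(1 − ρ₀)`: transporting a Cauchy bound to a
smaller gauge LOSES the factor `1/s`, so on the pure Cauchy route the margins are pinned to the analyticity radii and there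
`Gop = Ghist = G` (NUMBERS (f)). [folklore] -/
theorem opFibreEnvelope_regauge {W : Set (ℕ → ℝ)} {κ G : ℝ} (h : M.OpFibreEnvelope W κ G) (hs1 : s ≤ 1) (ht1 : t ≤ 1) :
    (regauge M s t hs ht).OpFibreEnvelope W κ G := by
  intro k g hg U p hp X hX hh hhh u hu
  have hrOp := M.rOp_pos k
  have hrHist := M.rHist_pos k
  change hh ∈ closedBall p.2 (t * M.rHist k) at hhh
  change ‖u‖ ≤ s * M.rOp k at hu
  have hhh' : hh ∈ closedBall p.2 (M.rHist k) :=
    closedBall_subset_closedBall (by nlinarith) hhh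
  have hu' : ‖u‖ ≤ M.rOp k := hu.trans (by nlinarith)
  exact h k g hg U p hp X hX hh hhh' u hu'

/-- **CAUCHY PINS THE GAUGE** (history fibre): the same for `HistFibreEnvelope κ G`. [folklore] -/
theorem histFibreEnvelope_regauge {W : Set (ℕ → ℝ)} {κ G : ℝ} (h : M.HistFibreEnvelope W κ G) (hs1 : s ≤ 1)
    (ht1 : t ≤ 1) : (regauge M s t hs ht).HistFibreEnvelope W κ G := by
  intro k g hg U p hp X hX o ho v hv
  have hrOp := M.rOp_pos k
  have hrHist := M.rHist_pos k
  change o ∈ closedBall p.1 (s * M.rOp k) at ho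
  change ‖v‖ ≤ t * M.rHist k at hv
  have ho' : o ∈ closedBall p.1 (M.rOp k) := closedBall_subset_closedBall (by nlinarith) ho
  have hv' : ‖v‖ ≤ M.rHist k := hv.trans (by nlinarith)
  exact h k g hg U p hp X hX o ho' v hv'

/-- **GAUGE FIXING**: in the operator-margin gauge `s = Λhist/Λop` (`0 < Λhist ≤ Λop`, history margin kept) the species form
`DataLipschitz₂ κ Λop Λhist ρ₀` becomes file v5's SINGLE-modulus form with modulus `Λhist` and the same reach — the
operator sensitivity has been absorbed into the operator margin.  (For `Λop ≤ Λhist` no gauge is needed: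
`dataLipschitz_of_dataLipschitz₂` already gives the single modulus `max Λop Λhist = Λhist`.) [folklore] -/
theorem dataLipschitz_gauge {W : Set (ℕ → ℝ)} {κ Λop Λhist ρ₀ : ℝ} (h : DataLipschitz₂ M W κ Λop Λhist ρ₀)
    (hΛhist : 0 < Λhist) (hle : Λhist ≤ Λop) :
    (regauge M (Λhist / Λop) 1 (div_pos hΛhist (hΛhist.trans_le hle)) one_pos).DataLipschitz W κ Λhist ρ₀ := by
  have hΛop : 0 < Λop := hΛhist.trans_le hle
  have hs1 : Λhist / Λop ≤ 1 := (div_le_one hΛop).mpr hle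
  rcases le_or_gt 0 ρ₀ with hρ₀ | hρ₀
  · have key := dataLipschitz₂_regauge M (div_pos hΛhist hΛop) one_pos h (ρ₀' := ρ₀)
      (by nlinarith) (by rw [mul_one])
    rw [div_mul_cancel₀ _ hΛop.ne', one_mul] at key
    have := dataLipschitz_of_dataLipschitz₂ _ key
    rwa [max_self] at this
  · -- negative reach: the shape is vacuous
    intro k g hg U p hp X hX q hq1 hq2
    exfalso
    have hr : 0 < Λhist / Λop * M.rOp k := mul_pos (div_pos hΛhist hΛop) (M.rOp_pos k)
    have : ρ₀ * (Λhist / Λop * M.rOp k) < 0 := mul_neg_of_neg_of_pos hρ₀ hr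
    exact absurd (hq1.trans_lt this) (not_lt.mpr (norm_nonneg _))

/-- **THE SPECIES CLOSURE IS FILE v5's SINGLE CLOSURE IN THE OPERATOR-MARGIN GAUGE** (the referee's INFO-1 of cell item
GAPS-T4 C-t4r3-17 as a kernel fact).  Hypotheses of `ne5_at_of_stepModel_lip₂_nat` with `0 < Λhist ≤ Λop`; the proof
applies `StepModel.ne5_at_of_stepModel_lip_nat` of `T4InputCauchyRateData` (file v5 §11) to `regauge M (Λhist/Λop) 1`, where
the operator rate reads `δ·Λop/Λhist` regauged margins and the single modulus is `Λhist`.  SAME load-bearing smallness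
`ω + Λhist·c < θ′`, SAME constant `(Λop·δ + Λhist·δ′ + B)(θ′ − ω)/(θ′ − (ω + Λhist·c))`; the gauge is visible in EXACTLY ONE
place — the REACH hypothesis `hnear`, which here reads `(δ·Λop/Λhist + δ′)θ^{k₀} + c(EA₀ + E₀)/(1 − ω) ≤ ρ₀` instead of
`(δ + δ′)θ^{k₀} + …`: a larger `k₀` (more first scales paid in `B`), never a different exponent.  [analysis] So at the
level of the RECURSION the species separation of §2 is the gauge-covariant bookkeeping of v5's estimate, not a sharper
estimate (verbatim for reach-independent moduli such as the toy's; in general at the cost of absolute operator reach); what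
is NOT bookkeeping is the species-by-species Cauchy DISCHARGE of §1 (`dataLipschitz₂_of_fibreEnvelopes` with `Gop ≠ Ghist`),
which v5's diagonal discharge cannot reproduce in any gauge (`opFibreEnvelope_regauge`: a regauged envelope keeps its
constant).  `hnear` is the route's second binder-visible smallness (INFO-2) — a condition on REACH (`c(EA₀ + E₀)/(1 − ω) <
ρ₀`, the two runs' data within mutual reach), gauge-dependent through `δ`, independent of `θ′`. [folklore] -/
theorem ne5_at_of_stepModel_lip₂_nat_of_gauge {EA : Functional C C.BgA} {EB : Functional C C.BgB} {W : Set (ℕ → ℝ)}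
    {κ Λop Λhist EA₀ E₀ δ δ' θ θ' c ω ρ₀ B : ℝ} {k₀ : ℕ} (hrA : M.RepresentsA EA W) (hrB : M.RepresentsB EB W)
    (hbase : M.InBase EB W) (hlip : DataLipschitz₂ M W κ Λop Λhist ρ₀) (hdA : DecayBound EA W EA₀ κ)
    (hdB : DecayBound EB W E₀ κ) (hop : M.OperatorRate W δ θ) (hins : M.InsertionRate W κ E₀ δ' θ)
    (hdamp : M.InsertionDampedNat W κ c ω) (hΛhist : 0 < Λhist) (hle : Λhist ≤ Λop) (hδ : 0 ≤ δ) (hδ' : 0 ≤ δ')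
    (hθ : 0 ≤ θ) (hθθ' : θ ≤ θ') (hθ'1 : θ' ≤ 1) (hc : 0 ≤ c) (hω : 0 < ω)
    (hnear : (δ * (Λop / Λhist) + δ') * θ ^ k₀ + c * (EA₀ + E₀) / (1 - ω) ≤ ρ₀) (hB : 0 ≤ B)
    (hfirst : ∀ k < k₀, EA₀ + E₀ ≤ B * θ ^ k) (hsmall : ω + Λhist * c < θ') :
    NE5 EA EB W κ θ' ((Λop * δ + Λhist * δ' + B) * (θ' - ω) / (θ' - (ω + Λhist * c))) := by
  have hΛop : 0 < Λop := hΛhist.trans_le hle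
  have hs : 0 < Λhist / Λop := div_pos hΛhist hΛop
  have hds : δ / (Λhist / Λop) = δ * (Λop / Λhist) := by
    rw [div_div_eq_mul_div, mul_div_assoc]
  have hop' := operatorRate_regauge M hs one_pos hop
  have hins' := insertionRate_regauge M hs one_pos hins
  have hdamp' := insertionDampedNat_regauge M hs one_pos hdamp
  rw [div_one] at hins' hdamp'
  rw [hds] at hop'
  have key := (regauge M (Λhist / Λop) 1 hs one_pos).ne5_at_of_stepModel_lip_nat hrA hrB hbase
    (dataLipschitz_gauge M hlip hΛhist hle) hdA hdB hop' hins' hdamp' hΛhist.le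
    (add_nonneg (mul_nonneg hδ (div_nonneg hΛop.le hΛhist.le)) hδ') hθ hθθ' hθ'1 hc hω hnear hB hfirst hsmall
  have hconst : Λhist * (δ * (Λop / Λhist) + δ') + B = Λop * δ + Λhist * δ' + B := by
    field_simp
  rwa [hconst] at key

/-- The complementary ordering `Λop ≤ Λhist` needs no gauge: v5's single closure with `Λ = max Λop Λhist = Λhist` fires under
the SAME smallness `ω + Λhist·c < θ′`, constant `(Λhist(δ + δ′) + B)(θ′ − ω)/(θ′ − (ω + Λhist·c))` (`≥` the species constant
by `(Λhist − Λop)δ`, recoverable by the inverse gauge `s = Λhist/Λop ≥ 1` at the price of reach). [folklore] -/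
theorem ne5_at_of_stepModel_lip₂_nat_of_single {EA : Functional C C.BgA} {EB : Functional C C.BgB} {W : Set (ℕ → ℝ)}
    {κ Λop Λhist EA₀ E₀ δ δ' θ θ' c ω ρ₀ B : ℝ} {k₀ : ℕ} (hrA : M.RepresentsA EA W) (hrB : M.RepresentsB EB W)
    (hbase : M.InBase EB W) (hlip : DataLipschitz₂ M W κ Λop Λhist ρ₀) (hdA : DecayBound EA W EA₀ κ)
    (hdB : DecayBound EB W E₀ κ) (hop : M.OperatorRate W δ θ) (hins : M.InsertionRate W κ E₀ δ' θ)
    (hdamp : M.InsertionDampedNat W κ c ω) (hΛop : 0 ≤ Λop) (hle : Λop ≤ Λhist) (hδ : 0 ≤ δ) (hδ' : 0 ≤ δ')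
    (hθ : 0 ≤ θ) (hθθ' : θ ≤ θ') (hθ'1 : θ' ≤ 1) (hc : 0 ≤ c) (hω : 0 < ω)
    (hnear : (δ + δ') * θ ^ k₀ + c * (EA₀ + E₀) / (1 - ω) ≤ ρ₀) (hB : 0 ≤ B)
    (hfirst : ∀ k < k₀, EA₀ + E₀ ≤ B * θ ^ k) (hsmall : ω + Λhist * c < θ') :
    NE5 EA EB W κ θ' ((Λhist * (δ + δ') + B) * (θ' - ω) / (θ' - (ω + Λhist * c))) := by
  have h1 := dataLipschitz_of_dataLipschitz₂ M hlip
  rw [max_eq_right hle] at h1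
  exact M.ne5_at_of_stepModel_lip_nat hrA hrB hbase h1 hdA hdB hop hins hdamp (hΛop.trans hle) (add_nonneg hδ hδ')
    hθ hθθ' hθ'1 hc hω hnear hB hfirst hsmall

end Gauge

/-! ## §5 The toy in the operator-margin gauge `s = 1/64`: file v5's single-modulus closure fires with the species
constant (the referee's witness of C-t4r3-17, reproduced) -/

section ToyGauge

/-- The species toy read with operator margin `1/64` (history margin kept): the referee's `toyModel₆₄r`. [folklore] -/
def toyModel₆₄r : StepModel toyCarriers ℂ ℂ := regauge toyModel₆₄ (1 / 64) 1 (by norm_num) one_pos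

/-- In this gauge the exact moduli are `(1, 1)`, so the SINGLE modulus `Λ = 1` holds for every reach (from
`toy₆₄_dataLipschitz₂` by `dataLipschitz_gauge`). [folklore] -/
theorem toy₆₄r_dataLipschitz (ρ₀ : ℝ) : toyModel₆₄r.DataLipschitz Set.univ 0 1 ρ₀ :=
  dataLipschitz_gauge toyModel₆₄ (toy₆₄_dataLipschitz₂ ρ₀) one_pos (by norm_num)

/-- … the operator rate reads `δ = 64` regauged margins. [folklore] -/
theorem toy₆₄r_operatorRate : toyModel₆₄r.OperatorRate Set.univ 64 (1 / 2) := by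
  have h := operatorRate_regauge toyModel₆₄ (s := 1 / 64) (t := 1) (by norm_num) one_pos toy₆₄_operatorRate
  rw [show (1 : ℝ) / (1 / 64) = 64 by norm_num] at h
  exact h

/-- … the insertion rate is unchanged (`δ′ = 0`, history margin kept). [folklore] -/
theorem toy₆₄r_insertionRate : toyModel₆₄r.InsertionRate Set.univ 0 3 0 (1 / 2) := by
  have h := insertionRate_regauge toyModel₆₄ (s := 1 / 64) (t := 1) (by norm_num) one_pos toy₆₄_insertionRate
  rw [zero_div] at h
  exact h

/-- … the natural damped-Lipschitz bound is unchanged (gain `1/64`, damping `1/64`). [folklore] -/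
theorem toy₆₄r_insertionDampedNat : toyModel₆₄r.InsertionDampedNat Set.univ 0 (1 / 64) (1 / 64) := by
  have h := insertionDampedNat_regauge toyModel₆₄ (s := 1 / 64) (t := 1) (by norm_num) one_pos
    toy₆₄_insertionDampedNat
  rw [div_one] at h
  exact h

/-- **FILE v5's SINGLE-MODULUS CLOSURE FIRES IN THIS GAUGE** with `Λ = 1`, `δ = 64`, `δ′ = 0`, reach `ρ₀ = 70` (near
hypothesis `64 + (1/64)·195/(1 − 1/64) ≤ 70` from the first scale, `k₀ = 0`, `B = 0`), `θ = θ′ = 1/2`, `c = ω = 1/64`: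
smallness `1/64 + 1·(1/64) < 1/2`, constant `(1·(64 + 0) + 0)(31/64)/(30/64) = 992/15` — the SAME rate and constant as the
species closure `toy₆₄_ne5` at unit margins, where every single modulus was void (`toy₆₄_single_closure_void`).  Referee
witness `toy₆₄r_ne5_single` of cell item GAPS-T4 C-t4r3-17 (t4-ref3-g10, `RescaleInline.lean` 8803103275aec08f), reproduced
here through `regauge`. [folklore] -/
theorem toy₆₄r_ne5_single : NE5 toyEA₆₄ toyEB (Set.univ : Set (ℕ → ℝ)) 0 (1 / 2)
    ((1 * (64 + 0) + 0) * (1 / 2 - 1 / 64) / (1 / 2 - (1 / 64 + 1 * (1 / 64)))) :=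
  toyModel₆₄r.ne5_at_of_stepModel_lip_nat (ρ₀ := 70) (B := 0) (k₀ := 0) toy₆₄_representsA toy₆₄_representsB
    toy₆₄_inBase (toy₆₄r_dataLipschitz 70) toy₆₄_decayA toy_decayB toy₆₄r_operatorRate toy₆₄r_insertionRate
    toy₆₄r_insertionDampedNat (by norm_num) (by norm_num) (by norm_num) le_rfl (by norm_num) (by norm_num) (by norm_num)
    (by norm_num) le_rfl (fun k hk => absurd hk (Nat.not_lt_zero k)) (by norm_num)

/-- The same conclusion from the general gauge theorem applied to the UNIT-margin toy with its exact species moduli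
`Λop = 64`, `Λhist = 1` (near hypothesis read in the gauge: `(1·64 + 0)·1 + (1/64)·195/(1 − 1/64) ≤ 70`). [folklore] -/
theorem toy₆₄_ne5_of_gauge : NE5 toyEA₆₄ toyEB (Set.univ : Set (ℕ → ℝ)) 0 (1 / 2)
    ((64 * 1 + 1 * 0 + 0) * (1 / 2 - 1 / 64) / (1 / 2 - (1 / 64 + 1 * (1 / 64)))) :=
  ne5_at_of_stepModel_lip₂_nat_of_gauge toyModel₆₄ (ρ₀ := 70) (B := 0) (k₀ := 0) toy₆₄_representsA toy₆₄_representsB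
    toy₆₄_inBase (toy₆₄_dataLipschitz₂ 70) toy₆₄_decayA toy_decayB toy₆₄_operatorRate toy₆₄_insertionRate
    toy₆₄_insertionDampedNat one_pos (by norm_num) (by norm_num) le_rfl (by norm_num) le_rfl (by norm_num) (by norm_num)
    (by norm_num) (by norm_num) le_rfl (fun k hk => absurd hk (Nat.not_lt_zero k)) (by norm_num)

/-- Both gauge-route constants equal the species constant `992/15` of `toy₆₄_ne5`. [folklore] -/
example : ((1 * (64 + 0) + 0) * (1 / 2 - 1 / 64) / (1 / 2 - (1 / 64 + 1 * (1 / 64))) : ℝ) = 992 / 15 ∧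
    ((64 * 1 + 1 * 0 + 0) * (1 / 2 - 1 / 64) / (1 / 2 - (1 / 64 + 1 * (1 / 64))) : ℝ) = 992 / 15 := by norm_num

end ToyGauge

/-! ## §6 (file v1.2, ADDITIVE) The CLASS READING of the fibre envelopes: a one-run output bound on an admissible CLASS
## that contains the slack box, plus complex differentiability along every complex segment inside the class, IS the pair
## of fibre envelopes of `T4InputCauchyRateData` §11 — same constant for both species -/

section ClassReading

variable {C : Carriers} {Op Hist : Type*} [NormedAddCommGroup Op] [NormedSpace ℂ Op] [NormedAddCommGroup Hist]
  [NormedSpace ℂ Hist] (M : StepModel C Op Hist) (K : ℕ → (ℕ → ℝ) → C.BgB → Set (Op × Hist))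

/-- HYPOTHESIS SHAPE `BoxInClass K` (the SLACK of the class reading): around every base point the two-margin box `box k p`
lies inside the admissible class `K k g U` of step-`k` input data.  Printed support: NONE at the potential level — the
actual total potential `V″` sits inside the one (1.36)-budget `E₀` of Lemma 2 p. 11 at an unprinted depth `d·E₀ =
(1 − μ)E₀`, `μ ≤ 1` being all the print gives (NUMBERS (g′)).  [File v1.2 cited here, as action-level support, [II] p. 21
[R] *"Next, we assume that O(1)C₃ε₁ ≤ ½E₀."*, [R] *"The inequality (2.41) and the assumptions imply the inequality
(I.1.18), with ½E₀ instead of E₀, for the terms of the effective action 𝐄^{(k+1)} in (I.1.3)."* and transported that half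
to the inserted potentials by `InsHomog` — WITHDRAWN by v1.2.1: the half is the small-field output term's action-level
share, the normalization term takes the other half by definition of `E₀`, and Lemma 1 transports the whole history
functional `𝐄_k`, whose (1.36)-image shares ONE budget with the `𝐏^{(k)}`-part.]  [File v1.3: the depth is DISPENSABLE —
for the ball class DILATED by `λ > 1` (Lemma 2's existential (1.36)-constant read as `λC₁`) the slack follows from the
printed BUDGET `μ ≤ 1` alone, §8 `boxInClass_of_baseBudget` / `baseDepth_dilate`, at the print-visible price `G ↦ λG`,
`ε₁`- and `γ`-thresholds `/λ` (NUMBERS (g″)).] [folklore] -/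
def BoxInClass (W : Set (ℕ → ℝ)) : Prop :=
  ∀ k, ∀ g ∈ W, ∀ (U : C.BgB) (p : Op × Hist), p ∈ M.Base k g U → M.box k p ⊆ K k g U

/-- HYPOTHESIS SHAPE `ClassBound K κ G` (printed SUPPORT = the INTERFACE READING of [II] §2: the one-step bound (2.41) p. 21
[R] *"|𝐄^{(k+1)}(X)| ≤ O(1)C₃ε₁exp(−(1−10δ)½Lκd_{k+1}(X))"* is derived for input potentials consumed ONLY through the class
properties of Lemma 2 p. 11 — the unit bound (1.36) p. 9, analyticity on (1.34), localization, gauge invariance — and for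
operators consumed only through their bounds, (1.5) p. 3; NOT PRINTED as a statement quantified over a class `K`): the
one-run output envelope `G·e^{−κd(X)}` holds at EVERY point of the class, not only at the runs' own data. [folklore] -/
def ClassBound (W : Set (ℕ → ℝ)) (κ G : ℝ) : Prop :=
  ∀ k, ∀ g ∈ W, ∀ (U : C.BgB) (q : Op × Hist), q ∈ K k g U → ∀ X : C.Dom, C.scale X = k →
    ‖M.Out k q.1 q.2 X‖ ≤ G * Real.exp (-(κ * C.d X))

/-- HYPOTHESIS SHAPE `ClassLineAnalytic K` ([analysis] of the printed STRUCTURE: each resummed term (2.14) p. 15 of [II]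
carries the potentials through *"exp[Σ_{Y∈𝐃} τ(Y)𝐕_k(Y,B)]"* [R] — an exponential of an expression LINEAR in the
potentials, entire along every complex segment `V + ζv` — and the series (2.13) converges uniformly under the bounds of
Lemma 3 p. 20, the mechanism [II] uses on p. 15 for the analyticity in σ(Z); NOT PRINTED for segments in the potentials):
along every complex segment `ζ ↦ (o + ζu, h + ζv)`, `|ζ| ≤ 1`, that stays inside the class, the step-`k` output at a
step-`k` domain is complex differentiable on the closed unit disc. [folklore] -/
def ClassLineAnalytic (W : Set (ℕ → ℝ)) : Prop :=
  ∀ k, ∀ g ∈ W, ∀ (U : C.BgB) (o u : Op) (h v : Hist),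
    (∀ ζ ∈ closedBall (0 : ℂ) 1, (o + ζ • u, h + ζ • v) ∈ K k g U) → ∀ X : C.Dom, C.scale X = k →
      DifferentiableOn ℂ (fun ζ : ℂ => M.Out k (o + ζ • u) (h + ζ • v) X) (closedBall 0 1)

variable {M K}

/-- An operator segment of length at most the operator margin, at a history datum of the history ball, stays in the box.
[folklore] -/
theorem opSegment_mem_box {k : ℕ} {p : Op × Hist} {h : Hist} (hh : h ∈ closedBall p.2 (M.rHist k)) {u : Op}
    (hu : ‖u‖ ≤ M.rOp k) {ζ : ℂ} (hζ : ζ ∈ closedBall (0 : ℂ) 1) : (p.1 + ζ • u, h) ∈ M.box k p := by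
  rw [mem_closedBall, dist_zero_right] at hζ
  refine Set.mk_mem_prod ?_ hh
  rw [mem_closedBall, dist_eq_norm, add_sub_cancel_left, norm_smul]
  calc ‖ζ‖ * ‖u‖ ≤ 1 * M.rOp k := mul_le_mul hζ hu (norm_nonneg _) zero_le_one
    _ = M.rOp k := one_mul _

/-- A history segment of length at most the history margin, at an operator datum of the operator ball, stays in the box.
[folklore] -/
theorem histSegment_mem_box {k : ℕ} {p : Op × Hist} {o : Op} (ho : o ∈ closedBall p.1 (M.rOp k)) {v : Hist}
    (hv : ‖v‖ ≤ M.rHist k) {ζ : ℂ} (hζ : ζ ∈ closedBall (0 : ℂ) 1) : (o, p.2 + ζ • v) ∈ M.box k p := by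
  rw [mem_closedBall, dist_zero_right] at hζ
  refine Set.mk_mem_prod ho ?_
  rw [mem_closedBall, dist_eq_norm, add_sub_cancel_left, norm_smul]
  calc ‖ζ‖ * ‖v‖ ≤ 1 * M.rHist k := mul_le_mul hζ hv (norm_nonneg _) zero_le_one
    _ = M.rHist k := one_mul _

/-- **CLASS ⟹ OPERATOR FIBRE.**  `BoxInClass K ∧ ClassBound K κ G ∧ ClassLineAnalytic K ⟹ OpFibreEnvelope κ G`: the
operator segment through a base point lies in the box, hence in the class, where the output is bounded by the class bound
and complex differentiable along the segment. [folklore] -/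
theorem opFibreEnvelope_of_class {W : Set (ℕ → ℝ)} {κ G : ℝ} (hbox : BoxInClass M K W) (hbd : ClassBound M K W κ G)
    (hline : ClassLineAnalytic M K W) : M.OpFibreEnvelope W κ G := by
  intro k g hg U p hp X hX h hh u hu
  have hmem : ∀ ζ ∈ closedBall (0 : ℂ) 1, (p.1 + ζ • u, h) ∈ K k g U :=
    fun ζ hζ => hbox k g hg U p hp (opSegment_mem_box hh hu hζ)
  refine ⟨?_, fun ζ hζ => hbd k g hg U _ (hmem ζ hζ) X hX⟩
  have hseg : ∀ ζ ∈ closedBall (0 : ℂ) 1, (p.1 + ζ • u, h + ζ • (0 : Hist)) ∈ K k g U := fun ζ hζ => by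
    simpa only [smul_zero, add_zero] using hmem ζ hζ
  simpa only [smul_zero, add_zero] using hline k g hg U p.1 u h 0 hseg X hX

/-- **CLASS ⟹ HISTORY FIBRE**, symmetrically. [folklore] -/
theorem histFibreEnvelope_of_class {W : Set (ℕ → ℝ)} {κ G : ℝ} (hbox : BoxInClass M K W) (hbd : ClassBound M K W κ G)
    (hline : ClassLineAnalytic M K W) : M.HistFibreEnvelope W κ G := by
  intro k g hg U p hp X hX o ho v hv
  have hmem : ∀ ζ ∈ closedBall (0 : ℂ) 1, (o, p.2 + ζ • v) ∈ K k g U :=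
    fun ζ hζ => hbox k g hg U p hp (histSegment_mem_box ho hv hζ)
  refine ⟨?_, fun ζ hζ => hbd k g hg U _ (hmem ζ hζ) X hX⟩
  have hseg : ∀ ζ ∈ closedBall (0 : ℂ) 1, (o + ζ • (0 : Op), p.2 + ζ • v) ∈ K k g U := fun ζ hζ => by
    simpa only [smul_zero, add_zero] using hmem ζ hζ
  simpa only [smul_zero, add_zero] using hline k g hg U o 0 p.2 v hseg X hX

/-- **THE SPECIES DISCHARGE FROM THE CLASS**: `BoxInClass ∧ ClassBound κ G ∧ ClassLineAnalytic ∧ ρ₀ < 1 ⟹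
DataLipschitz₂ κ (G/(1 − ρ₀)) (G/(1 − ρ₀)) ρ₀` — ONE class constant `G` for both species (a class bound is species-blind).
[folklore] -/
theorem dataLipschitz₂_of_class {W : Set (ℕ → ℝ)} {κ G ρ₀ : ℝ} (hbox : BoxInClass M K W) (hbd : ClassBound M K W κ G)
    (hline : ClassLineAnalytic M K W) (hρ₀ : ρ₀ < 1) : DataLipschitz₂ M W κ (G / (1 - ρ₀)) (G / (1 - ρ₀)) ρ₀ :=
  dataLipschitz₂_of_fibreEnvelopes M (opFibreEnvelope_of_class hbox hbd hline) (histFibreEnvelope_of_class hbox hbd hline)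
    hρ₀

variable (M K) in
/-- **NE5 FROM THE CLASS READING, natural gain, printed age normalisation** — `ne5_at_of_stepModel_fibre₂_scale_nat` with
both fibre envelopes discharged by the class (`Gop = Ghist = G`): representation of the two runs, admissibility of run B's
data, `BoxInClass K`, `ClassBound K κ G`, `ClassLineAnalytic K`, the one-run decay bounds, `OperatorRate δ θ`,
`InsertionRate κ E₀ δ′ θ`, the structural insertion shapes + the single-scale bound `InsScaleBound κ E₁ c ω`, the near
hypothesis and the first scales; smallness `ω + G·c/(1 − ρ₀) < θ′`; constant
`(G(δ + δ′)/(1 − ρ₀) + B)(θ′ − ω)/(θ′ − (ω + G·c/(1 − ρ₀)))` (written species-wise). [folklore] -/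
theorem ne5_at_of_stepModel_class_scale_nat {EA : Functional C C.BgA} {EB : Functional C C.BgB} {W : Set (ℕ → ℝ)}
    {κ G EA₀ E₀ E₁ δ δ' θ θ' c ω ρ₀ B : ℝ} {k₀ : ℕ} (hrA : M.RepresentsA EA W) (hrB : M.RepresentsB EB W)
    (hbase : M.InBase EB W) (hbox : BoxInClass M K W) (hbd : ClassBound M K W κ G) (hline : ClassLineAnalytic M K W)
    (hdA : DecayBound EA W EA₀ κ) (hdB : DecayBound EB W E₀ κ) (hop : M.OperatorRate W δ θ)
    (hins : M.InsertionRate W κ E₀ δ' θ) (haff : M.InsAffine W) (hblind : M.InsBlind W) (hhom : M.InsHomog W)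
    (hunit : M.InsScaleBound W κ E₁ c ω) (hE₁ : 0 < E₁) (hG : 0 ≤ G) (hδ : 0 ≤ δ) (hδ' : 0 ≤ δ') (hθ : 0 ≤ θ)
    (hθθ' : θ ≤ θ') (hθ'1 : θ' ≤ 1) (hc : 0 ≤ c) (hω : 0 < ω) (hρ₀ : ρ₀ < 1)
    (hnear : (δ + δ') * θ ^ k₀ + c * (EA₀ + E₀) / (1 - ω) ≤ ρ₀) (hB : 0 ≤ B) (hfirst : ∀ k < k₀, EA₀ + E₀ ≤ B * θ ^ k)
    (hsmall : ω + G / (1 - ρ₀) * c < θ') :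
    NE5 EA EB W κ θ' ((G / (1 - ρ₀) * δ + G / (1 - ρ₀) * δ' + B) * (θ' - ω) / (θ' - (ω + G / (1 - ρ₀) * c))) :=
  ne5_at_of_stepModel_fibre₂_scale_nat M hrA hrB hbase (opFibreEnvelope_of_class hbox hbd hline)
    (histFibreEnvelope_of_class hbox hbd hline) hdA hdB hop hins haff hblind hhom hunit hE₁ hG hG hδ hδ' hθ hθθ' hθ'1 hc
    hω hρ₀ hnear hB hfirst hsmall

variable (M)

/-- The BALL CLASS: at step `k` (coupling sequence `g`, background `U`) the product of the closed balls of radii `ROp k`,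
`RHist k` around a class centre `ctr k g U` ([analysis] for [II]: centre = the explicit part P₀ of the input potentials
with the step's own operators, history radius = the unit budget E₀ of (1.36) p. 9 in its weighted norm). [folklore] -/
def ballClass (ctr : ℕ → (ℕ → ℝ) → C.BgB → Op × Hist) (ROp RHist : ℕ → ℝ) (k : ℕ) (g : ℕ → ℝ) (U : C.BgB) :
    Set (Op × Hist) :=
  closedBall (ctr k g U).1 (ROp k) ×ˢ closedBall (ctr k g U).2 (RHist k)

/-- HYPOTHESIS SHAPE `BaseDepth ctr ROp RHist`: every base point lies at depth at least the margin inside the ball class,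
species by species: `‖p.1 − ctr.1‖ + rOp ≤ ROp`, `‖p.2 − ctr.2‖ + rHist ≤ RHist`.  Printed support: NONE at the potential
level (depth `d = 1 − μ`, `μ ≤ 1` only, NUMBERS (g′)); file v1.2's gloss «the DEPTH of [II] p. 21 — output at level `½E₀`
of a class of level `E₀`; [analysis] generally at level `νE₀`» described the OUTPUT level `ν`, which is not the depth of
the INPUT potential, and is WITHDRAWN as support by v1.2.1.  [File v1.3: for DILATED radii `BaseDepth` follows from
`BaseBudget` (printed `μ ≤ 1`) — §8 `baseDepth_of_baseBudget`, `baseDepth_dilate`.] [folklore] -/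
def BaseDepth (W : Set (ℕ → ℝ)) (ctr : ℕ → (ℕ → ℝ) → C.BgB → Op × Hist) (ROp RHist : ℕ → ℝ) : Prop :=
  ∀ k, ∀ g ∈ W, ∀ (U : C.BgB) (p : Op × Hist), p ∈ M.Base k g U →
    ‖p.1 - (ctr k g U).1‖ + M.rOp k ≤ ROp k ∧ ‖p.2 - (ctr k g U).2‖ + M.rHist k ≤ RHist k

variable {M}

/-- DEPTH ⟹ SLACK: `BaseDepth ctr ROp RHist ⟹ BoxInClass (ballClass ctr ROp RHist)` (triangle inequality). [folklore] -/
theorem boxInClass_of_baseDepth {W : Set (ℕ → ℝ)} {ctr : ℕ → (ℕ → ℝ) → C.BgB → Op × Hist} {ROp RHist : ℕ → ℝ}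
    (h : BaseDepth M W ctr ROp RHist) : BoxInClass M (ballClass ctr ROp RHist) W := by
  intro k g hg U p hp q hq
  obtain ⟨h1, h2⟩ := h k g hg U p hp
  obtain ⟨hq1, hq2⟩ := Set.mem_prod.1 hq
  rw [mem_closedBall] at hq1 hq2
  refine Set.mem_prod.2 ⟨?_, ?_⟩
  · rw [mem_closedBall]
    calc dist q.1 (ctr k g U).1 ≤ dist q.1 p.1 + dist p.1 (ctr k g U).1 := dist_triangle _ _ _
      _ ≤ M.rOp k + ‖p.1 - (ctr k g U).1‖ := add_le_add hq1 (dist_eq_norm _ _).le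
      _ ≤ ROp k := by linarith
  · rw [mem_closedBall]
    calc dist q.2 (ctr k g U).2 ≤ dist q.2 p.2 + dist p.2 (ctr k g U).2 := dist_triangle _ _ _
      _ ≤ M.rHist k + ‖p.2 - (ctr k g U).2‖ := add_le_add hq2 (dist_eq_norm _ _).le
      _ ≤ RHist k := by linarith

end ClassReading

/-! ## §7 (file v1.2, ADDITIVE) The class reading on the species toy, and the class-gauge census numbers -/

section ToyClass

/-- The toy class centre: the origin of `ℂ × ℂ` at every step. [folklore] -/
def toyCtr : ℕ → (ℕ → ℝ) → toyCarriers.BgB → ℂ × ℂ := fun _ _ _ => (0, 0)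

/-- Toy: the base class `{o = 0, ‖h‖ ≤ 1}` with unit margins sits at depth inside the ball class of radii `ROp = 1`,
`RHist = 2` around the origin. [folklore] -/
theorem toy₆₄_baseDepth : BaseDepth toyModel₆₄ Set.univ toyCtr (fun _ => 1) fun _ => 2 := by
  intro k g _ U p hp
  obtain ⟨hp1, hp2⟩ : p.1 = 0 ∧ ‖p.2‖ ≤ 1 := hp
  refine ⟨?_, ?_⟩
  · show ‖p.1 - 0‖ + 1 ≤ 1
    rw [hp1, sub_zero, norm_zero, zero_add]
  · show ‖p.2 - 0‖ + 1 ≤ 2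
    rw [sub_zero]
    linarith

/-- Toy: the slack — every unit two-margin box around a base point lies in the ball class. [folklore] -/
theorem toy₆₄_boxInClass : BoxInClass toyModel₆₄ (ballClass toyCtr (fun _ => 1) fun _ => 2) Set.univ :=
  boxInClass_of_baseDepth toy₆₄_baseDepth

/-- Toy: the CLASS BOUND — `|64·o + h| ≤ 66` on the ball class `{‖o‖ ≤ 1, ‖h‖ ≤ 2}` (one constant for both species).
[folklore] -/
theorem toy₆₄_classBound : ClassBound toyModel₆₄ (ballClass toyCtr (fun _ => 1) fun _ => 2) Set.univ 0 66 := by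
  intro k g _ U q hq X _
  obtain ⟨hq1, hq2⟩ := Set.mem_prod.1 hq
  rw [mem_closedBall, dist_eq_norm] at hq1 hq2
  have h1 : ‖q.1‖ ≤ 1 := by simpa [toyCtr] using hq1
  have h2 : ‖q.2‖ ≤ 2 := by simpa [toyCtr] using hq2
  show ‖64 * q.1 + q.2‖ ≤ 66 * Real.exp (-(0 * toyCarriers.d X))
  rw [zero_mul, neg_zero, Real.exp_zero, mul_one]
  calc ‖64 * q.1 + q.2‖ ≤ ‖(64 : ℂ) * q.1‖ + ‖q.2‖ := norm_add_le _ _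
    _ = 64 * ‖q.1‖ + ‖q.2‖ := by rw [norm_mul]; norm_num
    _ ≤ 64 * 1 + 2 := by linarith
    _ = 66 := by norm_num

/-- Toy: the output `64·o + h` is entire along every complex segment (inside the class or not). [folklore] -/
theorem toy₆₄_classLineAnalytic : ClassLineAnalytic toyModel₆₄ (ballClass toyCtr (fun _ => 1) fun _ => 2) Set.univ := by
  intro k g _ U o u h v _ X _
  show DifferentiableOn ℂ (fun ζ : ℂ => 64 * (o + ζ • u) + (h + ζ • v)) (closedBall 0 1)
  apply Differentiable.differentiableOn
  fun_prop

/-- Toy: the OPERATOR fibre envelope FROM THE CLASS, constant `66`. [folklore] -/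
theorem toy₆₄_opFibreEnvelope_of_class : toyModel₆₄.OpFibreEnvelope Set.univ 0 66 :=
  opFibreEnvelope_of_class toy₆₄_boxInClass toy₆₄_classBound toy₆₄_classLineAnalytic

/-- Toy: the HISTORY fibre envelope FROM THE CLASS, the SAME constant `66` — against the exact history modulus `1`
(`toy₆₄_dataLipschitz₂`): a class bound is species-blind, so the Cauchy reading charges the history species with the
operator-dominated size of the output. [folklore] -/
theorem toy₆₄_histFibreEnvelope_of_class : toyModel₆₄.HistFibreEnvelope Set.univ 0 66 :=
  histFibreEnvelope_of_class toy₆₄_boxInClass toy₆₄_classBound toy₆₄_classLineAnalytic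

/-- Toy: the species discharge from the class — `DataLipschitz₂` with `Λop = Λhist = 66/(1 − ρ₀)`. [folklore] -/
theorem toy₆₄_dataLipschitz₂_of_class {ρ₀ : ℝ} (hρ₀ : ρ₀ < 1) :
    DataLipschitz₂ toyModel₆₄ Set.univ 0 (66 / (1 - ρ₀)) (66 / (1 - ρ₀)) ρ₀ :=
  dataLipschitz₂_of_class toy₆₄_boxInClass toy₆₄_classBound toy₆₄_classLineAnalytic hρ₀

/-- Toy: on THIS toy the class route is VOID — with the class constant `66` and any natural history gain (`≥ 1/64`,
`toy₆₄_natural_gain_ge`) the smallness `ω + 66·c/(1 − ρ₀) < θ′ ≤ 1` of `ne5_at_of_stepModel_class_scale_nat` cannot hold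
(`66/64 > 1`), while the exact species moduli `(64, 1)` fire (`toy₆₄_ne5`): the class reading is worth exactly
OUTPUT SIZE over MARGIN, the toy's `66/1`, [II]'s `ν/d` (NUMBERS (g′); (g) wrote `ν/(1 − ν)`). [folklore] -/
theorem toy₆₄_class_smallness_void {c ω ρ₀ θ' : ℝ} (hc : toyModel₆₄.InsertionDampedNat Set.univ 0 c ω) (hω : 0 ≤ ω)
    (hρ₀ : 0 ≤ ρ₀) (hρ₀1 : ρ₀ < 1) (hθ' : θ' ≤ 1) : ¬ ω + 66 / (1 - ρ₀) * c < θ' := by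
  have hc64 : 1 / 64 ≤ c := toy₆₄_natural_gain_ge hc
  have h1 : 0 < 1 - ρ₀ := by linarith
  have h66 : (66 : ℝ) ≤ 66 / (1 - ρ₀) := by
    rw [le_div_iff₀ h1]
    nlinarith
  intro hlt
  have : 66 / (1 - ρ₀) * c ≥ 66 * (1 / 64) := mul_le_mul h66 hc64 (by norm_num) (by positivity)
  linarith

/-- [analysis] CLASS-GAUGE CENSUS NUMBERS (NUMBERS (g)/(g′)): at `(d, ν) = (½, ½)` — (g)'s reading of [II] p. 21's
action-level `½` as the depth, identification `μ = ν` (withdrawn as print-backed by (g′); the arithmetic stands) — the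
near-regime reach `2γ₀ν/(d(1 − ω))` with `γ₀ = 1`, `ω = 1/16` equals `32/15 > 1`: the class route is VOID there.
[folklore] -/
example : 2 * 1 * (1 / 2 : ℝ) / ((1 - 1 / 2) * (1 - 1 / 16)) = 32 / 15 ∧ (1 : ℝ) < 32 / 15 := by norm_num

/-- [analysis] NUMBERS (g)/(g′) at `(d, ν) = (9/10, 1/10)` (row `μ = ν`), `γ₀ = 1`, `ω = 1/16`: reach `ρ₀ = 32/135`,
exponent gain `γ₀ν/(d(1 − ρ₀)) = 15/103`, smallness `1/16 + 15/103 < 1/4 = θ′` — every `L^{−a}` with `16^{−a} > 0.2082`,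
i.e. `a < 0.566`, is reached. [folklore] -/
example : 2 * 1 * (1 / 10 : ℝ) / ((1 - 1 / 10) * (1 - 1 / 16)) = 32 / 135 ∧
    1 * (1 / 10 : ℝ) / ((1 - 1 / 10) * (1 - 32 / 135)) = 15 / 103 ∧ (1 : ℝ) / 16 + 15 / 103 < 1 / 4 := by norm_num

/-- [analysis] NUMBERS (g)/(g′) at `(d, ν) = (99/100, 1/100)` (row `μ = ν`): reach `32/1485`, gain `15/1453`, smallness
`1/16 + 15/1453 < 3/40` — `a < 0.945`; as `ν → 0` at fixed `d > 0` the rate tends to the age damping `ω = L^{−1}` itself.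
[folklore] -/
example : 2 * 1 * (1 / 100 : ℝ) / ((1 - 1 / 100) * (1 - 1 / 16)) = 32 / 1485 ∧
    1 * (1 / 100 : ℝ) / ((1 - 1 / 100) * (1 - 32 / 1485)) = 15 / 1453 ∧ (1 : ℝ) / 16 + 15 / 1453 < 3 / 40 := by
  norm_num

/-- (file v1.2.1) [analysis] NUMBERS (g′) at `(d, ν) = (2/5, 1/10)` (illustrative row `μ = ½ + ν`: the normalization
images charged at their nominal action-level half): reach `2γ₀ν/(d(1 − ω)) = 8/15`, exponent gain `γ₀ν/(d(1 − ρ₀)) =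
15/28`, smallness `1/16 + 15/28 = 67/112 < 0.6` — only `a < 0.185`. [folklore] -/
example : 2 * 1 * (1 / 10 : ℝ) / ((2 / 5) * (1 - 1 / 16)) = 8 / 15 ∧
    1 * (1 / 10 : ℝ) / ((2 / 5) * (1 - 8 / 15)) = 15 / 28 ∧ (1 : ℝ) / 16 + 15 / 28 = 67 / 112 ∧
    (67 : ℝ) / 112 < 6 / 10 := by norm_num

/-- (file v1.2.1) [analysis] NUMBERS (g′) at `(d, ν) = (49/100, 1/100)` (row `μ = ½ + ν`): reach `32/735`, gain
`15/703`, smallness `1/16 + 15/703 = 943/11248 < 0.084` — `a < 0.894`; again `a → 1` as `ν → 0` at fixed `d`.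
[folklore] -/
example : 2 * 1 * (1 / 100 : ℝ) / ((49 / 100) * (1 - 1 / 16)) = 32 / 735 ∧
    1 * (1 / 100 : ℝ) / ((49 / 100) * (1 - 32 / 735)) = 15 / 703 ∧ (1 : ℝ) / 16 + 15 / 703 = 943 / 11248 ∧
    (943 : ℝ) / 11248 < 84 / 1000 := by norm_num

end ToyClass

/-! ## §8 (file v1.3, ADDITIVE) SLACK from BUDGET and DILATION: the depth of the class reading needs NO itemization of
## the (1.36)-budget — Lemma 2's constant is existential, so the budget ball may be dilated by any `λ > 1` at a
## print-visible price (class envelope `G ↦ λG` through `ε₂, C₃ ∝ C₁`; `ε₁`-thresholds `↦ /λ`) -/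

section BudgetDilation

variable {C : Carriers} {Op Hist : Type*} [NormedAddCommGroup Op] [NormedSpace ℂ Op] [NormedAddCommGroup Hist]
  [NormedSpace ℂ Hist] (M : StepModel C Op Hist)

/-- HYPOTHESIS SHAPE `BaseBudget ctr BOp BHist` (file v1.3): every base point lies within budget `BOp k`, `BHist k` of the
class centre, species by species; NOTHING is said about the margins.  Printed support, history species: [II] Lemma 2
p. 11 [R] *"the function V″_k(Y, B) satisfies the bound (1.36)"* — the actual TOTAL potential lies in the budget ball of
the weighted norm of (1.36) p. 9 (`μ ≤ 1` in the language of NUMBERS (g′)); operator species: budget `0` (the centre's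
operators ARE the step's operators, DICTIONARY `ballClass`). [folklore] -/
def BaseBudget (W : Set (ℕ → ℝ)) (ctr : ℕ → (ℕ → ℝ) → C.BgB → Op × Hist) (BOp BHist : ℕ → ℝ) : Prop :=
  ∀ k, ∀ g ∈ W, ∀ (U : C.BgB) (p : Op × Hist), p ∈ M.Base k g U →
    ‖p.1 - (ctr k g U).1‖ ≤ BOp k ∧ ‖p.2 - (ctr k g U).2‖ ≤ BHist k

variable {M}

/-- **BUDGET + ROOM ⟹ DEPTH**: if the class radii are at least budget plus margin, species by species, then
`BaseBudget ⟹ BaseDepth` — whatever the composition of the base point inside its budget. [folklore] -/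
theorem baseDepth_of_baseBudget {W : Set (ℕ → ℝ)} {ctr : ℕ → (ℕ → ℝ) → C.BgB → Op × Hist}
    {BOp BHist ROp RHist : ℕ → ℝ} (h : BaseBudget M W ctr BOp BHist) (hOp : ∀ k, BOp k + M.rOp k ≤ ROp k)
    (hHist : ∀ k, BHist k + M.rHist k ≤ RHist k) : BaseDepth M W ctr ROp RHist := by
  intro k g hg U p hp
  obtain ⟨h1, h2⟩ := h k g hg U p hp
  exact ⟨by linarith [hOp k], by linarith [hHist k]⟩

/-- **THE DILATED CLASS**: with margins at most `(l − 1)·BOp`, `(l′ − 1)·BHist`, every base point sits at depth inside the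
ball class of the DILATED radii `l·BOp`, `l′·BHist` — for any dilation factors `l, l′`; the kernel face of reading [II]
Lemma 2's existential constant `C₁` as `λC₁` (NUMBERS (g″)). [folklore] -/
theorem baseDepth_dilate {W : Set (ℕ → ℝ)} {ctr : ℕ → (ℕ → ℝ) → C.BgB → Op × Hist} {BOp BHist : ℕ → ℝ} {l l' : ℝ}
    (h : BaseBudget M W ctr BOp BHist) (hOp : ∀ k, M.rOp k ≤ (l - 1) * BOp k)
    (hHist : ∀ k, M.rHist k ≤ (l' - 1) * BHist k) :
    BaseDepth M W ctr (fun k => l * BOp k) (fun k => l' * BHist k) :=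
  baseDepth_of_baseBudget h (fun k => by have := hOp k; rw [sub_mul, one_mul] at this; linarith)
    (fun k => by have := hHist k; rw [sub_mul, one_mul] at this; linarith)

/-- BUDGET + ROOM ⟹ SLACK for the ball class (`boxInClass_of_baseDepth ∘ baseDepth_of_baseBudget`). [folklore] -/
theorem boxInClass_of_baseBudget {W : Set (ℕ → ℝ)} {ctr : ℕ → (ℕ → ℝ) → C.BgB → Op × Hist}
    {BOp BHist ROp RHist : ℕ → ℝ} (h : BaseBudget M W ctr BOp BHist) (hOp : ∀ k, BOp k + M.rOp k ≤ ROp k)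
    (hHist : ∀ k, BHist k + M.rHist k ≤ RHist k) : BoxInClass M (ballClass ctr ROp RHist) W :=
  boxInClass_of_baseDepth (baseDepth_of_baseBudget h hOp hHist)

variable (M) in
/-- **NE5 FROM BUDGET, ROOM AND THE CLASS BOUND ON THE ROOMY BALL CLASS** — `ne5_at_of_stepModel_class_scale_nat` on the
ball class of radii `ROp ≥ BOp + rOp`, `RHist ≥ BHist + rHist` with its slack discharged by `BaseBudget` (printed `μ ≤ 1`)
instead of an unprinted depth: representation of the two runs, admissibility of run B's data, `BaseBudget ctr BOp BHist`,
the two room inequalities, `ClassBound`/`ClassLineAnalytic` on `ballClass ctr ROp RHist` with class constant `G` (for the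
dilated budget ball of [II], `G = λ·O(1)C₃ε₁`-level, NUMBERS (g″)), the one-run decay bounds, the rates, the structural
insertion shapes + `InsScaleBound`, near hypothesis, first scales; smallness `ω + G·c/(1 − ρ₀) < θ′`. [folklore] -/
theorem ne5_at_of_stepModel_budget_scale_nat {EA : Functional C C.BgA} {EB : Functional C C.BgB} {W : Set (ℕ → ℝ)}
    {ctr : ℕ → (ℕ → ℝ) → C.BgB → Op × Hist} {BOp BHist ROp RHist : ℕ → ℝ}
    {κ G EA₀ E₀ E₁ δ δ' θ θ' c ω ρ₀ B : ℝ} {k₀ : ℕ} (hrA : M.RepresentsA EA W) (hrB : M.RepresentsB EB W)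
    (hbase : M.InBase EB W) (hbud : BaseBudget M W ctr BOp BHist) (hOp : ∀ k, BOp k + M.rOp k ≤ ROp k)
    (hHist : ∀ k, BHist k + M.rHist k ≤ RHist k) (hbd : ClassBound M (ballClass ctr ROp RHist) W κ G)
    (hline : ClassLineAnalytic M (ballClass ctr ROp RHist) W)
    (hdA : DecayBound EA W EA₀ κ) (hdB : DecayBound EB W E₀ κ) (hop : M.OperatorRate W δ θ)
    (hins : M.InsertionRate W κ E₀ δ' θ) (haff : M.InsAffine W) (hblind : M.InsBlind W) (hhom : M.InsHomog W)
    (hunit : M.InsScaleBound W κ E₁ c ω) (hE₁ : 0 < E₁) (hG : 0 ≤ G) (hδ : 0 ≤ δ) (hδ' : 0 ≤ δ') (hθ : 0 ≤ θ)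
    (hθθ' : θ ≤ θ') (hθ'1 : θ' ≤ 1) (hc : 0 ≤ c) (hω : 0 < ω) (hρ₀ : ρ₀ < 1)
    (hnear : (δ + δ') * θ ^ k₀ + c * (EA₀ + E₀) / (1 - ω) ≤ ρ₀) (hB : 0 ≤ B) (hfirst : ∀ k < k₀, EA₀ + E₀ ≤ B * θ ^ k)
    (hsmall : ω + G / (1 - ρ₀) * c < θ') :
    NE5 EA EB W κ θ' ((G / (1 - ρ₀) * δ + G / (1 - ρ₀) * δ' + B) * (θ' - ω) / (θ' - (ω + G / (1 - ρ₀) * c))) :=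
  ne5_at_of_stepModel_class_scale_nat M (ballClass ctr ROp RHist) hrA hrB hbase (boxInClass_of_baseBudget hbud hOp hHist)
    hbd hline hdA hdB hop hins haff hblind hhom hunit hE₁ hG hδ hδ' hθ hθθ' hθ'1 hc hω hρ₀ hnear hB hfirst hsmall

end BudgetDilation

/-! ## §9 (file v1.3, ADDITIVE) Budget and dilation on the species toy; the census numbers of the dilation reading -/

section ToyBudget

/-- Toy: the base class `{o = 0, ‖h‖ ≤ 1}` has budgets `(0, 1)` around the origin — the operator component IS the centre's,
the history component fills the unit budget ball (worst case `μ = 1`). [folklore] -/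
theorem toy₆₄_baseBudget : BaseBudget toyModel₆₄ Set.univ toyCtr (fun _ => 0) fun _ => 1 := by
  intro k g _ U p hp
  obtain ⟨hp1, hp2⟩ : p.1 = 0 ∧ ‖p.2‖ ≤ 1 := hp
  refine ⟨?_, ?_⟩
  · show ‖p.1 - 0‖ ≤ 0
    rw [hp1, sub_zero, norm_zero]
  · show ‖p.2 - 0‖ ≤ 1
    rwa [sub_zero]

/-- Toy: §7's depth statement RE-DERIVED from budget + room — radii `(1, 2) = (0 + 1, 1 + 1)` = budgets plus the unit
margins; the history radius `2 = 2·1` is the budget DILATED by `λ = 2` (margin `(λ − 1)·1 = 1`). [folklore] -/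
example : BaseDepth toyModel₆₄ Set.univ toyCtr (fun _ => 1) fun _ => 2 :=
  baseDepth_of_baseBudget toy₆₄_baseBudget (fun _ => by show (0 : ℝ) + 1 ≤ 1; norm_num)
    fun _ => by show (1 : ℝ) + 1 ≤ 2; norm_num

/-- Toy: the history half as a DILATION instance (`l′ = 2`; the operator half with `l = 1` is degenerate — budget `0`
cannot be dilated into room, the operator radius needs explicit room as in the previous example). [folklore] -/
example : BaseDepth toyModel₆₄ Set.univ toyCtr (fun _ => 1) fun k => 2 * (fun _ : ℕ => (1 : ℝ)) k :=
  baseDepth_of_baseBudget toy₆₄_baseBudget (fun _ => by show (0 : ℝ) + 1 ≤ 1; norm_num)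
    fun _ => by show (1 : ℝ) + 1 ≤ 2 * 1; norm_num

/-- Toy: NE5 on `toyModel₆₄` is NOT obtainable from the budget route either (same class, same void smallness as §7) — the
budget route changes WHERE the slack comes from, not the species-blind price `66/1`. [folklore] -/
example {c ω ρ₀ θ' : ℝ} (hc : toyModel₆₄.InsertionDampedNat Set.univ 0 c ω) (hω : 0 ≤ ω) (hρ₀ : 0 ≤ ρ₀) (hρ₀1 : ρ₀ < 1)
    (hθ' : θ' ≤ 1) : ¬ ω + 66 / (1 - ρ₀) * c < θ' :=
  toy₆₄_class_smallness_void hc hω hρ₀ hρ₀1 hθ'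

/-- (file v1.3) [analysis] NUMBERS (g″) — the DILATION census at `λ = 2`, worst printed budget `μ = 1`, `ν = 1/100`
(`γ₀ = 1`, `ω = 1/16`; effective ratio `ν_eff = λν/(λ − μ) = 1/50` in place of (g′)'s `ν/d`): reach `16/375`, exponent
gain `15/718`, smallness `1/16 + 15/718 = 479/5744 < 0.0834` — `a < 0.895`, with NO unprinted depth constant (price: class
envelope doubled, `ε₁`-thresholds halved). [folklore] -/
example : 2 * 1 * (2 * (1 / 100) / (2 - 1) : ℝ) / (1 - 1 / 16) = 16 / 375 ∧
    (1 * (2 * (1 / 100) / (2 - 1)) : ℝ) / (1 - 16 / 375) = 15 / 718 ∧ (1 : ℝ) / 16 + 15 / 718 = 479 / 5744 ∧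
    (479 : ℝ) / 5744 < 834 / 10000 := by norm_num

/-- (file v1.3) [analysis] NUMBERS (g″) at `λ = 2`, `μ = 1`, `ν = 1/1000` (`ν_eff = 1/500`): reach `8/1875`, gain
`15/7468`, smallness `1/16 + 15/7468 = 1927/29872 < 0.0646` — `a < 0.988`: `a → 1` as `ε₁ → 0` at FIXED `λ`, the
budget being the printed one. [folklore] -/
example : 2 * 1 * (2 * (1 / 1000) / (2 - 1) : ℝ) / (1 - 1 / 16) = 8 / 1875 ∧
    (1 * (2 * (1 / 1000) / (2 - 1)) : ℝ) / (1 - 8 / 1875) = 15 / 7468 ∧ (1 : ℝ) / 16 + 15 / 7468 = 1927 / 29872 ∧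
    (1927 : ℝ) / 29872 < 646 / 10000 := by norm_num

/-- (file v1.3) [analysis] NUMBERS (g″), the dilation is MONOTONE: at `λ = 11`, `μ = 1`, `ν = 1/100` (`ν_eff = 11/1000`)
reach `44/1875`, gain `165/14648`, smallness `2161/29296 < 0.0738` — `a < 0.940`; `ν_eff ↓ ν` as `λ → ∞`, each `λ`
costing `ε₁`-thresholds `/λ`. [folklore] -/
example : 2 * 1 * (11 * (1 / 100) / (11 - 1) : ℝ) / (1 - 1 / 16) = 44 / 1875 ∧
    (1 * (11 * (1 / 100) / (11 - 1)) : ℝ) / (1 - 44 / 1875) = 165 / 14648 ∧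
    (1 : ℝ) / 16 + 165 / 14648 = 2161 / 29296 ∧ (2161 : ℝ) / 29296 < 738 / 10000 := by norm_num

end ToyBudget

/-! ## §10 (file v1.4, ADDITIVE) The budget route under the MARGIN GAUGE, and a NON-VOID end-to-end instance of the
## budget closure on the regauged species toy (vacuity witness: the hypotheses of `ne5_at_of_stepModel_budget_scale_nat`
## are jointly satisfiable with a non-trivial conclusion) -/

section BudgetGauge

variable {C : Carriers} {Op Hist : Type*} [NormedAddCommGroup Op] [NormedSpace ℂ Op] [NormedAddCommGroup Hist]
  [NormedSpace ℂ Hist] (M : StepModel C Op Hist)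

variable {s t : ℝ} (hs : 0 < s) (ht : 0 < t)

/-- GAUGE: the printed STRUCTURE binders do not see the margins. [folklore] -/
theorem regauge_insAffine {W : Set (ℕ → ℝ)} : (regauge M s t hs ht).InsAffine W ↔ M.InsAffine W := Iff.rfl

/-- GAUGE: blindness does not see the margins. [folklore] -/
theorem regauge_insBlind {W : Set (ℕ → ℝ)} : (regauge M s t hs ht).InsBlind W ↔ M.InsBlind W := Iff.rfl

/-- GAUGE: homogeneity does not see the margins. [folklore] -/
theorem regauge_insHomog {W : Set (ℕ → ℝ)} : (regauge M s t hs ht).InsHomog W ↔ M.InsHomog W := Iff.rfl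

/-- COVARIANCE of the single-scale insertion bound: `c ↦ c/t` (history margins `↦ t·rHist`). [folklore] -/
theorem insScaleBound_regauge {W : Set (ℕ → ℝ)} {κ E₁ c ω : ℝ} (h : M.InsScaleBound W κ E₁ c ω) :
    (regauge M s t hs ht).InsScaleBound W κ E₁ (c / t) ω := by
  intro k g hg U tab j hj hsupp hbd
  show ‖M.insA g U k tab - M.insA g U k 0‖ ≤ t * M.rHist k * (c / t * (ω ^ (k - 1 - j) * E₁))
  rw [show t * M.rHist k * (c / t * (ω ^ (k - 1 - j) * E₁)) = M.rHist k * (c * (ω ^ (k - 1 - j) * E₁)) by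
    field_simp]
  exact h k g hg U tab j hj hsupp hbd

/-- GAUGE: the budget of the base class does not see the margins (it is a statement about base points and the centre).
[folklore] -/
theorem regauge_baseBudget {W : Set (ℕ → ℝ)} {ctr : ℕ → (ℕ → ℝ) → C.BgB → Op × Hist} {BOp BHist : ℕ → ℝ} :
    BaseBudget (regauge M s t hs ht) W ctr BOp BHist ↔ BaseBudget M W ctr BOp BHist := Iff.rfl

/-- GAUGE: a class bound does not see the margins (it is a statement about the output map on the class). [folklore] -/
theorem regauge_classBound {K : ℕ → (ℕ → ℝ) → C.BgB → Set (Op × Hist)} {W : Set (ℕ → ℝ)} {κ G : ℝ} :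
    ClassBound (regauge M s t hs ht) K W κ G ↔ ClassBound M K W κ G := Iff.rfl

/-- GAUGE: segment analyticity in the class does not see the margins. [folklore] -/
theorem regauge_classLineAnalytic {K : ℕ → (ℕ → ℝ) → C.BgB → Set (Op × Hist)} {W : Set (ℕ → ℝ)} :
    ClassLineAnalytic (regauge M s t hs ht) K W ↔ ClassLineAnalytic M K W := Iff.rfl

end BudgetGauge

section ToyBudgetFires

/-- The species toy read with operator margin `1/64` and history margin `16`: `toyModel₆₄R`.  In this gauge the operator
rate is `δ = 64`, the natural history gain `c = 1/1024`, and the two-margin box around a base point `(0, h)`, `‖h‖ ≤ 1`,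
is `{‖o‖ ≤ 1/64} × {‖h′ − h‖ ≤ 16}`. [folklore] -/
def toyModel₆₄R : StepModel toyCarriers ℂ ℂ := regauge toyModel₆₄ (1 / 64) 16 (by norm_num) (by norm_num)

/-- Toy: the CLASS BOUND on the roomy ball class of radii `(1/64, 17)` around the origin: `|64·o + h| ≤ 18`. [folklore] -/
theorem toy₆₄_classBound_roomy :
    ClassBound toyModel₆₄ (ballClass toyCtr (fun _ => 1 / 64) fun _ => 17) Set.univ 0 18 := by
  intro k g _ U q hq X _
  obtain ⟨hq1, hq2⟩ := Set.mem_prod.1 hq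
  rw [mem_closedBall, dist_eq_norm] at hq1 hq2
  have h1 : ‖q.1‖ ≤ 1 / 64 := by simpa [toyCtr] using hq1
  have h2 : ‖q.2‖ ≤ 17 := by simpa [toyCtr] using hq2
  show ‖64 * q.1 + q.2‖ ≤ 18 * Real.exp (-(0 * toyCarriers.d X))
  rw [zero_mul, neg_zero, Real.exp_zero, mul_one]
  calc ‖64 * q.1 + q.2‖ ≤ ‖(64 : ℂ) * q.1‖ + ‖q.2‖ := norm_add_le _ _
    _ = 64 * ‖q.1‖ + ‖q.2‖ := by rw [norm_mul]; norm_num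
    _ ≤ 64 * (1 / 64) + 17 := by linarith
    _ = 18 := by norm_num

/-- Toy: segment analyticity of `64·o + h` in the roomy class (it is entire). [folklore] -/
theorem toy₆₄_classLineAnalytic_roomy :
    ClassLineAnalytic toyModel₆₄ (ballClass toyCtr (fun _ => 1 / 64) fun _ => 17) Set.univ := by
  intro k g _ U o u h v _ X _
  show DifferentiableOn ℂ (fun ζ : ℂ => 64 * (o + ζ • u) + (h + ζ • v)) (closedBall 0 1)
  apply Differentiable.differentiableOn
  fun_prop

/-- Toy, regauged: operator rate `δ = 1/(1/64) = 64` at `θ = 1/2`. [folklore] -/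
theorem toy₆₄R_operatorRate : toyModel₆₄R.OperatorRate Set.univ 64 (1 / 2) := by
  have h := operatorRate_regauge toyModel₆₄ (by norm_num : (0 : ℝ) < 1 / 64) (by norm_num : (0 : ℝ) < 16)
    toy₆₄_operatorRate
  rw [show (1 : ℝ) / (1 / 64) = 64 by norm_num] at h
  exact h

/-- Toy, regauged: the two runs insert identically (`δ′ = 0/16 = 0`). [folklore] -/
theorem toy₆₄R_insertionRate : toyModel₆₄R.InsertionRate Set.univ 0 3 0 (1 / 2) := by
  have h := insertionRate_regauge toyModel₆₄ (by norm_num : (0 : ℝ) < 1 / 64) (by norm_num : (0 : ℝ) < 16)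
    toy₆₄_insertionRate
  rw [zero_div] at h
  exact h

/-- Toy, regauged: the single-scale insertion bound at level `3` with gain `(1/64)/16 = 1/1024`. [folklore] -/
theorem toy₆₄R_insScaleBound {ω : ℝ} (hω : 0 ≤ ω) : toyModel₆₄R.InsScaleBound Set.univ 0 3 (1 / 1024) ω := by
  have h := insScaleBound_regauge toyModel₆₄ (by norm_num : (0 : ℝ) < 1 / 64) (by norm_num : (0 : ℝ) < 16)
    (toy_insScaleBound hω : toyModel₆₄.InsScaleBound Set.univ 0 3 (1 / 64) ω)
  rw [show (1 : ℝ) / 64 / 16 = 1 / 1024 by norm_num] at h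
  exact h

/-- **THE BUDGET CLOSURE FIRES ON THE REGAUGED TOY** (vacuity witness for `ne5_at_of_stepModel_budget_scale_nat`): budgets
`(0, 1)` (`toy₆₄_baseBudget`), margins `(1/64, 16)`, room into the ball class of radii `(1/64, 17)`, class constant
`G = 18`, segment analyticity; rates `δ = 64`, `δ′ = 0`, `θ = θ′ = 1/2`; structure binders of file v5's toy; single-scale
gain `c = 1/1024` at `ω = 1/64`, level `E₁ = 3`; decay levels `192 + 3`; reach `ρ₀ = 1/3` from the first scale `k₀ = 9`
(`64·(1/2)^9 + (1/1024)·195/(1 − 1/64) = 107/336 ≤ 1/3`), start-up constant `B = 49920 = 195·2^8`; smallness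
`1/64 + (18/(1 − 1/3))·(1/1024) = 43/1024 < 1/2`.  Contrast `toy₆₄_class_smallness_void` (unit margins: void) — the class
route is worth OUTPUT SIZE over MARGIN, and the margin gauge is free ([analysis]: [II]'s `ν_eff`, NUMBERS (g″)).
[folklore] -/
theorem toy₆₄R_ne5_budget : NE5 toyEA₆₄ toyEB (Set.univ : Set (ℕ → ℝ)) 0 (1 / 2)
    ((18 / (1 - 1 / 3) * 64 + 18 / (1 - 1 / 3) * 0 + 49920) * (1 / 2 - 1 / 64) /
      (1 / 2 - (1 / 64 + 18 / (1 - 1 / 3) * (1 / 1024)))) :=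
  ne5_at_of_stepModel_budget_scale_nat toyModel₆₄R (ctr := toyCtr) (BOp := fun _ => 0) (BHist := fun _ => 1)
    (ROp := fun _ => 1 / 64) (RHist := fun _ => 17) (ρ₀ := 1 / 3) (B := 49920) (k₀ := 9) (E₁ := 3)
    toy₆₄_representsA toy₆₄_representsB toy₆₄_inBase toy₆₄_baseBudget
    (fun k => by show (0 : ℝ) + 1 / 64 * 1 ≤ 1 / 64; norm_num)
    (fun k => by show (1 : ℝ) + 16 * 1 ≤ 17; norm_num)
    toy₆₄_classBound_roomy toy₆₄_classLineAnalytic_roomy toy₆₄_decayA toy_decayB toy₆₄R_operatorRate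
    toy₆₄R_insertionRate toy_insAffine toy_insBlind toy_insHomog (toy₆₄R_insScaleBound (by norm_num)) (by norm_num)
    (by norm_num) (by norm_num) le_rfl (by norm_num) le_rfl (by norm_num) (by norm_num) (by norm_num) (by norm_num)
    (by norm_num) (by norm_num) (fun k hk => by
      have hk' : k ≤ 8 := by omega
      calc (192 : ℝ) + 3 = 49920 * (1 / 2) ^ 8 := by norm_num
        _ ≤ 49920 * (1 / 2) ^ k := by
          apply mul_le_mul_of_nonneg_left _ (by norm_num)
          exact pow_le_pow_of_le_one (by norm_num) (by norm_num) hk')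
    (by norm_num)

/-- [analysis] The instance's numbers: reach `64·2^{−9} + 195/1008 = 107/336 ≤ 1/3` and smallness `1/64 + 27/1024 =
43/1024 < 1/2` (the NE5 constant is `(1728 + 49920)·(31/64)·(1024/469)`, huge and irrelevant: the point is that every
binder of the budget closure is met by a non-degenerate model and the conclusion is a genuine rate `1/2`). [folklore] -/
example : (64 : ℝ) * (1 / 2) ^ 9 + 1 / 1024 * (192 + 3) / (1 - 1 / 64) = 107 / 336 ∧ (107 : ℝ) / 336 ≤ 1 / 3 ∧
    (1 : ℝ) / 64 + 18 / (1 - 1 / 3) * (1 / 1024) = 43 / 1024 ∧ (43 : ℝ) / 1024 < 1 / 2 := by norm_num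

end ToyBudgetFires

end Literature.MathematicalPhysics.QuantumFieldTheory.Balaban1983to89.T4InputCauchyRateSpecies

end
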